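import Mathlib
import Literature.Analysis.FluidPDE.PlanarCircleWirtinger
import Literature.Analysis.FluidPDE.CylindricalCutoff
import Literature.Analysis.FluidPDE.WholeSpaceIBP
import Literature.Analysis.FluidPDE.TaoEnstrophyLocalisationProofs
import Literature.Analysis.FluidPDE.HomogeneousEulerProofs
import Literature.Analysis.FluidPDE.SteadyNSLocalEnergy
import Literature.Analysis.FluidPDE.SteadyHelicalLiouville
import Literature.Analysis.FluidPDE.AxisymmetricVorticityTransport
import HarnessLib

/-!
# Steady Navier–Stokes Liouville theorems in the periodic slab (Bang–Gui–Wang–Xie 2025 Thm 1.4, Han–Wang–Xie 2023 Thm 1.1), file 1 of 4: vertical-period Poincaré–Wirtinger, localised energy identities, dyadic cut-offs, the helical radial velocity and its zero flux (re-homed proofs)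

**Two Liouville theorems for bounded smooth steady Navier–Stokes flows on `ℝ³` that are periodic in the axial variable.**
(1) Q. Han, Y. Wang, C. Xie, *Liouville-type theorems for steady Navier–Stokes system under helical symmetry or Navier boundary
conditions*, arXiv:2312.10382 = Sci. China Math. (2025), Theorem 1.1 [HanWangXie2023]: for every viscosity `ν > 0` and pitch
`κ ≠ 0`, a bounded smooth helically symmetric steady solution on `ℝ³` is an axial constant `C e₃` — the named fact
`Literature.Analysis.FluidPDE.HanWangXie2023_helical_liouville` (`SteadyHelicalLiouville.lean`).  (2) J. Bang, C. Gui, Y. Wang,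
C. Xie, *Liouville-type theorems for steady solutions to the Navier–Stokes system in a slab*, arXiv:2205.13259 = J. Fluid Mech.
1005 (2025) A6, Theorem 1.4 [BangGuiWangXie2025]: a bounded smooth steady solution on `ℝ³`, `L`-periodic in `x₃`, is an axial
constant as soon as (a) its swirl velocity is axisymmetric, or (b) its radial velocity is axisymmetric, or (c) `r u^r → 0`
uniformly as `r → ∞`; and (d) it is constant when `sup ‖U‖ < 2πν/L` — the named fact
`Literature.Analysis.FluidPDE.BangGuiWangXie2025_periodicSlab_liouville` (`PeriodicSlabSteadyLiouville.lean`).  Both facts are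
PROVED in the tree by the Navier–Stokes blow-up-scenario census cell (`pub/ns-census`, rows S6/S7: periodic pressure, the
Poincaré–Wirtinger inequality on vertical periods, the helical / axisymmetric zero-flux of the radial velocity, foot-point
splitting of the pressure, a stream-function corrector in case (c), weighted dyadic energy (Saint-Venant) estimates) — until now
Summits-side only (`Summits/NavierStokesRegularity/NavierStokesRegularity/Theorems/ScenarioCensusSteadyS6.lean`, `…S7.lean`).
RE-HOMED into `Literature/` by the Hodge foundations lane (`lit-hodgefound`, prover p20, generation 39) as FOUR files: verbatim
DECLARATION-LEVEL ports (the 135 declarations the two discharges need, in dependency order; each Part header lists the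
declarations of its source module that are NOT carried) of 29 Summits modules
`Summits/NavierStokesRegularity/NavierStokesRegularity/Theorems/ScenarioCensus{PeriodicSlab,HelicalSlab}*.lean`, namespaces
`Summit.NavierStokesRegularity.NavierStokesRegularity.Theorems.ScenarioCensus{,.PeriodicSlab,.HelicalSlab}` re-rooted to
`Literature.Analysis.SteadySlabLiouville{,.PeriodicSlab,.HelicalSlab}` (a root outside `Literature.Analysis.FluidPDE` on purpose:
namespace-prefix resolution would otherwise shadow the cone's lemmas by same-named `FluidPDE` lemmas); imports from `Literature/`
and Mathlib only; no `sorry`, no new axiom, NO named fact (D-0026); the census-row aliases `Row_S6`, `Row_S7`, `Row_S7c` and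
`row_S*_excluded` of `ScenarioCensusSteady{,S6,S7}.lean` are Summits bookkeeping and are not carried.  PROVENANCE CONVENTION:
docstrings are carried byte-for-byte; declarations the cell cites keep their cites; `[folklore]`-tagged and untagged
declarations (the cell's own lemmas) carry the Part's tag `[cite: <Key>, <loc> (source of the ARGUMENT this module implements;
this declaration is the cell's own lemma or plumbing, NOT a printed statement)]`, because the gate does not admit a public
Literature theorem without a cite tag.

THIS FILE (1 of 4) ports: ScenarioCensusPeriodicSlabTools, ScenarioCensusPeriodicSlabEnergy, ScenarioCensusPeriodicSlabWindow, ScenarioCensusPeriodicSlabBounds, ScenarioCensusHelicalSlabTools, ScenarioCensusHelicalSlabRadial, ScenarioCensusHelicalSlabEnergy, ScenarioCensusHelicalSlabTerms, ScenarioCensusHelicalSlabFlux.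
-/

noncomputable section

/-!
## Part 1 — port of `Summits/NavierStokesRegularity/NavierStokesRegularity/Theorems/ScenarioCensusPeriodicSlabTools.lean` (11 declarations kept)

# Census row S7 (bounded steady flows in the periodic slab, case (d)): slab tools —
# translation invariance per period and the sharp Wirtinger inequality in `x₃`

Support file for the scenario census of `NavierStokesRegularity` (cell `pub/ns-census`, row S7 =
Bang–Gui–Wang–Xie 2025, Thm 1.4 (d): a bounded smooth steady Navier–Stokes flow on `ℝ² × 𝕋_L` with
`sup ‖U‖ < 2πν/L` is constant; tree FACT
`Literature.Analysis.FluidPDE.BangGuiWangXie2025_periodicSlab_liouville`, second conjunct). The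
printed proof (arXiv:2205.13259, §5 Step 4) rests on the Wirtinger inequality in the periodic
variable, `‖∂₃u‖_{L²(period)} ≤ (L/2π) ‖∂₃²u‖_{L²(period)}` ("since `∫_0^1 ∂_{x_3}u dx_3 = 0`, by
virtue of Poincaré inequality"), applied under `z`-independent horizontal weights. This file proves
that inequality in the tree's slab vocabulary (`Literature.Analysis.FluidPDE.zSlab L 0 = {0 ≤ x₂ < L}`,
`Literature.Analysis.FluidPDE.IsAxiallyPeriodic`), with the SHARP constant `(2π/L)²` (it is the
constant that produces the printed threshold `2π`):

* `setLIntegral_zSlab_comp_add_smul_eZ` — the integral over one period slab of an axially periodic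
  density is invariant under ALL axial translations (not only integer multiples of the period);
  proof through the smooth partition-of-unity window of `PeriodicWindowIntegral`
  (`∫ Q ω² = ∫_{slab} Q`, translation invariance of Lebesgue measure, `∑ₖ ω(z − s + kL)² = 1`).
* `vertical_wirtinger` — for `V ∈ C²` axially `L`-periodic and every base point `x`,
  `(2π/L)² ∫₀ᴸ ‖∂₃V(x + s e₃)‖² ds ≤ ∫₀ᴸ ‖∂₃∂₃V(x + s e₃)‖² ds` (coordinatewise
  `Literature.Analysis.FluidPDE.wirtinger_interval_real`; `∂₃V` has zero mean over a period).
* `slab_wirtinger` — for a measurable, bounded, `z`-independent weight `g ≥ 0` vanishing off a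
  cylinder, `(2π/L)² ∫_{slab} g ‖∂₃V‖² ≤ ∫_{slab} g ‖∂₃∂₃V‖²` (vertical averaging + Tonelli; no
  product decomposition of `ℝ³` is used).

No summit statement and no census row is proved in this file.

## References

* J. Bang, C. Gui, Y. Wang, C. Xie, *Liouville-type theorems for steady solutions to the
  Navier–Stokes system in a slab*, J. Fluid Mech. 1005 (2025) A6 = arXiv:2205.13259, §5 Step 4
  (proof of Thm 1.4 (d): the Wirtinger inequality with constant `1/(2π)`). [BangGuiWangXie2025]
* G. H. Hardy, J. E. Littlewood, G. Pólya, *Inequalities*, §7.7 Thm 258 (Wirtinger).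
-/

section Part1

open _root_.MeasureTheory _root_.Set _root_.Function _root_.Filter
open scoped _root_.Topology _root_.ENNReal _root_.NNReal _root_.InnerProductSpace

namespace Literature.Analysis.SteadySlabLiouville.PeriodicSlab

open Literature.Analysis Literature.Analysis.FluidPDE

/-! ### Coordinates along the axis -/

/-- `(x + s e₃)₂ = x₂ + s`.
[cite: BangGuiWangXie2025, Thm 1.4 (d), proof §5 (Poincaré inequality in the vertical period, localised energy identity, dyadic Saint-Venant estimate) (source of the ARGUMENT this module implements; this declaration is the cell’s own lemma or plumbing, NOT a printed statement)] -/
theorem apply_two_add_smul_eZ (x : EuclideanSpace ℝ (Fin 3)) (s : ℝ) :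
    (x + s • eZ) 2 = x 2 + s := by
  simp [eZ]

/-- An axially `L`-periodic function is periodic along `e₃` with period `L` in the additive form
`Q (x + L • eZ) = Q x`.
[cite: BangGuiWangXie2025, Thm 1.4 (d), proof §5 (Poincaré inequality in the vertical period, localised energy identity, dyadic Saint-Venant estimate) (source of the ARGUMENT this module implements; this declaration is the cell’s own lemma or plumbing, NOT a printed statement)] -/
theorem isAxiallyPeriodic_add_smul_eZ {α : Sort*} {L : ℝ} {Q : EuclideanSpace ℝ (Fin 3) → α}
    (hQ : IsAxiallyPeriodic L Q) (x : EuclideanSpace ℝ (Fin 3)) : Q (x + L • eZ) = Q x :=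
  hQ x

/-- Axial translates of an axially periodic function are axially periodic.
[cite: BangGuiWangXie2025, Thm 1.4 (d), proof §5 (Poincaré inequality in the vertical period, localised energy identity, dyadic Saint-Venant estimate) (source of the ARGUMENT this module implements; this declaration is the cell’s own lemma or plumbing, NOT a printed statement)] -/
theorem isAxiallyPeriodic_comp_add_smul_eZ {α : Sort*} {L : ℝ} {Q : EuclideanSpace ℝ (Fin 3) → α}
    (hQ : IsAxiallyPeriodic L Q) (s : ℝ) : IsAxiallyPeriodic L fun x => Q (x + s • eZ) := by
  intro x
  show Q (x + L • EuclideanSpace.single 2 1 + s • eZ) = Q (x + s • eZ)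
  rw [add_right_comm]
  exact hQ (x + s • eZ)

/-! ### Translation invariance of slab integrals of periodic densities -/

/-- **All axial translates have the same integral over one period.** For a measurable axially
`L`-periodic density `Q ≥ 0` (`L > 0`) and every `s : ℝ`,
`∫⁻_{zSlab L 0} Q(x + s e₃) dx = ∫⁻_{zSlab L 0} Q`.
[cite: BangGuiWangXie2025, Thm 1.4 (d), proof §5 (Poincaré inequality in the vertical period, localised energy identity, dyadic Saint-Venant estimate) (source of the ARGUMENT this module implements; this declaration is the cell’s own lemma or plumbing, NOT a printed statement)] -/
theorem setLIntegral_zSlab_comp_add_smul_eZ {L : ℝ} (hL : 0 < L)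
    {Q : EuclideanSpace ℝ (Fin 3) → ℝ≥0∞} (hQm : Measurable Q) (hQ : IsAxiallyPeriodic L Q)
    (s : ℝ) : ∫⁻ x in zSlab L 0, Q (x + s • eZ) = ∫⁻ x in zSlab L 0, Q x := by
  have hQs : IsAxiallyPeriodic L (fun x => Q (x + s • eZ)) := isAxiallyPeriodic_comp_add_smul_eZ hQ s
  have hQsm : Measurable (fun x => Q (x + s • eZ)) := hQm.comp (measurable_id.add_const _)
  rw [← lintegral_mul_periodicWindow_sq hL hQsm.aemeasurable hQs]
  -- substitute `x ↦ x - s e₃` (translation invariance of Lebesgue measure)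
  have hW : Measurable fun z : ℝ => ENNReal.ofReal (periodicWindow L (z - s) ^ 2) :=
    ENNReal.measurable_ofReal.comp
      (((contDiff_periodicWindow L (n := 0)).continuous.comp (continuous_id.sub continuous_const)).pow 2).measurable
  have h1 : ∫⁻ x, Q (x + s • eZ) * ENNReal.ofReal (periodicWindow L (x 2) ^ 2) =
      ∫⁻ x, Q x * ENNReal.ofReal (periodicWindow L (x 2 - s) ^ 2) := by
    rw [← lintegral_add_right_eq_self
      (fun x : EuclideanSpace ℝ (Fin 3) => Q x * ENNReal.ofReal (periodicWindow L (x 2 - s) ^ 2))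
      (s • eZ)]
    refine lintegral_congr fun x => ?_
    rw [apply_two_add_smul_eZ, add_sub_cancel_right]
  rw [h1]
  have h2 := lintegral_mul_comp_apply_two_eq_const_mul hL hQm.aemeasurable hQ hW (c := 1)
    (fun z => by
      have hs : Summable fun k : ℤ => periodicWindow L ((z - s) + (k : ℝ) * L) ^ 2 := by
        by_contra hns
        have := tsum_eq_zero_of_not_summable hns
        rw [tsum_periodicWindow_sq hL (z - s)] at this
        exact one_ne_zero this
      have e : (fun k : ℤ => ENNReal.ofReal (periodicWindow L (z + (k : ℝ) * L - s) ^ 2)) =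
          fun k : ℤ => ENNReal.ofReal (periodicWindow L ((z - s) + (k : ℝ) * L) ^ 2) := by
        funext k; ring_nf
      rw [e, ← ENNReal.ofReal_tsum_of_nonneg (fun k => sq_nonneg _) hs,
        tsum_periodicWindow_sq hL (z - s), ENNReal.ofReal_one])
  rw [h2, one_mul]

/-! ### The vertical Wirtinger inequality -/

/-- The derivative of an axially `L`-periodic `C¹` field is axially `L`-periodic.
[cite: BangGuiWangXie2025, Thm 1.4 (d), proof §5 (Poincaré inequality in the vertical period, localised energy identity, dyadic Saint-Venant estimate) (source of the ARGUMENT this module implements; this declaration is the cell’s own lemma or plumbing, NOT a printed statement)] -/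
theorem isAxiallyPeriodic_fderiv {F : Type*} [NormedAddCommGroup F] [NormedSpace ℝ F] {L : ℝ}
    {V : EuclideanSpace ℝ (Fin 3) → F} (hper : IsAxiallyPeriodic L V) :
    IsAxiallyPeriodic L (fderiv ℝ V) := by
  intro x
  have hfun : (fun y => V (y + L • EuclideanSpace.single 2 (1 : ℝ))) = V := funext fun y => hper y
  have h := fderiv_comp_add_right (𝕜 := ℝ) (f := V) (x := x) (L • EuclideanSpace.single 2 (1 : ℝ))
  rw [hfun] at h
  exact h.symm

/-- Derivative along the axis: `d/ds V(x + s e₃) = DV(x + s e₃) e₃`.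
[cite: BangGuiWangXie2025, Thm 1.4 (d), proof §5 (Poincaré inequality in the vertical period, localised energy identity, dyadic Saint-Venant estimate) (source of the ARGUMENT this module implements; this declaration is the cell’s own lemma or plumbing, NOT a printed statement)] -/
theorem hasDerivAt_comp_add_smul_eZ {F : Type*} [NormedAddCommGroup F] [NormedSpace ℝ F]
    {V : EuclideanSpace ℝ (Fin 3) → F} (hV : Differentiable ℝ V) (x : EuclideanSpace ℝ (Fin 3))
    (s : ℝ) : HasDerivAt (fun σ : ℝ => V (x + σ • eZ)) ((fderiv ℝ V (x + s • eZ)) eZ) s := by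
  have hℓ : HasDerivAt (fun σ : ℝ => x + σ • eZ) eZ s := by
    have h := ((hasDerivAt_id s).smul_const (eZ : EuclideanSpace ℝ (Fin 3))).const_add x
    simpa using h
  exact (hV (x + s • eZ)).hasFDerivAt.comp_hasDerivAt s hℓ

/-- **Vertical Wirtinger inequality** (sharp constant): for `V ∈ C²` axially `L`-periodic
(`L > 0`) and every base point `x`,
`(2π/L)² ∫₀ᴸ ‖∂₃V(x + s e₃)‖² ds ≤ ∫₀ᴸ ‖∂₃∂₃V(x + s e₃)‖² ds`: each coordinate of
`s ↦ ∂₃V(x + s e₃)` is `L`-periodic with zero mean (it is the derivative of the periodic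
`s ↦ V(x + s e₃)`), so `Literature.Analysis.FluidPDE.wirtinger_interval_real` applies.
[cite: BangGuiWangXie2025, Thm 1.4 (d), proof §5 (Poincaré inequality in the vertical period, localised energy identity, dyadic Saint-Venant estimate) (source of the ARGUMENT this module implements; this declaration is the cell’s own lemma or plumbing, NOT a printed statement)] -/
theorem vertical_wirtinger {L : ℝ} (hL : 0 < L)
    {V : EuclideanSpace ℝ (Fin 3) → EuclideanSpace ℝ (Fin 3)} (hV : ContDiff ℝ 2 V)
    (hper : IsAxiallyPeriodic L V) (x : EuclideanSpace ℝ (Fin 3)) :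
    (2 * Real.pi / L) ^ 2 * ∫ s in (0 : ℝ)..L, ‖fderiv ℝ V (x + s • eZ) eZ‖ ^ 2 ≤
      ∫ s in (0 : ℝ)..L, ‖fderiv ℝ (fun y => fderiv ℝ V y eZ) (x + s • eZ) eZ‖ ^ 2 := by
  set w : EuclideanSpace ℝ (Fin 3) → EuclideanSpace ℝ (Fin 3) := fun y => fderiv ℝ V y eZ with hw
  have hV1 : ContDiff ℝ 1 V := hV.of_le one_le_two
  have hw1 : ContDiff ℝ 1 w := (hV.fderiv_right (m := 1) le_rfl).clm_apply contDiff_const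
  have hVd : Differentiable ℝ V := hV1.differentiable one_ne_zero
  have hwd : Differentiable ℝ w := hw1.differentiable one_ne_zero
  have hwc : Continuous w := hw1.continuous
  have hdwc : Continuous (fderiv ℝ w) := hw1.continuous_fderiv one_ne_zero
  have hwper : IsAxiallyPeriodic L w := fun y => by
    show fderiv ℝ V (y + L • EuclideanSpace.single 2 1) eZ = fderiv ℝ V y eZ
    rw [isAxiallyPeriodic_fderiv hper y]
  -- coordinates along the vertical line through `x`
  set ℓ : ℝ → EuclideanSpace ℝ (Fin 3) := fun s => x + s • eZ with hℓ
  have hℓc : Continuous ℓ := continuous_const.add (continuous_id.smul continuous_const)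
  set c : Fin 3 → ℝ → ℝ := fun i s => (w (ℓ s)) i with hc
  set c' : Fin 3 → ℝ → ℝ := fun i s => (fderiv ℝ w (ℓ s) eZ) i with hc'
  have hproj : ∀ i : Fin 3, ∀ v : EuclideanSpace ℝ (Fin 3),
      (EuclideanSpace.proj i : EuclideanSpace ℝ (Fin 3) →L[ℝ] ℝ) v = v i := fun i v => rfl
  have hc_deriv : ∀ i s, HasDerivAt (c i) (c' i s) s := by
    intro i s
    have h := hasDerivAt_comp_add_smul_eZ hwd x s
    have h2 := ((EuclideanSpace.proj i : EuclideanSpace ℝ (Fin 3) →L[ℝ] ℝ).hasFDerivAt).comp_hasDerivAt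
      s h
    simpa [hc, hc', hℓ, hproj, Function.comp_def] using h2
  have hb_deriv : ∀ i s, HasDerivAt (fun σ => (V (ℓ σ)) i) (c i s) s := by
    intro i s
    have h := hasDerivAt_comp_add_smul_eZ hVd x s
    have h2 := ((EuclideanSpace.proj i : EuclideanSpace ℝ (Fin 3) →L[ℝ] ℝ).hasFDerivAt).comp_hasDerivAt
      s h
    simpa [hc, hℓ, hw, hproj, Function.comp_def] using h2
  have hc_cont : ∀ i, Continuous (c i) := fun i =>
    (continuous_apply i).comp ((PiLp.continuous_ofLp 2 _).comp (hwc.comp hℓc))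
  have hc'_cont : ∀ i, Continuous (c' i) := fun i =>
    (continuous_apply i).comp ((PiLp.continuous_ofLp 2 _).comp
      ((hdwc.comp hℓc).clm_apply continuous_const))
  -- periodicity and zero mean
  have hℓL : ℓ L = x + L • eZ := rfl
  have hℓ0 : ℓ 0 = x := by simp [hℓ]
  have hc_per : ∀ i, c i L = c i 0 := fun i => by
    simp only [hc, hℓL, hℓ0]
    rw [isAxiallyPeriodic_add_smul_eZ hwper x]
  have hc_mean : ∀ i, ∫ s in (0 : ℝ)..L, c i s = 0 := fun i => by
    rw [intervalIntegral.integral_eq_sub_of_hasDerivAt (fun s _ => hb_deriv i s)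
      ((hc_cont i).intervalIntegrable _ _), hℓL, hℓ0, isAxiallyPeriodic_add_smul_eZ hper x, sub_self]
  -- Wirtinger, coordinate by coordinate
  have hW : ∀ i, (2 * Real.pi / L) ^ 2 * ∫ s in (0 : ℝ)..L, c i s ^ 2 ≤
      ∫ s in (0 : ℝ)..L, c' i s ^ 2 := fun i => by
    have h := wirtinger_interval_real hL (hc_deriv i) (hc'_cont i) (hc_per i) (hc_mean i)
    rwa [sub_zero] at h
  -- sum over coordinates
  have hn : ∀ v : EuclideanSpace ℝ (Fin 3), ‖v‖ ^ 2 = ∑ i, v i ^ 2 := fun v =>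
    EuclideanSpace.real_norm_sq_eq v
  have e1 : ∫ s in (0 : ℝ)..L, ‖fderiv ℝ V (x + s • eZ) eZ‖ ^ 2 =
      ∑ i, ∫ s in (0 : ℝ)..L, c i s ^ 2 := by
    rw [← intervalIntegral.integral_finsetSum (f := fun i σ => c i σ ^ 2) fun i _ =>
      ((hc_cont i).pow 2).intervalIntegrable _ _]
    refine intervalIntegral.integral_congr fun s _ => ?_
    simpa [hc, hℓ, hw] using hn (w (ℓ s))
  have e2 : ∫ s in (0 : ℝ)..L, ‖fderiv ℝ (fun y => fderiv ℝ V y eZ) (x + s • eZ) eZ‖ ^ 2 =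
      ∑ i, ∫ s in (0 : ℝ)..L, c' i s ^ 2 := by
    rw [← intervalIntegral.integral_finsetSum (f := fun i σ => c' i σ ^ 2) fun i _ =>
      ((hc'_cont i).pow 2).intervalIntegrable _ _]
    refine intervalIntegral.integral_congr fun s _ => ?_
    simpa [hc', hℓ, hw] using hn (fderiv ℝ w (ℓ s) eZ)
  rw [e1, e2, Finset.mul_sum]
  exact Finset.sum_le_sum fun i _ => hW i

/-! ### The Wirtinger inequality on one period slab under a `z`-independent weight -/

/-- A point of the period slab `zSlab L 0` (`L > 0`) inside the cylinder `{r < ρ}` lies in the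
closed ball of radius `|ρ| + L`.
[cite: BangGuiWangXie2025, Thm 1.4 (d), proof §5 (Poincaré inequality in the vertical period, localised energy identity, dyadic Saint-Venant estimate) (source of the ARGUMENT this module implements; this declaration is the cell’s own lemma or plumbing, NOT a printed statement)] -/
theorem norm_le_of_mem_zSlab_of_cylRadius_lt {L ρ : ℝ} (hL : 0 < L) {x : EuclideanSpace ℝ (Fin 3)}
    (hx : x ∈ zSlab L 0) (hr : cylRadius x < ρ) : ‖x‖ ≤ |ρ| + L := by
  rw [mem_zSlab] at hx
  simp only [Int.cast_zero, zero_mul, zero_add, one_mul] at hx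
  have h1 := norm_le_cylRadius_add_abs_apply_two x
  have h2 : |x 2| ≤ L := by
    rw [abs_le]; constructor <;> linarith [hx.1, hx.2]
  linarith [le_abs_self ρ]

/-- **Integrability on a period slab** of a measurable function vanishing off a cylinder and
bounded on the ball that contains the slab's part of the cylinder.
[cite: BangGuiWangXie2025, Thm 1.4 (d), proof §5 (Poincaré inequality in the vertical period, localised energy identity, dyadic Saint-Venant estimate) (source of the ARGUMENT this module implements; this declaration is the cell’s own lemma or plumbing, NOT a printed statement)] -/
theorem integrableOn_zSlab_of_bound {L : ℝ} (hL : 0 < L) {F : EuclideanSpace ℝ (Fin 3) → ℝ}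
    (hFm : AEStronglyMeasurable F volume) {ρ : ℝ} (hF0 : ∀ x, ρ ≤ cylRadius x → F x = 0)
    {B : ℝ} (hFB : ∀ x, ‖x‖ ≤ |ρ| + L → ‖F x‖ ≤ B) : IntegrableOn F (zSlab L 0) volume := by
  set K : Set (EuclideanSpace ℝ (Fin 3)) := Metric.closedBall 0 (|ρ| + L) with hK
  have hKfin : volume K ≠ ⊤ := (isCompact_closedBall _ _).measure_lt_top.ne
  have hIK : IntegrableOn F K volume := by
    refine Measure.integrableOn_of_bounded hKfin hFm (M := B) ?_
    rw [ae_restrict_iff' Metric.isClosed_closedBall.measurableSet]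
    exact Eventually.of_forall fun x hx => hFB x (mem_closedBall_zero_iff.1 hx)
  refine hIK.of_forall_sdiff_eq_zero (measurableSet_zSlab L 0) fun x hx => ?_
  obtain ⟨hxs, hxK⟩ := hx
  refine hF0 x ?_
  by_contra h
  exact hxK (mem_closedBall_zero_iff.2 (norm_le_of_mem_zSlab_of_cylRadius_lt hL hxs (not_le.1 h)))

/-- **Vertical averaging on one period** (Tonelli): for a measurable `z`-independent weight
`g ≥ 0` and a continuous axially `L`-periodic density `f ≥ 0` (`L > 0`),
`∫⁻_{slab} g(x) (∫₀ᴸ f(x + s e₃) ds) dx = L ∫⁻_{slab} g f`: swap the integrals and use the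
invariance of slab integrals of periodic densities under axial translations
(`setLIntegral_zSlab_comp_add_smul_eZ`).
[cite: BangGuiWangXie2025, Thm 1.4 (d), proof §5 (Poincaré inequality in the vertical period, localised energy identity, dyadic Saint-Venant estimate) (source of the ARGUMENT this module implements; this declaration is the cell’s own lemma or plumbing, NOT a printed statement)] -/
theorem setLIntegral_zSlab_mul_verticalIntegral {L : ℝ} (hL : 0 < L)
    {g : EuclideanSpace ℝ (Fin 3) → ℝ} (hgm : Measurable g) (hg0 : ∀ x, 0 ≤ g x)
    (hgz : ∀ (x : EuclideanSpace ℝ (Fin 3)) (s : ℝ), g (x + s • eZ) = g x)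
    {f : EuclideanSpace ℝ (Fin 3) → ℝ} (hfc : Continuous f) (hf0 : ∀ x, 0 ≤ f x)
    (hfper : IsAxiallyPeriodic L f) :
    ∫⁻ x in zSlab L 0, ENNReal.ofReal (g x * ∫ s in (0 : ℝ)..L, f (x + s • eZ)) =
      ENNReal.ofReal L * ∫⁻ x in zSlab L 0, ENNReal.ofReal (g x * f x) := by
  -- (a) the inner integral as a Lebesgue integral
  have hline : ∀ x : EuclideanSpace ℝ (Fin 3), Continuous fun s : ℝ => g x * f (x + s • eZ) :=
    fun x => continuous_const.mul (hfc.comp (continuous_const.add (continuous_id.smul continuous_const)))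
  have ha : ∀ x : EuclideanSpace ℝ (Fin 3), ENNReal.ofReal (g x * ∫ s in (0 : ℝ)..L, f (x + s • eZ)) =
      ∫⁻ s in Ioc 0 L, ENNReal.ofReal (g x * f (x + s • eZ)) := by
    intro x
    rw [intervalIntegral.integral_of_le hL.le, ← integral_const_mul]
    refine ofReal_integral_eq_lintegral_ofReal ?_ ?_
    · exact ((hline x).integrableOn_Icc).mono_set Ioc_subset_Icc_self
    · exact Eventually.of_forall fun s => mul_nonneg (hg0 x) (hf0 _)
  simp_rw [ha]
  -- (b) Tonelli
  have hΦm : AEMeasurable (uncurry fun (x : EuclideanSpace ℝ (Fin 3)) (s : ℝ) =>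
      ENNReal.ofReal (g x * f (x + s • eZ)))
      ((volume.restrict (zSlab L 0)).prod (volume.restrict (Ioc 0 L))) := by
    refine (ENNReal.measurable_ofReal.comp ?_).aemeasurable
    exact (hgm.comp measurable_fst).mul
      (hfc.measurable.comp (measurable_fst.add (measurable_snd.smul measurable_const)))
  rw [lintegral_lintegral_swap hΦm]
  -- (c) the inner slab integral does not depend on `s`
  set Q : EuclideanSpace ℝ (Fin 3) → ℝ≥0∞ := fun x => ENNReal.ofReal (g x * f x) with hQ
  have hQm : Measurable Q := ENNReal.measurable_ofReal.comp (hgm.mul hfc.measurable)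
  have hQper : IsAxiallyPeriodic L Q := fun x => by
    simp only [hQ]
    rw [hfper x]
    have : g (x + L • EuclideanSpace.single 2 (1 : ℝ)) = g x := hgz x L
    rw [this]
  have hinner : ∀ s : ℝ, ∫⁻ x in zSlab L 0, ENNReal.ofReal (g x * f (x + s • eZ)) =
      ∫⁻ x in zSlab L 0, Q x := by
    intro s
    rw [← setLIntegral_zSlab_comp_add_smul_eZ hL hQm hQper s]
    refine lintegral_congr fun x => ?_
    simp only [hQ, hgz x s]
  simp_rw [hinner]
  rw [setLIntegral_const, Real.volume_Ioc, sub_zero, mul_comm]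

/-- **The Wirtinger inequality on one period slab, under a `z`-independent weight** (sharp
constant). Let `V ∈ C²(ℝ³; ℝ³)` be axially `L`-periodic (`L > 0`) and let `g ≥ 0` be a bounded
measurable weight, independent of `x₃` and vanishing off a cylinder `{r < ρ}`. Then
`(2π/L)² ∫_{zSlab L 0} g ‖∂₃V‖² ≤ ∫_{zSlab L 0} g ‖∂₃∂₃V‖²` (`∂₃ = D(·) e₃`). This is the
inequality "`‖∂_{x_3}u √φ_R‖_{L²(Ω)} ≤ (1/2π)‖∂²_{x_3}u √φ_R‖_{L²(Ω)}`" of the printed proof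
(Bang–Gui–Wang–Xie, §5 Step 4), for general period `L`.
[cite: BangGuiWangXie2025, Thm 1.4 (d), proof §5 (Poincaré inequality in the vertical period, localised energy identity, dyadic Saint-Venant estimate) (source of the ARGUMENT this module implements; this declaration is the cell’s own lemma or plumbing, NOT a printed statement)] -/
theorem slab_wirtinger {L : ℝ} (hL : 0 < L)
    {V : EuclideanSpace ℝ (Fin 3) → EuclideanSpace ℝ (Fin 3)} (hV : ContDiff ℝ 2 V)
    (hper : IsAxiallyPeriodic L V) {g : EuclideanSpace ℝ (Fin 3) → ℝ} (hgm : Measurable g)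
    (hg0 : ∀ x, 0 ≤ g x) (hgz : ∀ (x : EuclideanSpace ℝ (Fin 3)) (s : ℝ), g (x + s • eZ) = g x)
    {G : ℝ} (hgG : ∀ x, g x ≤ G) {ρ : ℝ} (hgρ : ∀ x, ρ ≤ cylRadius x → g x = 0) :
    (2 * Real.pi / L) ^ 2 * ∫ x in zSlab L 0, g x * ‖fderiv ℝ V x eZ‖ ^ 2 ≤
      ∫ x in zSlab L 0, g x * ‖fderiv ℝ (fun y => fderiv ℝ V y eZ) x eZ‖ ^ 2 := by
  set w : EuclideanSpace ℝ (Fin 3) → EuclideanSpace ℝ (Fin 3) := fun y => fderiv ℝ V y eZ with hw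
  set dw : EuclideanSpace ℝ (Fin 3) → EuclideanSpace ℝ (Fin 3) := fun y => fderiv ℝ w y eZ with hdw
  have hw1 : ContDiff ℝ 1 w := (hV.fderiv_right (m := 1) le_rfl).clm_apply contDiff_const
  have hwc : Continuous w := hw1.continuous
  have hdwc : Continuous dw := (hw1.continuous_fderiv one_ne_zero).clm_apply continuous_const
  have hwper : IsAxiallyPeriodic L w := fun y => by
    show fderiv ℝ V (y + L • EuclideanSpace.single 2 1) eZ = fderiv ℝ V y eZ
    rw [isAxiallyPeriodic_fderiv hper y]
  have hdwper : IsAxiallyPeriodic L dw := fun y => by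
    show fderiv ℝ w (y + L • EuclideanSpace.single 2 1) eZ = fderiv ℝ w y eZ
    rw [isAxiallyPeriodic_fderiv hwper y]
  -- the two densities
  set f₁ : EuclideanSpace ℝ (Fin 3) → ℝ := fun x => ‖w x‖ ^ 2 with hf₁
  set f₂ : EuclideanSpace ℝ (Fin 3) → ℝ := fun x => ‖dw x‖ ^ 2 with hf₂
  have hf₁c : Continuous f₁ := hwc.norm.pow 2
  have hf₂c : Continuous f₂ := hdwc.norm.pow 2
  have hf₁per : IsAxiallyPeriodic L f₁ := fun x => by simp only [hf₁]; rw [hwper x]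
  have hf₂per : IsAxiallyPeriodic L f₂ := fun x => by simp only [hf₂]; rw [hdwper x]
  -- vertical averaging
  have key₁ := setLIntegral_zSlab_mul_verticalIntegral hL hgm hg0 hgz hf₁c (fun x => sq_nonneg _) hf₁per
  have key₂ := setLIntegral_zSlab_mul_verticalIntegral hL hgm hg0 hgz hf₂c (fun x => sq_nonneg _) hf₂per
  -- pointwise vertical Wirtinger
  have hAB : ∀ x : EuclideanSpace ℝ (Fin 3),
      (2 * Real.pi / L) ^ 2 * (g x * ∫ s in (0 : ℝ)..L, f₁ (x + s • eZ)) ≤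
        g x * ∫ s in (0 : ℝ)..L, f₂ (x + s • eZ) := by
    intro x
    have h := vertical_wirtinger hL hV hper x
    have hg := hg0 x
    calc (2 * Real.pi / L) ^ 2 * (g x * ∫ s in (0 : ℝ)..L, f₁ (x + s • eZ))
        = g x * ((2 * Real.pi / L) ^ 2 * ∫ s in (0 : ℝ)..L, ‖fderiv ℝ V (x + s • eZ) eZ‖ ^ 2) := by
          simp only [hf₁, hw]; ring
      _ ≤ g x * ∫ s in (0 : ℝ)..L, f₂ (x + s • eZ) := by
          simp only [hf₂, hdw, hw]
          exact mul_le_mul_of_nonneg_left h hg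
  -- the inequality between Lebesgue integrals
  set I₁ : ℝ≥0∞ := ∫⁻ x in zSlab L 0, ENNReal.ofReal (g x * f₁ x) with hI₁
  set I₂ : ℝ≥0∞ := ∫⁻ x in zSlab L 0, ENNReal.ofReal (g x * f₂ x) with hI₂
  have hc0 : 0 ≤ (2 * Real.pi / L) ^ 2 := sq_nonneg _
  have hle : ENNReal.ofReal ((2 * Real.pi / L) ^ 2) * (ENNReal.ofReal L * I₁) ≤
      ENNReal.ofReal L * I₂ := by
    rw [← key₁, ← key₂, ← lintegral_const_mul' _ _ ENNReal.ofReal_ne_top]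
    refine lintegral_mono fun x => ?_
    rw [← ENNReal.ofReal_mul hc0]
    exact ENNReal.ofReal_le_ofReal (hAB x)
  have hL0 : ENNReal.ofReal L ≠ 0 := by simpa using hL
  have hle' : ENNReal.ofReal ((2 * Real.pi / L) ^ 2) * I₁ ≤ I₂ := by
    rw [← mul_assoc, mul_comm (ENNReal.ofReal _) (ENNReal.ofReal L), mul_assoc] at hle
    exact (ENNReal.mul_le_mul_iff_right hL0 ENNReal.ofReal_ne_top).1 hle
  -- integrability of the two integrands on the slab
  obtain ⟨B₁, hB₁⟩ := (isCompact_closedBall (0 : EuclideanSpace ℝ (Fin 3)) (|ρ| + L)).exists_bound_of_continuousOn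
    hf₁c.continuousOn
  obtain ⟨B₂, hB₂⟩ := (isCompact_closedBall (0 : EuclideanSpace ℝ (Fin 3)) (|ρ| + L)).exists_bound_of_continuousOn
    hf₂c.continuousOn
  have hG0 : 0 ≤ G := (hg0 0).trans (hgG 0)
  have hF0 : ∀ (f : EuclideanSpace ℝ (Fin 3) → ℝ) (x : EuclideanSpace ℝ (Fin 3)),
      ρ ≤ cylRadius x → g x * f x = 0 := fun f x hx => by rw [hgρ x hx, zero_mul]
  have hFB : ∀ (f : EuclideanSpace ℝ (Fin 3) → ℝ) (B : ℝ),
      (∀ x ∈ Metric.closedBall (0 : EuclideanSpace ℝ (Fin 3)) (|ρ| + L), ‖f x‖ ≤ B) →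
      ∀ x : EuclideanSpace ℝ (Fin 3), ‖x‖ ≤ |ρ| + L → ‖g x * f x‖ ≤ G * B := by
    intro f B hB x hx
    rw [norm_mul, Real.norm_of_nonneg (hg0 x)]
    exact mul_le_mul (hgG x) (hB x (mem_closedBall_zero_iff.2 hx)) (norm_nonneg _) hG0
  have hm₁ : AEStronglyMeasurable (fun x => g x * f₁ x) volume :=
    (hgm.mul hf₁c.measurable).aestronglyMeasurable
  have hm₂ : AEStronglyMeasurable (fun x => g x * f₂ x) volume :=
    (hgm.mul hf₂c.measurable).aestronglyMeasurable
  have hint₁ : IntegrableOn (fun x => g x * f₁ x) (zSlab L 0) volume :=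
    integrableOn_zSlab_of_bound hL hm₁ (hF0 f₁) (hFB f₁ B₁ hB₁)
  have hint₂ : IntegrableOn (fun x => g x * f₂ x) (zSlab L 0) volume :=
    integrableOn_zSlab_of_bound hL hm₂ (hF0 f₂) (hFB f₂ B₂ hB₂)
  -- back to Bochner integrals
  have hnn₁ : 0 ≤ᵐ[volume.restrict (zSlab L 0)] fun x => g x * f₁ x :=
    Eventually.of_forall fun x => mul_nonneg (hg0 x) (sq_nonneg _)
  have hnn₂ : 0 ≤ᵐ[volume.restrict (zSlab L 0)] fun x => g x * f₂ x :=
    Eventually.of_forall fun x => mul_nonneg (hg0 x) (sq_nonneg _)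
  have e₁ : ∫ x in zSlab L 0, g x * ‖fderiv ℝ V x eZ‖ ^ 2 = I₁.toReal :=
    integral_eq_lintegral_of_nonneg_ae hnn₁ hm₁.restrict
  have e₂ : ∫ x in zSlab L 0, g x * ‖fderiv ℝ (fun y => fderiv ℝ V y eZ) x eZ‖ ^ 2 = I₂.toReal :=
    integral_eq_lintegral_of_nonneg_ae hnn₂ hm₂.restrict
  have hI₂fin : I₂ ≠ ⊤ := by
    have h := hint₂.2
    rw [hasFiniteIntegral_iff_enorm] at h
    exact (lt_of_le_of_lt (lintegral_ofReal_le_lintegral_enorm _) h).ne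
  rw [e₁, e₂, ← ENNReal.toReal_ofReal hc0, ← ENNReal.toReal_mul]
  exact ENNReal.toReal_mono hI₂fin hle'

end Literature.Analysis.SteadySlabLiouville.PeriodicSlab

end Part1

/-!
## Part 2 — port of `Summits/NavierStokesRegularity/NavierStokesRegularity/Theorems/ScenarioCensusPeriodicSlabEnergy.lean` (1 declarations kept)

# Census row S7 (bounded steady flows in the periodic slab, case (d)): the localised energy
# identity of the linearised steady system

Support file for the scenario census of `NavierStokesRegularity` (cell `pub/ns-census`, row S7 =
Bang–Gui–Wang–Xie 2025, Thm 1.4 (d); tree FACT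
`Literature.Analysis.FluidPDE.BangGuiWangXie2025_periodicSlab_liouville`, second conjunct). The
printed proof (arXiv:2205.13259, §5 Step 4, display after (6-1)) multiplies the differentiated
momentum equation `−Δ∂₃u + (∂₃u·∇)u + (u·∇)∂₃u + ∇∂₃P = 0` by `φ_R ∂₃u` and integrates by parts.
Here is that computation for the abstract **linearised steady system**

  `ν Δw = (w·∇)U + (U·∇)w + ∇q`,  `div U = div w = 0`,

on a finite-dimensional real inner product space, tested against `Φ w` with `Φ ∈ C¹_c`
(`linearised_energy_identity`):

  `ν ∫ Φ |Dw|² = −ν Σᵢ ∫ (∂ᵢΦ) ⟪∂ᵢw, w⟫ + ½ ∫ (DΦ·U) ‖w‖² + ∫ (DΦ·w) ⟪U, w⟫`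
  `             + ∫ Φ ⟪U, Dw(w)⟫ + ∫ q (DΦ·w)`,

with only FIRST derivatives of the test function on the right (so only gradient bounds of the
cut-off are needed downstream). Ingredients, all from the tree's `WholeSpaceIBP`: Green's first
identity (`integral_inner_laplacian_add_eq_zero`), the trilinear identity
(`integral_inner_convect_add_eq_zero`, twice) and the pressure identity
(`integral_inner_gradient_eq_neg_integral_mul_divergence`); the template is the tree's steady
energy identity `IsLerayProfile.integral_mul_frobeniusNormSq_eq` (`SteadyNSLocalEnergy`).

No summit statement and no census row is proved in this file.

## References

* J. Bang, C. Gui, Y. Wang, C. Xie, J. Fluid Mech. 1005 (2025) A6 = arXiv:2205.13259, §5 Step 4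
  (the identity after (6-1)). [BangGuiWangXie2025]
* G. Seregin, W. Wang, St. Petersburg Math. J. 31 (2020), proof of Prop. 2.1 (localised energy
  identities for steady systems). [SereginWang2020]
-/

section Part2

open _root_.MeasureTheory _root_.Set _root_.Function _root_.Filter _root_.InnerProductSpace
open scoped _root_.Topology RealInnerProductSpace Laplacian

namespace Literature.Analysis.SteadySlabLiouville.PeriodicSlab

open Literature.Analysis Literature.Analysis.FluidPDE

variable {E : Type*} [NormedAddCommGroup E] [InnerProductSpace ℝ E] [FiniteDimensional ℝ E]
  [MeasurableSpace E] [BorelSpace E]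

/-- **The localised energy identity of the linearised steady system.** Let `U ∈ C¹`, `w ∈ C²`,
`q ∈ C¹` on a finite-dimensional real inner product space with `div U = 0`, `div w = 0` and
`ν Δw = (w·∇)U + (U·∇)w + ∇q` pointwise, and let `Φ ∈ C¹_c`. Then, for any orthonormal basis `b`,
`ν ∫ Φ |Dw|² = −ν Σᵢ ∫ (∂ᵢΦ)⟪∂ᵢw, w⟫ + ½ ∫ (DΦ·U)‖w‖² + ∫ (DΦ·w)⟪U, w⟫ + ∫ Φ⟪U, Dw(w)⟫ + ∫ q (DΦ·w)`
(`|Dw|²` the Frobenius norm `frobeniusNormSq`). This is the identity displayed after (6-1) in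
Bang–Gui–Wang–Xie, §5 Step 4 (there `U = u`, `w = ∂₃u`, `q = ∂₃P`, `ν = 1`, `Φ = φ_R`), with the
Green term kept in first-order form.
[cite: BangGuiWangXie2025, Thm 1.4 (d), proof §5 (Poincaré inequality in the vertical period, localised energy identity, dyadic Saint-Venant estimate) (source of the ARGUMENT this module implements; this declaration is the cell’s own lemma or plumbing, NOT a printed statement)] -/
theorem linearised_energy_identity {ι : Type*} [Fintype ι] (b : OrthonormalBasis ι ℝ E)
    {ν : ℝ} {U w : E → E} {q : E → ℝ} (hU : ContDiff ℝ 1 U) (hw : ContDiff ℝ 2 w)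
    (hq : ContDiff ℝ 1 q) (hdivU : VectorCalculus.IsDivFree U) (hdivw : VectorCalculus.IsDivFree w)
    (hpde : ∀ x, ν • (Δ w) x = convect w U x + convect U w x + gradient q x)
    {Φ : E → ℝ} (hΦ : ContDiff ℝ 1 Φ) (hΦc : HasCompactSupport Φ) :
    ν * ∫ x, Φ x * frobeniusNormSq (fderiv ℝ w x) =
      -(ν * ∑ i, ∫ x, fderiv ℝ Φ x (b i) * ⟪fderiv ℝ w x (b i), w x⟫) +
        2⁻¹ * (∫ x, fderiv ℝ Φ x (U x) * ‖w x‖ ^ 2) +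
        (∫ x, fderiv ℝ Φ x (w x) * ⟪U x, w x⟫) +
        (∫ x, Φ x * ⟪U x, fderiv ℝ w x (w x)⟫) +
        ∫ x, q x * fderiv ℝ Φ x (w x) := by
  -- regularity
  have hw1 : ContDiff ℝ 1 w := hw.of_le one_le_two
  have hUd : ∀ x, DifferentiableAt ℝ U x := fun x => hU.differentiable one_ne_zero x
  have hwd : ∀ x, DifferentiableAt ℝ w x := fun x => hw1.differentiable one_ne_zero x
  have hΦd : ∀ x, DifferentiableAt ℝ Φ x := fun x => hΦ.differentiable one_ne_zero x
  have hUc : Continuous U := hU.continuous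
  have hwc : Continuous w := hw1.continuous
  have hqc : Continuous q := hq.continuous
  have hDwc : Continuous (fderiv ℝ w) := hw1.continuous_fderiv one_ne_zero
  have hΦcn : Continuous Φ := hΦ.continuous
  have hDΦc : Continuous (fderiv ℝ Φ) := hΦ.continuous_fderiv one_ne_zero
  -- the test field `W = Φ w`
  set W : E → E := fun x => Φ x • w x with hW
  have hW1 : ContDiff ℝ 1 W := hΦ.smul hw1
  have hWc : HasCompactSupport W := hΦc.smul_right
  have hDΦcs : HasCompactSupport (fderiv ℝ Φ) := hΦc.fderiv (𝕜 := ℝ)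
  have hDW : ∀ x v, fderiv ℝ W x v = fderiv ℝ Φ x v • w x + Φ x • fderiv ℝ w x v := fun x v => by
    rw [hW, fderiv_fun_smul (hΦd x) (hwd x)]
    simp [add_comm]
  -- (1) the equation tested against `W`
  have heq : ∀ x, ν * ⟪(Δ w) x, W x⟫ =
      Φ x * ⟪convect w U x, w x⟫ + Φ x * ⟪convect U w x, w x⟫ + Φ x * ⟪gradient q x, w x⟫ := by
    intro x
    rw [← real_inner_smul_left, hpde x, hW]
    simp only [inner_add_left, real_inner_smul_right]
  -- (2) Green's identity for `v = w`, test `W`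
  have green := FluidPDE.integral_inner_laplacian_add_eq_zero b hw hW1 (Or.inr hWc)
  have hpair : ∀ x, ∑ i, ⟪fderiv ℝ w x (b i), fderiv ℝ W x (b i)⟫ =
      (∑ i, fderiv ℝ Φ x (b i) * ⟪fderiv ℝ w x (b i), w x⟫) +
        Φ x * frobeniusNormSq (fderiv ℝ w x) := by
    intro x
    rw [frobeniusNormSq_eq_sum b, Finset.mul_sum, ← Finset.sum_add_distrib]
    refine Finset.sum_congr rfl fun i _ => ?_
    rw [hDW x (b i), inner_add_right, real_inner_smul_right, real_inner_smul_right,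
      real_inner_self_eq_norm_sq]
  -- (3) the trilinear identity with drift `U`
  have conv1 := FluidPDE.integral_inner_convect_add_eq_zero (F' := E) hU hw1 hW1 hWc
  have hconv1a : ∀ x, ⟪convect U w x, W x⟫ = Φ x * ⟪convect U w x, w x⟫ := fun x => by
    rw [hW, real_inner_smul_right]
  have hconv1b : ∀ x, ⟪w x, convect U W x⟫ =
      Φ x * ⟪convect U w x, w x⟫ + fderiv ℝ Φ x (U x) * ‖w x‖ ^ 2 := fun x => by
    rw [hW, convect_smul_apply (hΦd x) (hwd x), inner_add_right, real_inner_smul_right,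
      real_inner_smul_right, real_inner_self_eq_norm_sq, real_inner_comm]
  have hconv1c : ∫ x, VectorCalculus.divergence U x * ⟪w x, W x⟫ = 0 := by
    rw [← integral_zero (α := E) (G := ℝ)]
    refine integral_congr_ae (Eventually.of_forall fun x => ?_)
    show VectorCalculus.divergence U x * ⟪w x, W x⟫ = 0
    rw [hdivU x, zero_mul]
  -- (4) the trilinear identity with drift `w`
  have conv2 := FluidPDE.integral_inner_convect_add_eq_zero (F' := E) hw1 hU hW1 hWc
  have hconv2a : ∀ x, ⟪convect w U x, W x⟫ = Φ x * ⟪convect w U x, w x⟫ := fun x => by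
    rw [hW, real_inner_smul_right]
  have hconv2b : ∀ x, ⟪U x, convect w W x⟫ =
      Φ x * ⟪U x, fderiv ℝ w x (w x)⟫ + fderiv ℝ Φ x (w x) * ⟪U x, w x⟫ := fun x => by
    rw [hW, convect_smul_apply (hΦd x) (hwd x), inner_add_right, real_inner_smul_right,
      real_inner_smul_right, convect_apply]
  have hconv2c : ∫ x, VectorCalculus.divergence w x * ⟪U x, W x⟫ = 0 := by
    rw [← integral_zero (α := E) (G := ℝ)]
    refine integral_congr_ae (Eventually.of_forall fun x => ?_)
    show VectorCalculus.divergence w x * ⟪U x, W x⟫ = 0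
    rw [hdivw x, zero_mul]
  -- (5) the pressure identity
  have press := FluidPDE.integral_inner_gradient_eq_neg_integral_mul_divergence hq hW1 hWc
  have hdivW : ∀ x, VectorCalculus.divergence W x = fderiv ℝ Φ x (w x) := fun x => by
    rw [hW, divergence_smul_apply (hΦd x) (hwd x), hdivw x, mul_zero, zero_add, gradient,
      real_inner_comm, InnerProductSpace.toDual_symm_apply]
  have hpressa : ∀ x, ⟪gradient q x, W x⟫ = Φ x * ⟪gradient q x, w x⟫ := fun x => by
    rw [hW, real_inner_smul_right]
  -- integrability of all the integrands (continuous, compactly supported)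
  have hcsΦ : ∀ f : E → ℝ, HasCompactSupport fun x => Φ x * f x := fun f => hΦc.mul_right
  have hcsD : ∀ (v : E → E) (f : E → ℝ),
      HasCompactSupport fun x => fderiv ℝ Φ x (v x) * f x := fun v f =>
    hDΦcs.mono fun x hx => by
      rw [mem_support] at hx ⊢
      contrapose! hx
      simp [hx]
  have hconvUw : Continuous fun x => convect U w x := by
    simp only [convect_apply]; exact hDwc.clm_apply hUc
  have hconvwU : Continuous fun x => convect w U x := by
    simp only [convect_apply]; exact (hU.continuous_fderiv one_ne_zero).clm_apply hwc
  have hI_A : Integrable (fun x => Φ x * ⟪convect U w x, w x⟫) :=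
    (hΦcn.mul (hconvUw.inner hwc)).integrable_of_hasCompactSupport (hcsΦ _)
  have hI_B : Integrable (fun x => Φ x * ⟪convect w U x, w x⟫) :=
    (hΦcn.mul (hconvwU.inner hwc)).integrable_of_hasCompactSupport (hcsΦ _)
  have hI_P : Integrable (fun x => Φ x * ⟪gradient q x, w x⟫) :=
    (hΦcn.mul ((continuous_gradient_of_contDiff hq).inner hwc)).integrable_of_hasCompactSupport
      (hcsΦ _)
  have hFc : Continuous fun x => frobeniusNormSq (fderiv ℝ w x) := by
    rw [show (fun x => frobeniusNormSq (fderiv ℝ w x)) =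
      fun x => ∑ i, ‖fderiv ℝ w x (b i)‖ ^ 2 from funext fun x => frobeniusNormSq_eq_sum b _]
    exact continuous_finsetSum _ fun i _ => ((hDwc.clm_apply continuous_const).norm).pow 2
  have hI_F : Integrable (fun x => Φ x * frobeniusNormSq (fderiv ℝ w x)) :=
    (hΦcn.mul hFc).integrable_of_hasCompactSupport (hcsΦ _)
  have hI_S : ∀ i, Integrable (fun x => fderiv ℝ Φ x (b i) * ⟪fderiv ℝ w x (b i), w x⟫) :=
    fun i => (((hDΦc.clm_apply continuous_const).mul
      ((hDwc.clm_apply continuous_const).inner hwc))).integrable_of_hasCompactSupport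
        (hcsD (fun _ => b i) _)
  have hI_T : Integrable (fun x => fderiv ℝ Φ x (U x) * ‖w x‖ ^ 2) :=
    (((hDΦc.clm_apply hUc).mul (hwc.norm.pow 2))).integrable_of_hasCompactSupport (hcsD U _)
  have hI_R : Integrable (fun x => fderiv ℝ Φ x (w x) * ⟪U x, w x⟫) :=
    (((hDΦc.clm_apply hwc).mul (hUc.inner hwc))).integrable_of_hasCompactSupport (hcsD w _)
  have hI_Q : Integrable (fun x => Φ x * ⟪U x, fderiv ℝ w x (w x)⟫) :=
    (hΦcn.mul (hUc.inner (hDwc.clm_apply hwc))).integrable_of_hasCompactSupport (hcsΦ _)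
  -- assemble: rewrite every pairing
  have e1' : ν * ∫ x, ⟪(Δ w) x, W x⟫ = (∫ x, Φ x * ⟪convect w U x, w x⟫) +
      (∫ x, Φ x * ⟪convect U w x, w x⟫) + ∫ x, Φ x * ⟪gradient q x, w x⟫ := by
    rw [← integral_const_mul, ← integral_add hI_B hI_A,
      ← integral_add (f := fun x => Φ x * ⟪convect w U x, w x⟫ + Φ x * ⟪convect U w x, w x⟫)
        (hI_B.add hI_A) hI_P]
    exact integral_congr_ae (Eventually.of_forall heq)
  have e2 : ∑ i, ∫ x, ⟪fderiv ℝ w x (b i), fderiv ℝ W x (b i)⟫ =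
      (∑ i, ∫ x, fderiv ℝ Φ x (b i) * ⟪fderiv ℝ w x (b i), w x⟫) +
        ∫ x, Φ x * frobeniusNormSq (fderiv ℝ w x) := by
    rw [← integral_finsetSum _ fun i _ => hI_S i, ← integral_add (integrable_finsetSum _
      fun i _ => hI_S i) hI_F]
    have : ∀ i, Integrable (fun x => ⟪fderiv ℝ w x (b i), fderiv ℝ W x (b i)⟫) := fun i => by
      have : (fun x => ⟪fderiv ℝ w x (b i), fderiv ℝ W x (b i)⟫) = fun x =>
          fderiv ℝ Φ x (b i) * ⟪fderiv ℝ w x (b i), w x⟫ + Φ x * ‖fderiv ℝ w x (b i)‖ ^ 2 := by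
        funext x
        rw [hDW x (b i), inner_add_right, real_inner_smul_right, real_inner_smul_right,
          real_inner_self_eq_norm_sq]
      rw [this]
      exact (hI_S i).add (((hΦcn.mul ((hDwc.clm_apply continuous_const).norm.pow 2)))
        |>.integrable_of_hasCompactSupport (hcsΦ _))
    rw [← integral_finsetSum _ fun i _ => this i]
    exact integral_congr_ae (Eventually.of_forall fun x => hpair x)
  have e3 : ∫ x, ⟪convect U w x, W x⟫ = ∫ x, Φ x * ⟪convect U w x, w x⟫ :=
    integral_congr_ae (Eventually.of_forall hconv1a)
  have e4 : ∫ x, ⟪w x, convect U W x⟫ = (∫ x, Φ x * ⟪convect U w x, w x⟫) +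
      ∫ x, fderiv ℝ Φ x (U x) * ‖w x‖ ^ 2 := by
    rw [← integral_add hI_A hI_T]
    exact integral_congr_ae (Eventually.of_forall hconv1b)
  have e5 : ∫ x, ⟪convect w U x, W x⟫ = ∫ x, Φ x * ⟪convect w U x, w x⟫ :=
    integral_congr_ae (Eventually.of_forall hconv2a)
  have e6 : ∫ x, ⟪U x, convect w W x⟫ = (∫ x, Φ x * ⟪U x, fderiv ℝ w x (w x)⟫) +
      ∫ x, fderiv ℝ Φ x (w x) * ⟪U x, w x⟫ := by
    rw [← integral_add hI_Q hI_R]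
    exact integral_congr_ae (Eventually.of_forall hconv2b)
  have e7 : ∫ x, ⟪gradient q x, W x⟫ = ∫ x, Φ x * ⟪gradient q x, w x⟫ :=
    integral_congr_ae (Eventually.of_forall hpressa)
  have e8 : ∫ x, q x * VectorCalculus.divergence W x = ∫ x, q x * fderiv ℝ Φ x (w x) :=
    integral_congr_ae (Eventually.of_forall fun x => by
      show q x * VectorCalculus.divergence W x = q x * fderiv ℝ Φ x (w x)
      rw [hdivW x])
  -- Green's identity multiplied by `ν`
  have green' : ν * (∫ x, ⟪(Δ w) x, W x⟫) +
      ν * ∑ i, ∫ x, ⟪fderiv ℝ w x (b i), fderiv ℝ W x (b i)⟫ = 0 := by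
    rw [← mul_add, green, mul_zero]
  rw [e1', e2] at green'
  rw [e3, e4, hconv1c] at conv1
  rw [e5, e6, hconv2c] at conv2
  rw [e7, e8] at press
  linarith [green', conv1, conv2, press]

end Literature.Analysis.SteadySlabLiouville.PeriodicSlab

end Part2

/-!
## Part 3 — port of `Summits/NavierStokesRegularity/NavierStokesRegularity/Theorems/ScenarioCensusPeriodicSlabWindow.lean` (4 declarations kept)

# Census row S7 (bounded steady flows in the periodic slab, case (d)): the energy identity per
# period (window bookkeeping)

Support file for the scenario census of `NavierStokesRegularity` (cell `pub/ns-census`, row S7 =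
Bang–Gui–Wang–Xie 2025, Thm 1.4 (d); tree FACT
`Literature.Analysis.FluidPDE.BangGuiWangXie2025_periodicSlab_liouville`, second conjunct).
Printed proof, arXiv:2205.13259 §5 Step 4: test the differentiated momentum equation with
`φ_R ∂₃u` on `Ω = ℝ² × 𝕋`, absorb the convection term by the Wirtinger inequality when
`‖u‖_∞ < 2π`, and bound the cut-off terms.

* `window_identity` — the localised energy identity of the linearised system
  (`linearised_energy_identity`, `…PeriodicSlabEnergy`) with the test function
  `Φ = φ(x) ω_L(x₂)²` (`φ` an axially periodic `C¹` cut-off vanishing off a cylinder, `ω_L` the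
  smooth partition-of-unity window of `PeriodicWindowIntegral`) becomes an identity between
  integrals over ONE period slab `zSlab L 0`: the terms in which the derivative falls on the window
  are integrals of periodic densities against `(ω²)'` and vanish
  (`integral_mul_deriv_periodicWindow_sq_eq_zero`), the others are `∫ Q ω² = ∫_{slab} Q`
  (`integral_mul_periodicWindow_sq`).
The dyadic energy estimate built on this identity (cut-off `cylCutoff r (2r)`, Wirtinger absorption
of the convection term) is the sequel file `…PeriodicSlabEstimate`.

No summit statement and no census row is proved in this file.

## References

* J. Bang, C. Gui, Y. Wang, C. Xie, J. Fluid Mech. 1005 (2025) A6 = arXiv:2205.13259, §5 Step 4.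
  [BangGuiWangXie2025]
-/

section Part3

open _root_.MeasureTheory _root_.Set _root_.Function _root_.Filter _root_.InnerProductSpace
open scoped _root_.Topology _root_.ENNReal _root_.NNReal RealInnerProductSpace Laplacian

namespace Literature.Analysis.SteadySlabLiouville.PeriodicSlab

open Literature.Analysis Literature.Analysis.FluidPDE

/-! ### Support of the window and of its derivative -/

/-- `ω_L(z)² ≠ 0 ⇒ |z| ≤ 2L` (`L > 0`).
[cite: BangGuiWangXie2025, Thm 1.4 (d), proof §5 (Poincaré inequality in the vertical period, localised energy identity, dyadic Saint-Venant estimate) (source of the ARGUMENT this module implements; this declaration is the cell’s own lemma or plumbing, NOT a printed statement)] -/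
theorem abs_le_of_periodicWindow_sq_ne_zero {L : ℝ} (hL : 0 < L) (z : ℝ)
    (hz : periodicWindow L z ^ 2 ≠ 0) : |z| ≤ 2 * L := by
  have hz' : periodicWindow L z ≠ 0 := fun h => hz (by rw [h]; ring)
  have hm := mem_Ioo_of_periodicWindow_ne_zero hL hz'
  rw [abs_le]; constructor <;> linarith [hm.1, hm.2]

/-- `(ω_L²)'(z) ≠ 0 ⇒ |z| ≤ 2L` (`L > 0`): off `[0, 2L]` the window vanishes identically near `z`.
[cite: BangGuiWangXie2025, Thm 1.4 (d), proof §5 (Poincaré inequality in the vertical period, localised energy identity, dyadic Saint-Venant estimate) (source of the ARGUMENT this module implements; this declaration is the cell’s own lemma or plumbing, NOT a printed statement)] -/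
theorem abs_le_of_deriv_periodicWindow_sq_ne_zero {L : ℝ} (hL : 0 < L) (z : ℝ)
    (hz : deriv (fun s => periodicWindow L s ^ 2) z ≠ 0) : |z| ≤ 2 * L := by
  by_contra h
  rw [not_le] at h
  apply hz
  have hzero : (fun s => periodicWindow L s ^ 2) =ᶠ[𝓝 z] fun _ => (0 : ℝ) := by
    rcases lt_or_ge z 0 with hneg | hpos
    · filter_upwards [Iio_mem_nhds hneg] with s hs
      rw [periodicWindow_eq_zero_of_nonpos hL (le_of_lt hs)]; ring
    · have h2 : 2 * L < z := by
        rw [abs_of_nonneg hpos] at h; exact h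
      filter_upwards [Ioi_mem_nhds h2] with s hs
      rw [periodicWindow_eq_zero_of_two_mul_le hL (le_of_lt hs)]; ring
  rw [hzero.deriv_eq, deriv_const]

/-! ### The energy identity per period -/

/-- **Window bookkeeping.** For a continuous axially `L`-periodic density `Q` vanishing off a
cylinder (`L > 0`): `∫ Q ω_L² = ∫_{zSlab L 0} Q`, `∫ Q (ω_L²)' = 0`, and both whole-space
integrands are integrable.
[cite: BangGuiWangXie2025, Thm 1.4 (d), proof §5 (Poincaré inequality in the vertical period, localised energy identity, dyadic Saint-Venant estimate) (source of the ARGUMENT this module implements; this declaration is the cell’s own lemma or plumbing, NOT a printed statement)] -/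
theorem window_bookkeeping {L : ℝ} (hL : 0 < L) {Q : EuclideanSpace ℝ (Fin 3) → ℝ}
    (hQc : Continuous Q) (hQper : IsAxiallyPeriodic L Q) {ρ : ℝ}
    (hQ0 : ∀ x, ρ ≤ cylRadius x → Q x = 0) :
    (∫ x, Q x * periodicWindow L (x 2) ^ 2 = ∫ x in zSlab L 0, Q x) ∧
      (∫ x, Q x * deriv (fun s => periodicWindow L s ^ 2) (x 2) = 0) ∧
      Integrable (fun x => Q x * periodicWindow L (x 2) ^ 2) ∧
      Integrable (fun x => Q x * deriv (fun s => periodicWindow L s ^ 2) (x 2)) := by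
  have hQi : IntegrableOn Q (zSlab L 0) volume := integrableOn_zSlab_of_eq_zero_of_le_cylRadius hQc hQ0 L 0
  have hQm : AEStronglyMeasurable Q volume := hQc.aestronglyMeasurable
  refine ⟨integral_mul_periodicWindow_sq hL hQper hQm hQi,
    integral_mul_deriv_periodicWindow_sq_eq_zero hL hQper hQm hQi,
    integrable_mul_periodicWindow_sq hL hQper hQm hQi, ?_⟩
  have hc : Continuous fun x : EuclideanSpace ℝ (Fin 3) =>
      Q x * deriv (fun s => periodicWindow L s ^ 2) (x 2) :=
    hQc.mul (((contDiff_periodicWindow_sq L (n := 1)).continuous_deriv le_rfl).comp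
      (EuclideanSpace.proj (2 : Fin 3) : EuclideanSpace ℝ (Fin 3) →L[ℝ] ℝ).continuous)
  exact hc.integrable_of_hasCompactSupport
    (hasCompactSupport_mul_comp_apply_two hQ0 (abs_le_of_deriv_periodicWindow_sq_ne_zero hL))

/-- **The localised energy identity per period.** Let `U ∈ C¹`, `w ∈ C²`, `q ∈ C¹` be axially
`L`-periodic (`L > 0`) with `div U = div w = 0` and `ν Δw = (w·∇)U + (U·∇)w + ∇q`, and let
`φ ≥ 0` be an axially periodic `C¹` cut-off vanishing off a cylinder. Then, with
`S = zSlab L 0` one period and `eᵢ` the standard basis,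
`ν ∫_S φ |Dw|² = −ν Σᵢ ∫_S (∂ᵢφ)⟪∂ᵢw, w⟫ + ½ ∫_S (Dφ·U)‖w‖² + ∫_S (Dφ·w)⟪U, w⟫`
`+ ∫_S φ⟪U, Dw(w)⟫ + ∫_S q (Dφ·w)` — the identity displayed after (6-1) in Bang–Gui–Wang–Xie,
§5 Step 4, "integrating over `Ω`" realised through the window `ω_L²`.
[cite: BangGuiWangXie2025, Thm 1.4 (d), proof §5 (Poincaré inequality in the vertical period, localised energy identity, dyadic Saint-Venant estimate) (source of the ARGUMENT this module implements; this declaration is the cell’s own lemma or plumbing, NOT a printed statement)] -/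
theorem window_identity {ν L : ℝ} (hL : 0 < L)
    {U w : EuclideanSpace ℝ (Fin 3) → EuclideanSpace ℝ (Fin 3)} {q φ : EuclideanSpace ℝ (Fin 3) → ℝ}
    (hU : ContDiff ℝ 1 U) (hw : ContDiff ℝ 2 w) (hq : ContDiff ℝ 1 q)
    (hdivU : VectorCalculus.IsDivFree U) (hdivw : VectorCalculus.IsDivFree w)
    (hpde : ∀ x, ν • (Δ w) x = convect w U x + convect U w x + gradient q x)
    (hUper : IsAxiallyPeriodic L U) (hwper : IsAxiallyPeriodic L w) (hqper : IsAxiallyPeriodic L q)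
    (hφ : ContDiff ℝ 1 φ) (hφper : IsAxiallyPeriodic L φ) (hφnn : ∀ x, 0 ≤ φ x) {ρ : ℝ}
    (hφ0 : ∀ x, ρ ≤ cylRadius x → φ x = 0) :
    ν * ∫ x in zSlab L 0, φ x * frobeniusNormSq (fderiv ℝ w x) =
      -(ν * ∑ i, ∫ x in zSlab L 0, fderiv ℝ φ x (EuclideanSpace.basisFun (Fin 3) ℝ i) *
          ⟪fderiv ℝ w x (EuclideanSpace.basisFun (Fin 3) ℝ i), w x⟫) +
        2⁻¹ * (∫ x in zSlab L 0, fderiv ℝ φ x (U x) * ‖w x‖ ^ 2) +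
        (∫ x in zSlab L 0, fderiv ℝ φ x (w x) * ⟪U x, w x⟫) +
        (∫ x in zSlab L 0, φ x * ⟪U x, fderiv ℝ w x (w x)⟫) +
        ∫ x in zSlab L 0, q x * fderiv ℝ φ x (w x) := by
  set b := EuclideanSpace.basisFun (Fin 3) ℝ with hb
  set ω2 : ℝ → ℝ := fun s => periodicWindow L s ^ 2 with hω2
  set Φ : EuclideanSpace ℝ (Fin 3) → ℝ := fun x => φ x * ω2 (x 2) with hΦ
  -- regularity and support
  have hw1 : ContDiff ℝ 1 w := hw.of_le one_le_two
  have hUc : Continuous U := hU.continuous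
  have hwc : Continuous w := hw1.continuous
  have hqc : Continuous q := hq.continuous
  have hφc : Continuous φ := hφ.continuous
  have hDwc : Continuous (fderiv ℝ w) := hw1.continuous_fderiv one_ne_zero
  have hDφc : Continuous (fderiv ℝ φ) := hφ.continuous_fderiv one_ne_zero
  have hω2 : ContDiff ℝ 1 ω2 := contDiff_periodicWindow_sq L
  have hΦ1 : ContDiff ℝ 1 Φ := contDiff_mul_comp_apply_two hφ hω2
  have hΦc : HasCompactSupport Φ :=
    hasCompactSupport_mul_comp_apply_two hφ0 (abs_le_of_periodicWindow_sq_ne_zero hL)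
  -- the derivative of the nonnegative cut-off vanishes where the cut-off vanishes (local minimum)
  have hφD0 : ∀ x, ρ ≤ cylRadius x → fderiv ℝ φ x = 0 := fun x hx => by
    have hmin : IsLocalMin φ x := Eventually.of_forall fun y => by rw [hφ0 x hx]; exact hφnn y
    exact hmin.fderiv_eq_zero
  have hDΦ : ∀ (x v : EuclideanSpace ℝ (Fin 3)),
      fderiv ℝ Φ x v = ω2 (x 2) * fderiv ℝ φ x v + φ x * deriv ω2 (x 2) * v 2 := fun x v =>
    fderiv_mul_comp_apply_two (hφ.differentiable one_ne_zero x) (hω2.differentiable one_ne_zero _) v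
  -- periodicity of the derived fields
  have hDwper : IsAxiallyPeriodic L (fderiv ℝ w) := isAxiallyPeriodic_fderiv hwper
  have hDφper : IsAxiallyPeriodic L (fderiv ℝ φ) := isAxiallyPeriodic_fderiv hφper
  -- the whole-space identity
  have id := linearised_energy_identity b hU hw hq hdivU hdivw hpde hΦ1 hΦc
  -- the six densities and the four window-derivative densities
  -- (0) `φ |Dw|²`
  have hFc : Continuous fun x => frobeniusNormSq (fderiv ℝ w x) :=
    continuous_frobeniusNormSq_fderiv hw1 one_ne_zero
  obtain ⟨c0, -, -, -⟩ := window_bookkeeping hL (Q := fun x => φ x * frobeniusNormSq (fderiv ℝ w x))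
    (hφc.mul hFc) (fun x => by simp only [hφper x, hDwper x]) (ρ := ρ)
    (fun x hx => by rw [hφ0 x hx, zero_mul])
  have e0 : ∫ x, Φ x * frobeniusNormSq (fderiv ℝ w x) =
      ∫ x in zSlab L 0, φ x * frobeniusNormSq (fderiv ℝ w x) := by
    rw [← c0]; refine integral_congr_ae (Eventually.of_forall fun x => ?_)
    simp only [hΦ]; ring
  -- (1) `∂ᵢΦ ⟪∂ᵢw, w⟫`
  have e1 : ∀ i, ∫ x, fderiv ℝ Φ x (b i) * ⟪fderiv ℝ w x (b i), w x⟫ =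
      ∫ x in zSlab L 0, fderiv ℝ φ x (b i) * ⟪fderiv ℝ w x (b i), w x⟫ := by
    intro i
    obtain ⟨cA, -, iA, -⟩ := window_bookkeeping hL
      (Q := fun x => fderiv ℝ φ x (b i) * ⟪fderiv ℝ w x (b i), w x⟫)
      ((hDφc.clm_apply continuous_const).mul ((hDwc.clm_apply continuous_const).inner hwc))
      (fun x => by simp only [hDφper x, hDwper x, hwper x]) (ρ := ρ)
      (fun x hx => by rw [hφD0 x hx]; simp)
    obtain ⟨-, cB, -, iB⟩ := window_bookkeeping hL
      (Q := fun x => φ x * (b i) 2 * ⟪fderiv ℝ w x (b i), w x⟫)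
      ((hφc.mul continuous_const).mul ((hDwc.clm_apply continuous_const).inner hwc))
      (fun x => by simp only [hφper x, hDwper x, hwper x]) (ρ := ρ)
      (fun x hx => by rw [hφ0 x hx]; simp)
    rw [← cA, ← add_zero (∫ x, fderiv ℝ φ x (b i) * _ * _), ← cB, ← integral_add iA iB]
    refine integral_congr_ae (Eventually.of_forall fun x => ?_)
    simp only [hDΦ]; ring
  -- (2) `DΦ·U ‖w‖²`
  have e2 : ∫ x, fderiv ℝ Φ x (U x) * ‖w x‖ ^ 2 =
      ∫ x in zSlab L 0, fderiv ℝ φ x (U x) * ‖w x‖ ^ 2 := by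
    obtain ⟨cA, -, iA, -⟩ := window_bookkeeping hL
      (Q := fun x => fderiv ℝ φ x (U x) * ‖w x‖ ^ 2)
      ((hDφc.clm_apply hUc).mul (hwc.norm.pow 2))
      (fun x => by simp only [hDφper x, hUper x, hwper x]) (ρ := ρ)
      (fun x hx => by rw [hφD0 x hx]; simp)
    obtain ⟨-, cB, -, iB⟩ := window_bookkeeping hL
      (Q := fun x => φ x * (U x) 2 * ‖w x‖ ^ 2)
      ((hφc.mul ((continuous_apply 2).comp ((PiLp.continuous_ofLp 2 _).comp hUc))).mul
        (hwc.norm.pow 2))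
      (fun x => by simp only [hφper x, hUper x, hwper x]) (ρ := ρ)
      (fun x hx => by rw [hφ0 x hx]; simp)
    rw [← cA, ← add_zero (∫ x, fderiv ℝ φ x (U x) * _ * _), ← cB, ← integral_add iA iB]
    refine integral_congr_ae (Eventually.of_forall fun x => ?_)
    simp only [hDΦ]; ring
  -- (3) `DΦ·w ⟪U, w⟫`
  have e3 : ∫ x, fderiv ℝ Φ x (w x) * ⟪U x, w x⟫ =
      ∫ x in zSlab L 0, fderiv ℝ φ x (w x) * ⟪U x, w x⟫ := by
    obtain ⟨cA, -, iA, -⟩ := window_bookkeeping hL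
      (Q := fun x => fderiv ℝ φ x (w x) * ⟪U x, w x⟫)
      ((hDφc.clm_apply hwc).mul (hUc.inner hwc))
      (fun x => by simp only [hDφper x, hUper x, hwper x]) (ρ := ρ)
      (fun x hx => by rw [hφD0 x hx]; simp)
    obtain ⟨-, cB, -, iB⟩ := window_bookkeeping hL
      (Q := fun x => φ x * (w x) 2 * ⟪U x, w x⟫)
      ((hφc.mul ((continuous_apply 2).comp ((PiLp.continuous_ofLp 2 _).comp hwc))).mul
        (hUc.inner hwc))
      (fun x => by simp only [hφper x, hUper x, hwper x]) (ρ := ρ)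
      (fun x hx => by rw [hφ0 x hx]; simp)
    rw [← cA, ← add_zero (∫ x, fderiv ℝ φ x (w x) * _ * _), ← cB, ← integral_add iA iB]
    refine integral_congr_ae (Eventually.of_forall fun x => ?_)
    simp only [hDΦ]; ring
  -- (4) `Φ ⟪U, Dw(w)⟫`
  have e4 : ∫ x, Φ x * ⟪U x, fderiv ℝ w x (w x)⟫ =
      ∫ x in zSlab L 0, φ x * ⟪U x, fderiv ℝ w x (w x)⟫ := by
    obtain ⟨cA, -, -, -⟩ := window_bookkeeping hL
      (Q := fun x => φ x * ⟪U x, fderiv ℝ w x (w x)⟫)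
      (hφc.mul (hUc.inner (hDwc.clm_apply hwc)))
      (fun x => by simp only [hφper x, hUper x, hDwper x, hwper x]) (ρ := ρ)
      (fun x hx => by rw [hφ0 x hx, zero_mul])
    rw [← cA]; refine integral_congr_ae (Eventually.of_forall fun x => ?_)
    simp only [hΦ]; ring
  -- (5) `q DΦ·w`
  have e5 : ∫ x, q x * fderiv ℝ Φ x (w x) = ∫ x in zSlab L 0, q x * fderiv ℝ φ x (w x) := by
    obtain ⟨cA, -, iA, -⟩ := window_bookkeeping hL
      (Q := fun x => q x * fderiv ℝ φ x (w x))
      (hqc.mul (hDφc.clm_apply hwc))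
      (fun x => by simp only [hDφper x, hqper x, hwper x]) (ρ := ρ)
      (fun x hx => by rw [hφD0 x hx]; simp)
    obtain ⟨-, cB, -, iB⟩ := window_bookkeeping hL
      (Q := fun x => q x * φ x * (w x) 2)
      ((hqc.mul hφc).mul ((continuous_apply 2).comp ((PiLp.continuous_ofLp 2 _).comp hwc)))
      (fun x => by simp only [hφper x, hqper x, hwper x]) (ρ := ρ)
      (fun x hx => by rw [hφ0 x hx]; simp)
    rw [← cA, ← add_zero (∫ x, q x * _ * _), ← cB, ← integral_add iA iB]
    refine integral_congr_ae (Eventually.of_forall fun x => ?_)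
    simp only [hDΦ]; ring
  rw [e0, e2, e3, e4, e5] at id
  simp_rw [e1] at id
  exact id

end Literature.Analysis.SteadySlabLiouville.PeriodicSlab

end Part3

/-!
## Part 4 — port of `Summits/NavierStokesRegularity/NavierStokesRegularity/Theorems/ScenarioCensusPeriodicSlabBounds.lean` (9 declarations kept)

# Census row S7 (bounded steady flows in the periodic slab, case (d)): volume of one period of
# a cylinder, pointwise derivative bounds, and the algebra of the dyadic estimate

Support file for the scenario census of `NavierStokesRegularity` (cell `pub/ns-census`, row S7 =
Bang–Gui–Wang–Xie 2025, Thm 1.4 (d); tree FACT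
`Literature.Analysis.FluidPDE.BangGuiWangXie2025_periodicSlab_liouville`, second conjunct). Small
inputs of the dyadic energy estimate (`…PeriodicSlabEstimate`), kept in their own file:

* `volume_zSlab_inter_cyl_le` — one period of the cylinder `{ρ < R}` has volume `≤ 8 L R²`
  (it lies in a box; this is the `|𝒪_R| ≲ R` bookkeeping of the printed proof, arXiv:2205.13259
  §5, in the crude form sufficient for the dyadic argument);
* `partial_bounds` — `‖∂₃U‖ ≤ ‖DU‖`, `‖D ∂₃U‖ ≤ ‖D²U‖`, `|D ∂₃U|² ≤ 3 ‖D²U‖²` (Frobenius);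
* `alg_*` — the field identities used to collect the term bounds (proved once, outside the long
  estimate, so that `field_simp` runs in an empty context).

No summit statement and no census row is proved in this file.

## References

* J. Bang, C. Gui, Y. Wang, C. Xie, J. Fluid Mech. 1005 (2025) A6 = arXiv:2205.13259, §5 Step 4.
  [BangGuiWangXie2025]
-/

section Part4

open _root_.MeasureTheory _root_.Set _root_.Function _root_.Filter _root_.InnerProductSpace
open scoped _root_.Topology _root_.ENNReal _root_.NNReal RealInnerProductSpace _root_.ContDiff

namespace Literature.Analysis.SteadySlabLiouville.PeriodicSlab

open Literature.Analysis Literature.Analysis.FluidPDE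

/-! ### Volume of one period of a cylinder -/

/-- A coordinate is bounded by the horizontal radius: `|x₀| ≤ ρ(x)`, `|x₁| ≤ ρ(x)`.
[cite: BangGuiWangXie2025, Thm 1.4 (d), proof §5 (Poincaré inequality in the vertical period, localised energy identity, dyadic Saint-Venant estimate) (source of the ARGUMENT this module implements; this declaration is the cell’s own lemma or plumbing, NOT a printed statement)] -/
theorem abs_apply_le_cylRadius (x : EuclideanSpace ℝ (Fin 3)) :
    |x 0| ≤ cylRadius x ∧ |x 1| ≤ cylRadius x :=
  ⟨Real.abs_le_sqrt (by nlinarith [sq_nonneg (x 1)]), Real.abs_le_sqrt (by nlinarith [sq_nonneg (x 0)])⟩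

/-- **One period of the cylinder `{ρ < R}` has volume at most `8 L R²`** (it lies in the box
`(−R, R)² × (−L, L)`; `L, R > 0`).
[cite: BangGuiWangXie2025, Thm 1.4 (d), proof §5 (Poincaré inequality in the vertical period, localised energy identity, dyadic Saint-Venant estimate) (source of the ARGUMENT this module implements; this declaration is the cell’s own lemma or plumbing, NOT a printed statement)] -/
theorem volume_zSlab_inter_cyl_le {L R : ℝ} (hL : 0 < L) (hR : 0 < R) :
    volume (zSlab L 0 ∩ {x | cylRadius x < R}) ≤ ENNReal.ofReal (8 * L * R ^ 2) := by
  set lo : Fin 3 → ℝ := ![-R, -R, -L] with hlo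
  set hi : Fin 3 → ℝ := ![R, R, L] with hhi
  have hsub : zSlab L 0 ∩ {x | cylRadius x < R} ⊆
      (fun x : EuclideanSpace ℝ (Fin 3) => (WithLp.ofLp x : Fin 3 → ℝ)) ⁻¹'
        Set.pi univ (fun i => Ioo (lo i) (hi i)) := by
    rintro x ⟨hxS, hxR⟩
    rw [mem_zSlab] at hxS
    simp only [Int.cast_zero, zero_mul, zero_add, one_mul] at hxS
    have hxR' : cylRadius x < R := hxR
    obtain ⟨h0, h1⟩ := abs_apply_le_cylRadius x
    rw [mem_preimage, mem_univ_pi]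
    intro i
    fin_cases i
    · have := abs_lt.1 (lt_of_le_of_lt h0 hxR')
      simpa [hlo, hhi] using this
    · have := abs_lt.1 (lt_of_le_of_lt h1 hxR')
      simpa [hlo, hhi] using this
    · simp only [hlo, hhi]
      exact ⟨by simp; linarith [hxS.1], by simpa using hxS.2⟩
  calc volume (zSlab L 0 ∩ {x | cylRadius x < R})
      ≤ volume ((fun x : EuclideanSpace ℝ (Fin 3) => (WithLp.ofLp x : Fin 3 → ℝ)) ⁻¹'
          Set.pi univ (fun i => Ioo (lo i) (hi i))) := measure_mono hsub
    _ = volume (Set.pi univ (fun i => Ioo (lo i) (hi i))) :=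
        (PiLp.volume_preserving_ofLp (Fin 3)).measure_preimage
          (MeasurableSet.univ_pi fun i => measurableSet_Ioo).nullMeasurableSet
    _ = ∏ i, ENNReal.ofReal (hi i - lo i) := Real.volume_pi_Ioo
    _ = ENNReal.ofReal (8 * L * R ^ 2) := by
        rw [Fin.prod_univ_three]
        simp only [hlo, hhi, Matrix.cons_val_zero, Matrix.cons_val_one, Matrix.cons_val_two,
          Matrix.head_cons, Matrix.tail_cons, sub_neg_eq_add]
        rw [← ENNReal.ofReal_mul (by linarith), ← ENNReal.ofReal_mul (by positivity)]
        congr 1; ring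

/-- The Frobenius energy density of a `C¹` field is integrable on one period of any cylinder if
it is bounded.
[cite: BangGuiWangXie2025, Thm 1.4 (d), proof §5 (Poincaré inequality in the vertical period, localised energy identity, dyadic Saint-Venant estimate) (source of the ARGUMENT this module implements; this declaration is the cell’s own lemma or plumbing, NOT a printed statement)] -/
theorem integrableOn_zSlab_inter_cyl_of_bound {L R : ℝ} (hL : 0 < L) (hR : 0 < R)
    {F : EuclideanSpace ℝ (Fin 3) → ℝ} (hFc : Continuous F) {B : ℝ} (hFB : ∀ x, ‖F x‖ ≤ B) :
    IntegrableOn F (zSlab L 0 ∩ {x | cylRadius x < R}) volume := by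
  have hfin : volume (zSlab L 0 ∩ {x | cylRadius x < R}) ≠ ⊤ :=
    (lt_of_le_of_lt (volume_zSlab_inter_cyl_le hL hR) ENNReal.ofReal_lt_top).ne
  exact Measure.integrableOn_of_bounded hfin hFc.aestronglyMeasurable (Eventually.of_forall hFB)

/-! ### Pointwise bounds for `w = ∂₃U` -/

/-- **Pointwise bounds for the axial derivative.** For `U ∈ C²` with `‖D²U‖ ≤ K₂`:
`‖D(∂₃U)(x)‖ ≤ K₂`, `|D(∂₃U)(x)|² ≤ 3 K₂²` (Frobenius norm), and `‖∂₃U(x)‖ ≤ ‖DU(x)‖`.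
[cite: BangGuiWangXie2025, Thm 1.4 (d), proof §5 (Poincaré inequality in the vertical period, localised energy identity, dyadic Saint-Venant estimate) (source of the ARGUMENT this module implements; this declaration is the cell’s own lemma or plumbing, NOT a printed statement)] -/
theorem partial_bounds {U : EuclideanSpace ℝ (Fin 3) → EuclideanSpace ℝ (Fin 3)}
    (hU2 : ContDiff ℝ 2 U) {K₂ : ℝ} (hK₂ : ∀ x, ‖iteratedFDeriv ℝ 2 U x‖ ≤ K₂)
    (x : EuclideanSpace ℝ (Fin 3)) :
    ‖fderiv ℝ (fun y => fderiv ℝ U y eZ) x‖ ≤ K₂ ∧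
      frobeniusNormSq (fderiv ℝ (fun y => fderiv ℝ U y eZ) x) ≤ 3 * K₂ ^ 2 ∧
      ‖fderiv ℝ U x eZ‖ ≤ ‖fderiv ℝ U x‖ := by
  set b := EuclideanSpace.basisFun (Fin 3) ℝ with hb
  have heZ : ‖(eZ : EuclideanSpace ℝ (Fin 3))‖ = 1 := by simp [eZ]
  have hDU2 : ‖fderiv ℝ (fderiv ℝ U) x‖ ≤ K₂ := by
    rw [← norm_iteratedFDeriv_zero (𝕜 := ℝ) (f := fderiv ℝ (fderiv ℝ U)), norm_iteratedFDeriv_fderiv,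
      norm_iteratedFDeriv_fderiv]
    exact hK₂ x
  have hDUd : DifferentiableAt ℝ (fderiv ℝ U) x :=
    ((hU2.fderiv_right (m := 1) le_rfl).differentiable one_ne_zero) x
  have hDw_op : ‖fderiv ℝ (fun y => fderiv ℝ U y eZ) x‖ ≤ K₂ := by
    refine ContinuousLinearMap.opNorm_le_bound _
      ((norm_nonneg (fderiv ℝ (fderiv ℝ U) x)).trans hDU2) fun v => ?_
    rw [fderiv_apply_const_apply hDUd eZ v]
    calc ‖fderiv ℝ (fderiv ℝ U) x v eZ‖
        ≤ ‖fderiv ℝ (fderiv ℝ U) x v‖ * ‖(eZ : EuclideanSpace ℝ (Fin 3))‖ :=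
          ContinuousLinearMap.le_opNorm _ _
      _ ≤ ‖fderiv ℝ (fderiv ℝ U) x‖ * ‖v‖ * 1 := by
          rw [heZ]; exact mul_le_mul_of_nonneg_right (ContinuousLinearMap.le_opNorm _ _) zero_le_one
      _ ≤ K₂ * ‖v‖ := by rw [mul_one]; exact mul_le_mul_of_nonneg_right hDU2 (norm_nonneg _)
  refine ⟨hDw_op, ?_, ?_⟩
  · rw [frobeniusNormSq_eq_sum b]
    calc ∑ i, ‖fderiv ℝ (fun y => fderiv ℝ U y eZ) x (b i)‖ ^ 2 ≤ ∑ _i : Fin 3, K₂ ^ 2 :=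
          Finset.sum_le_sum fun i _ => by
            have h1 : ‖fderiv ℝ (fun y => fderiv ℝ U y eZ) x (b i)‖ ≤ K₂ := by
              calc ‖fderiv ℝ (fun y => fderiv ℝ U y eZ) x (b i)‖
                  ≤ ‖fderiv ℝ (fun y => fderiv ℝ U y eZ) x‖ * ‖b i‖ := ContinuousLinearMap.le_opNorm _ _
                _ ≤ K₂ := by rw [b.orthonormal.1 i, mul_one]; exact hDw_op
            exact pow_le_pow_left₀ (norm_nonneg _) h1 2
      _ = 3 * K₂ ^ 2 := by simp
  · calc ‖fderiv ℝ U x eZ‖ ≤ ‖fderiv ℝ U x‖ * ‖(eZ : EuclideanSpace ℝ (Fin 3))‖ :=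
          ContinuousLinearMap.le_opNorm _ _
      _ = ‖fderiv ℝ U x‖ := by rw [heZ, mul_one]

/-! ### Elementary algebra used in the estimate (kept outside the long proof) -/

/-- `(t a − b)²/t = t a² + b²/t − 2 b a` for `t ≠ 0`.
[cite: BangGuiWangXie2025, Thm 1.4 (d), proof §5 (Poincaré inequality in the vertical period, localised energy identity, dyadic Saint-Venant estimate) (source of the ARGUMENT this module implements; this declaration is the cell’s own lemma or plumbing, NOT a printed statement)] -/
theorem alg_sq_div (t a b : ℝ) (ht : t ≠ 0) :
    (t * a - b) ^ 2 / t = t * a ^ 2 + b ^ 2 / t - 2 * (b * a) := by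
  field_simp
  ring

/-- With `t = 2π/L` and `κ = (L/(2π))²`: `(M t/2) κ I + (M/(2t)) I = (M L/(2π)) I` (`L ≠ 0`).
[cite: BangGuiWangXie2025, Thm 1.4 (d), proof §5 (Poincaré inequality in the vertical period, localised energy identity, dyadic Saint-Venant estimate) (source of the ARGUMENT this module implements; this declaration is the cell’s own lemma or plumbing, NOT a printed statement)] -/
theorem alg_absorb (M L I : ℝ) (hL : L ≠ 0) :
    M * (2 * Real.pi / L) / 2 * ((L / (2 * Real.pi)) ^ 2 * I) + M / (2 * (2 * Real.pi / L)) * I =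
      M * L / (2 * Real.pi) * I := by
  have hπ : Real.pi ≠ 0 := Real.pi_ne_zero
  field_simp
  ring

/-- `C K² λ/(2r) · (32 L r²) = 16 C K² L λ r` (`r ≠ 0`).
[cite: BangGuiWangXie2025, Thm 1.4 (d), proof §5 (Poincaré inequality in the vertical period, localised energy identity, dyadic Saint-Venant estimate) (source of the ARGUMENT this module implements; this declaration is the cell’s own lemma or plumbing, NOT a printed statement)] -/
theorem alg_volume (C K lam L r : ℝ) (hr : r ≠ 0) :
    C * K ^ 2 * lam / (2 * r) * (32 * L * r ^ 2) = 16 * C * K ^ 2 * L * lam * r := by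
  field_simp
  ring

/-- `C/r · χ · ((λ K² + w²/λ)/2) = C K² λ/(2r) χ + C/(2 λ r) (χ w²)` (`r, λ ≠ 0`).
[cite: BangGuiWangXie2025, Thm 1.4 (d), proof §5 (Poincaré inequality in the vertical period, localised energy identity, dyadic Saint-Venant estimate) (source of the ARGUMENT this module implements; this declaration is the cell’s own lemma or plumbing, NOT a printed statement)] -/
theorem alg_split (C r χ lam K w : ℝ) (hr : r ≠ 0) (hlam : lam ≠ 0) :
    C / r * χ * ((lam * K ^ 2 + w ^ 2 / lam) / 2) =
      C * K ^ 2 * lam / (2 * r) * χ + C / (2 * lam * r) * (χ * w ^ 2) := by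
  field_simp

/-- The bookkeeping identity collecting the five term bounds of the dyadic estimate.
[cite: BangGuiWangXie2025, Thm 1.4 (d), proof §5 (Poincaré inequality in the vertical period, localised energy identity, dyadic Saint-Venant estimate) (source of the ARGUMENT this module implements; this declaration is the cell’s own lemma or plumbing, NOT a printed statement)] -/
theorem alg_collect (ν C₀ M κ D r lam : ℝ) (hr : r ≠ 0) (hlam : lam ≠ 0) :
    C₀ * (3 * ν * (1 + κ) / 2 + 3 * M * κ / 2) * D / r + C₀ * κ / 2 * D / (lam * r) =
      ν * (3 * (C₀ / (2 * r) * (D + κ * D))) + 2⁻¹ * (C₀ * M / r * (κ * D)) +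
        C₀ * M / r * (κ * D) + C₀ / (2 * lam * r) * (κ * D) := by
  field_simp
  ring

end Literature.Analysis.SteadySlabLiouville.PeriodicSlab

end Part4

/-!
## Part 5 — port of `Summits/NavierStokesRegularity/NavierStokesRegularity/Theorems/ScenarioCensusHelicalSlabTools.lean` (5 declarations kept)

# Census row S6 (bounded helical steady flows, any period–Reynolds number): slab tools —
# translation invariance (Bochner form), signed vertical averaging, and the Poincaré–Wirtinger
# inequality for zero-mean periodic scalars

Support file for the scenario census of `NavierStokesRegularity` (cell `pub/ns-census`, block S,
row S6 = Han–Wang–Xie, arXiv:2312.10382 = Sci. China Math. 2025, Thm 1.1: a bounded smooth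
helically symmetric steady Navier–Stokes flow on `ℝ³` is an axial constant `C e₃`; tree FACT
`Literature.Analysis.FluidPDE.HanWangXie2023_helical_liouville`). The tree proof of row S6
(`…HelicalSlabLiouville`) runs the Saint-Venant argument of the printed proof (§3: "Poincaré
inequality (A122)" for the radial velocity, whose vertical period means vanish by the helical
identities) on top of the period-slab machinery of row S7d (`…PeriodicSlab*`). This file adds the
three measure-theoretic tools that the S7d chain did not need:

* `setIntegral_zSlab_comp_add_smul_eZ` — Bochner form of `…PeriodicSlabTools`'
  `setLIntegral_zSlab_comp_add_smul_eZ`: the integral over one period slab of an axially periodic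
  function is invariant under ALL axial translations;
* `setIntegral_zSlab_mul_verticalIntegral_real` — SIGNED vertical averaging (Fubini):
  `∫_{slab} g(x) (∫₀ᴸ f(x + s e₃) ds) dx = L ∫_{slab} g f` for a bounded measurable `z`-independent
  weight `g` vanishing off a cylinder and a continuous periodic `f` (the `ℝ≥0∞` version for
  nonnegative data is `setLIntegral_zSlab_mul_verticalIntegral`); in particular such integrals
  vanish when `f` has zero vertical period means (`setIntegral_zSlab_mul_eq_zero_of_verticalMean`);
* `slab_poincare_of_verticalMean_eq_zero` — the Poincaré–Wirtinger inequality
  `(2π/L)² ∫_{slab} g f² ≤ ∫_{slab} g (∂₃f)²` for a `C¹` axially periodic SCALAR `f` whose vertical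
  period means vanish, under a `z`-independent weight (the S7d file `slab_wirtinger` is the case
  `f = ∂₃V`); sharp constant via `Literature.Analysis.FluidPDE.wirtinger_interval_real`.

No summit statement and no census row is proved in this file.

## References

* J. Han, Y. Wang, C. Xie, arXiv:2312.10382 (2023), §3, proof of Lemma 3.1 / Thm 1.1 ((A117),
  (A122): zero vertical means and the Poincaré inequality for `u^r`). [HanWangXie2023]
* J. Bang, C. Gui, Y. Wang, C. Xie, J. Fluid Mech. 1005 (2025) A6 = arXiv:2205.13259, §5.
  [BangGuiWangXie2025]

Not carried from this source module (not needed by the declarations re-homed here; their consumers are Summits-side): `norm_add_smul_eZ_le`.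
-/

section Part5

open _root_.MeasureTheory _root_.Set _root_.Function _root_.Filter
open scoped _root_.Topology _root_.ENNReal _root_.NNReal _root_.InnerProductSpace

namespace Literature.Analysis.SteadySlabLiouville.HelicalSlab

open Literature.Analysis Literature.Analysis.FluidPDE
open Literature.Analysis.SteadySlabLiouville.PeriodicSlab

/-! ### Translation invariance of slab integrals (Bochner form) -/

/-- **All axial translates have the same integral over one period** (Bochner form). For a real
axially `L`-periodic `Q` (`L > 0`), a.e.-strongly measurable, with `Q` and its translate
`Q(· + s e₃)` integrable on the period slab: `∫_{zSlab L 0} Q(x + s e₃) dx = ∫_{zSlab L 0} Q`.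
[cite: HanWangXie2023, Thm 1.1, proof §§2–3 (periodic pressure, helical identities, Saint-Venant estimate) (source of the ARGUMENT this module implements; this declaration is the cell’s own lemma or plumbing, NOT a printed statement)] -/
theorem setIntegral_zSlab_comp_add_smul_eZ {L : ℝ} (hL : 0 < L)
    {Q : EuclideanSpace ℝ (Fin 3) → ℝ} (hQper : IsAxiallyPeriodic L Q)
    (hQm : AEStronglyMeasurable Q volume) (hQi : IntegrableOn Q (zSlab L 0) volume) (s : ℝ)
    (hQsi : IntegrableOn (fun x => Q (x + s • eZ)) (zSlab L 0) volume) :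
    ∫ x in zSlab L 0, Q (x + s • eZ) = ∫ x in zSlab L 0, Q x := by
  have hQs : IsAxiallyPeriodic L (fun x => Q (x + s • eZ)) := isAxiallyPeriodic_comp_add_smul_eZ hQper s
  have hQsm : AEStronglyMeasurable (fun x => Q (x + s • eZ)) volume :=
    hQm.comp_quasiMeasurePreserving (measurePreserving_add_right volume (s • eZ)).quasiMeasurePreserving
  -- the translate, integrated against the window
  rw [← integral_mul_periodicWindow_sq hL hQs hQsm hQsi]
  -- substitute `x ↦ x - s e₃` (translation invariance of Lebesgue measure)
  have h1 : ∫ x, Q (x + s • eZ) * periodicWindow L (x 2) ^ 2 =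
      ∫ x, Q x * periodicWindow L (x 2 - s) ^ 2 := by
    rw [← integral_add_right_eq_self
      (fun x : EuclideanSpace ℝ (Fin 3) => Q x * periodicWindow L (x 2 - s) ^ 2) (s • eZ)]
    refine integral_congr_ae (Eventually.of_forall fun x => ?_)
    simp only [apply_two_add_smul_eZ, add_sub_cancel_right]
  rw [h1]
  -- the shifted window still has translates summing to `1`
  have hWm : Measurable fun z : ℝ => periodicWindow L (z - s) ^ 2 :=
    (((contDiff_periodicWindow L (n := 0)).continuous.comp (continuous_id.sub continuous_const)).pow 2).measurable
  have h2 := hQper.integral_mul_comp_apply_two_eq_const_mul hL hQm hQi hWm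
    (A := 2 * L + |s|) (B := 1) (c := 1)
    (fun z hz => by
      have hz' : periodicWindow L (z - s) ≠ 0 := fun h => hz (by rw [h]; ring)
      have hm := mem_Ioo_of_periodicWindow_ne_zero hL hz'
      constructor
      · linarith [hm.1, neg_abs_le s, hL]
      · linarith [hm.2, le_abs_self s])
    (fun z => by
      rw [abs_of_nonneg (sq_nonneg _), sq_le_one_iff_abs_le_one]
      exact abs_periodicWindow_le_one L _)
    (fun z => by
      have e : (fun k : ℤ => periodicWindow L (z + (k : ℝ) * L - s) ^ 2) =
          fun k : ℤ => periodicWindow L ((z - s) + (k : ℝ) * L) ^ 2 := by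
        funext k; ring_nf
      rw [e, tsum_periodicWindow_sq hL (z - s)])
  rw [h2, one_mul]

/-- **Signed vertical averaging on one period** (Fubini). For a measurable `z`-independent
weight `g` with `|g| ≤ G`, vanishing off a cylinder, and a continuous axially `L`-periodic `f`
(`L > 0`): `∫_{slab} g(x) (∫₀ᴸ f(x + s e₃) ds) dx = L ∫_{slab} g f`. (Swap the integrals; the
inner slab integral of `x ↦ g(x) f(x + s e₃) = (g f)(x + s e₃)` does not depend on `s` by
`setIntegral_zSlab_comp_add_smul_eZ`.)
[cite: HanWangXie2023, Thm 1.1, proof §§2–3 (periodic pressure, helical identities, Saint-Venant estimate) (source of the ARGUMENT this module implements; this declaration is the cell’s own lemma or plumbing, NOT a printed statement)] -/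
theorem setIntegral_zSlab_mul_verticalIntegral_real {L : ℝ} (hL : 0 < L)
    {g : EuclideanSpace ℝ (Fin 3) → ℝ} (hgm : Measurable g)
    (hgz : ∀ (x : EuclideanSpace ℝ (Fin 3)) (s : ℝ), g (x + s • eZ) = g x)
    {G : ℝ} (hgG : ∀ x, |g x| ≤ G) {ρ : ℝ} (hgρ : ∀ x, ρ ≤ cylRadius x → g x = 0)
    {f : EuclideanSpace ℝ (Fin 3) → ℝ} (hfc : Continuous f) (hfper : IsAxiallyPeriodic L f) :
    ∫ x in zSlab L 0, g x * ∫ s in (0 : ℝ)..L, f (x + s • eZ) =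
      L * ∫ x in zSlab L 0, g x * f x := by
  set S : Set (EuclideanSpace ℝ (Fin 3)) := zSlab L 0 with hS
  set F : EuclideanSpace ℝ (Fin 3) → ℝ → ℝ := fun x s => g x * f (x + s • eZ) with hF
  have hG0 : 0 ≤ G := (abs_nonneg _).trans (hgG 0)
  have hcyl : ∀ (x : EuclideanSpace ℝ (Fin 3)) (s : ℝ), cylRadius (x + s • eZ) = cylRadius x :=
    fun x s => by simp [cylRadius, eZ]
  -- a bound for `f` on the relevant compact set
  obtain ⟨B, hB⟩ := (isCompact_closedBall (0 : EuclideanSpace ℝ (Fin 3)) (|ρ| + 2 * L)).exists_bound_of_continuousOn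
    hfc.continuousOn
  have hB0 : 0 ≤ B := (norm_nonneg _).trans (hB 0 (Metric.mem_closedBall_self (by positivity)))
  -- (a) the left-hand side as an iterated integral over `S × Ioc 0 L`
  have hlhs : ∫ x in S, g x * ∫ s in (0 : ℝ)..L, f (x + s • eZ) =
      ∫ x in S, ∫ s in Ioc (0 : ℝ) L, F x s := by
    refine setIntegral_congr_fun (measurableSet_zSlab L 0) fun x _ => ?_
    simp only [hF]
    rw [intervalIntegral.integral_of_le hL.le, ← integral_const_mul]
  rw [hlhs]
  -- (b) integrability on the product
  have hFm : AEStronglyMeasurable (uncurry F)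
      ((volume.restrict S).prod (volume.restrict (Ioc (0 : ℝ) L))) := by
    refine (Measurable.aestronglyMeasurable ?_)
    exact (hgm.comp measurable_fst).mul
      (hfc.measurable.comp (measurable_fst.add (measurable_snd.smul measurable_const)))
  have hFint : Integrable (uncurry F) ((volume.restrict S).prod (volume.restrict (Ioc (0 : ℝ) L))) := by
    rw [integrable_prod_iff hFm]
    constructor
    · refine Eventually.of_forall fun x => ?_
      show Integrable (fun s => g x * f (x + s • eZ)) (volume.restrict (Ioc 0 L))
      have hc : Continuous fun s : ℝ => g x * f (x + s • eZ) :=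
        continuous_const.mul (hfc.comp (continuous_const.add (continuous_id.smul continuous_const)))
      exact (hc.integrableOn_Icc (a := 0) (b := L)).mono_set Ioc_subset_Icc_self
    · -- `x ↦ ∫ |F x s| ds` is bounded by `G L B` on the slab part of the cylinder and vanishes off it
      have hnorm : ∀ x, (∫ s in Ioc (0 : ℝ) L, ‖uncurry F (x, s)‖) =
          |g x| * ∫ s in Ioc (0 : ℝ) L, |f (x + s • eZ)| := fun x => by
        rw [← integral_const_mul]
        refine integral_congr_ae (Eventually.of_forall fun s => ?_)
        simp only [hF, uncurry_apply_pair, norm_mul, Real.norm_eq_abs]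
      simp_rw [hnorm]
      have hIc : Continuous fun x : EuclideanSpace ℝ (Fin 3) => ∫ s in Ioc (0 : ℝ) L, |f (x + s • eZ)| := by
        have h := intervalIntegral.continuous_parametric_intervalIntegral_of_continuous'
          (μ := volume) (f := fun (x : EuclideanSpace ℝ (Fin 3)) (s : ℝ) => |f (x + s • eZ)|)
          (by exact (hfc.comp (continuous_fst.add (continuous_snd.smul continuous_const))).abs) 0 L
        refine h.congr fun x => ?_
        rw [intervalIntegral.integral_of_le hL.le]
      have hm : AEStronglyMeasurable
          (fun x : EuclideanSpace ℝ (Fin 3) => |g x| * ∫ s in Ioc (0 : ℝ) L, |f (x + s • eZ)|) volume :=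
        ((continuous_abs.measurable.comp hgm).mul hIc.measurable).aestronglyMeasurable
      refine integrableOn_zSlab_of_bound hL hm (ρ := ρ) (fun x hx => by rw [hgρ x hx, abs_zero, zero_mul])
        (B := G * (L * B)) fun x hx => ?_
      rw [Real.norm_eq_abs, abs_mul, abs_abs]
      by_cases hxr : ρ ≤ cylRadius x
      · rw [hgρ x hxr, abs_zero, zero_mul]; positivity
      · rw [not_le] at hxr
        have hint : |(∫ s in Ioc (0 : ℝ) L, |f (x + s • eZ)|)| ≤ L * B := by
          rw [abs_of_nonneg (integral_nonneg fun s => abs_nonneg _)]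
          have hle : ∫ s in Ioc (0 : ℝ) L, |f (x + s • eZ)| ≤ ∫ s in Ioc (0 : ℝ) L, B := by
            refine setIntegral_mono_on ?_ (integrableOn_const (by simp)) measurableSet_Ioc fun s hs => ?_
            · have hc : Continuous fun s : ℝ => |f (x + s • eZ)| :=
                (hfc.comp (continuous_const.add (continuous_id.smul continuous_const))).abs
              exact (hc.integrableOn_Icc (a := 0) (b := L)).mono_set Ioc_subset_Icc_self
            · rw [← Real.norm_eq_abs]
              refine hB _ (Metric.mem_closedBall.2 ?_)
              rw [dist_zero_right]
              -- `x` need not lie in the slab here; bound directly through `‖x‖ ≤ |ρ| + L`?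
              -- we only know `‖x‖ ≤ |ρ| + L` for slab points; use the hypothesis `hx` instead
              calc ‖x + s • eZ‖ ≤ ‖x‖ + ‖s • (eZ : EuclideanSpace ℝ (Fin 3))‖ := norm_add_le _ _
                _ ≤ (|ρ| + L) + L := by
                    have h1 : ‖s • (eZ : EuclideanSpace ℝ (Fin 3))‖ ≤ L := by
                      rw [norm_smul, Real.norm_of_nonneg hs.1.le]
                      have : ‖(eZ : EuclideanSpace ℝ (Fin 3))‖ = 1 := by simp [eZ]
                      rw [this, mul_one]; exact hs.2
                    linarith [hx]
                _ = |ρ| + 2 * L := by ring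
          calc ∫ s in Ioc (0 : ℝ) L, |f (x + s • eZ)| ≤ ∫ s in Ioc (0 : ℝ) L, B := hle
            _ = L * B := by rw [setIntegral_const, Real.volume_real_Ioc_of_le hL.le, sub_zero, smul_eq_mul]
        exact mul_le_mul (hgG x) hint (abs_nonneg _) hG0
  -- (c) swap
  rw [integral_integral_swap hFint]
  -- (d) the inner slab integral does not depend on `s`
  set Q : EuclideanSpace ℝ (Fin 3) → ℝ := fun x => g x * f x with hQ
  have hQper : IsAxiallyPeriodic L Q := fun x => by
    simp only [hQ]
    rw [hfper x]
    have : g (x + L • EuclideanSpace.single 2 (1 : ℝ)) = g x := hgz x L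
    rw [this]
  have hQm : AEStronglyMeasurable Q volume := (hgm.mul hfc.measurable).aestronglyMeasurable
  have hballB : ∀ y : EuclideanSpace ℝ (Fin 3), ‖y‖ ≤ |ρ| + 2 * L → |f y| ≤ B := fun y hy => by
    rw [← Real.norm_eq_abs]
    exact hB y (Metric.mem_closedBall.2 (by rwa [dist_zero_right]))
  have hQi : IntegrableOn Q S volume := by
    refine integrableOn_zSlab_of_bound hL hQm (ρ := ρ) (fun x hx => by simp only [hQ, hgρ x hx, zero_mul])
      (B := G * B) fun x hx => ?_
    simp only [hQ, Real.norm_eq_abs, abs_mul]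
    exact mul_le_mul (hgG x) (hballB x (by linarith [hx, hL])) (abs_nonneg _) hG0
  have hQsi : ∀ s ∈ Icc (0 : ℝ) L, IntegrableOn (fun x => Q (x + s • eZ)) S volume := by
    intro s hs
    have hm : AEStronglyMeasurable (fun x => Q (x + s • eZ)) volume :=
      hQm.comp_quasiMeasurePreserving (measurePreserving_add_right volume (s • eZ)).quasiMeasurePreserving
    refine integrableOn_zSlab_of_bound hL hm (ρ := ρ)
      (fun x hx => by simp only [hQ]; rw [hgz x s, hgρ x hx, zero_mul]) (B := G * B) fun x hx => ?_
    simp only [hQ, Real.norm_eq_abs, abs_mul, hgz x s]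
    refine mul_le_mul (hgG x) (hballB _ ?_) (abs_nonneg _) hG0
    calc ‖x + s • eZ‖ ≤ ‖x‖ + ‖s • (eZ : EuclideanSpace ℝ (Fin 3))‖ := norm_add_le _ _
      _ ≤ (|ρ| + L) + L := by
          have h1 : ‖s • (eZ : EuclideanSpace ℝ (Fin 3))‖ ≤ L := by
            rw [norm_smul, Real.norm_of_nonneg hs.1]
            have : ‖(eZ : EuclideanSpace ℝ (Fin 3))‖ = 1 := by simp [eZ]
            rw [this, mul_one]; exact hs.2
          linarith [hx]
      _ = |ρ| + 2 * L := by ring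
  have hinner : ∀ s ∈ Ioc (0 : ℝ) L, ∫ x in S, F x s = ∫ x in S, Q x := by
    intro s hs
    have e : (fun x => F x s) = fun x => Q (x + s • eZ) := by
      funext x; simp only [hF, hQ, hgz x s]
    rw [e]
    exact setIntegral_zSlab_comp_add_smul_eZ hL hQper hQm hQi s (hQsi s (Ioc_subset_Icc_self hs))
  rw [setIntegral_congr_fun measurableSet_Ioc hinner, setIntegral_const, Real.volume_real_Ioc_of_le hL.le,
    sub_zero, smul_eq_mul]

/-- **Integrals of `z`-independent weights against functions with zero vertical period means
vanish**: with `g`, `f` as in `setIntegral_zSlab_mul_verticalIntegral_real` and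
`∫₀ᴸ f(x + s e₃) ds = 0` for every `x`, `∫_{slab} g f = 0`.
[cite: HanWangXie2023, Thm 1.1, proof §§2–3 (periodic pressure, helical identities, Saint-Venant estimate) (source of the ARGUMENT this module implements; this declaration is the cell’s own lemma or plumbing, NOT a printed statement)] -/
theorem setIntegral_zSlab_mul_eq_zero_of_verticalMean {L : ℝ} (hL : 0 < L)
    {g : EuclideanSpace ℝ (Fin 3) → ℝ} (hgm : Measurable g)
    (hgz : ∀ (x : EuclideanSpace ℝ (Fin 3)) (s : ℝ), g (x + s • eZ) = g x)
    {G : ℝ} (hgG : ∀ x, |g x| ≤ G) {ρ : ℝ} (hgρ : ∀ x, ρ ≤ cylRadius x → g x = 0)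
    {f : EuclideanSpace ℝ (Fin 3) → ℝ} (hfc : Continuous f) (hfper : IsAxiallyPeriodic L f)
    (hmean : ∀ x, ∫ s in (0 : ℝ)..L, f (x + s • eZ) = 0) :
    ∫ x in zSlab L 0, g x * f x = 0 := by
  have h := setIntegral_zSlab_mul_verticalIntegral_real hL hgm hgz hgG hgρ hfc hfper
  simp_rw [hmean, mul_zero, integral_zero] at h
  have : L * ∫ x in zSlab L 0, g x * f x = 0 := h.symm
  exact (mul_eq_zero.1 this).resolve_left hL.ne'

/-! ### The Poincaré–Wirtinger inequality for zero-mean periodic scalars -/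

/-- **Vertical Poincaré–Wirtinger inequality for a scalar with zero period mean** (sharp
constant): for `f ∈ C¹` axially `L`-periodic (`L > 0`) and a base point `x` with
`∫₀ᴸ f(x + s e₃) ds = 0`, `(2π/L)² ∫₀ᴸ f(x + s e₃)² ds ≤ ∫₀ᴸ (∂₃f(x + s e₃))² ds`
(`Literature.Analysis.FluidPDE.wirtinger_interval_real`). This is the "Poincaré inequality
(A122)" of Han–Wang–Xie, §3, on one vertical period.
[cite: HanWangXie2023, Thm 1.1, proof §§2–3 (periodic pressure, helical identities, Saint-Venant estimate) (source of the ARGUMENT this module implements; this declaration is the cell’s own lemma or plumbing, NOT a printed statement)] -/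
theorem vertical_poincare_of_mean_eq_zero {L : ℝ} (hL : 0 < L) {f : EuclideanSpace ℝ (Fin 3) → ℝ}
    (hf : ContDiff ℝ 1 f) (hper : IsAxiallyPeriodic L f) (x : EuclideanSpace ℝ (Fin 3))
    (hmean : ∫ s in (0 : ℝ)..L, f (x + s • eZ) = 0) :
    (2 * Real.pi / L) ^ 2 * ∫ s in (0 : ℝ)..L, f (x + s • eZ) ^ 2 ≤
      ∫ s in (0 : ℝ)..L, (fderiv ℝ f (x + s • eZ) eZ) ^ 2 := by
  have hfd : Differentiable ℝ f := hf.differentiable one_ne_zero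
  have hDfc : Continuous (fderiv ℝ f) := hf.continuous_fderiv one_ne_zero
  have hℓc : Continuous fun s : ℝ => x + s • (eZ : EuclideanSpace ℝ (Fin 3)) :=
    continuous_const.add (continuous_id.smul continuous_const)
  have hc : ∀ s, HasDerivAt (fun σ : ℝ => f (x + σ • eZ)) (fderiv ℝ f (x + s • eZ) eZ) s :=
    fun s => hasDerivAt_comp_add_smul_eZ hfd x s
  have hc' : Continuous fun s : ℝ => fderiv ℝ f (x + s • eZ) eZ :=
    (hDfc.comp hℓc).clm_apply continuous_const
  have hcper : f (x + L • eZ) = f (x + (0 : ℝ) • eZ) := by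
    rw [zero_smul, add_zero]; exact isAxiallyPeriodic_add_smul_eZ hper x
  have h := wirtinger_interval_real hL hc hc' hcper hmean
  rwa [sub_zero] at h

/-- **The Poincaré–Wirtinger inequality on one period slab for a zero-mean periodic scalar, under
a `z`-independent weight** (sharp constant). Let `f ∈ C¹(ℝ³; ℝ)` be axially `L`-periodic
(`L > 0`) with `∫₀ᴸ f(x + s e₃) ds = 0` for every `x`, and let `g ≥ 0` be a bounded measurable
weight, independent of `x₃` and vanishing off a cylinder. Then
`(2π/L)² ∫_{zSlab L 0} g f² ≤ ∫_{zSlab L 0} g (∂₃f)²` (`∂₃f = Df(·) e₃`). (Vertical averaging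
`setLIntegral_zSlab_mul_verticalIntegral` + the pointwise inequality on vertical lines; the same
scheme as `slab_wirtinger` of the S7d chain.)
[cite: HanWangXie2023, Thm 1.1, proof §§2–3 (periodic pressure, helical identities, Saint-Venant estimate) (source of the ARGUMENT this module implements; this declaration is the cell’s own lemma or plumbing, NOT a printed statement)] -/
theorem slab_poincare_of_verticalMean_eq_zero {L : ℝ} (hL : 0 < L)
    {f : EuclideanSpace ℝ (Fin 3) → ℝ} (hf : ContDiff ℝ 1 f) (hper : IsAxiallyPeriodic L f)
    (hmean : ∀ x, ∫ s in (0 : ℝ)..L, f (x + s • eZ) = 0)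
    {g : EuclideanSpace ℝ (Fin 3) → ℝ} (hgm : Measurable g)
    (hg0 : ∀ x, 0 ≤ g x) (hgz : ∀ (x : EuclideanSpace ℝ (Fin 3)) (s : ℝ), g (x + s • eZ) = g x)
    {G : ℝ} (hgG : ∀ x, g x ≤ G) {ρ : ℝ} (hgρ : ∀ x, ρ ≤ cylRadius x → g x = 0) :
    (2 * Real.pi / L) ^ 2 * ∫ x in zSlab L 0, g x * f x ^ 2 ≤
      ∫ x in zSlab L 0, g x * (fderiv ℝ f x eZ) ^ 2 := by
  set df : EuclideanSpace ℝ (Fin 3) → ℝ := fun y => fderiv ℝ f y eZ with hdf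
  have hfc : Continuous f := hf.continuous
  have hdfc : Continuous df := (hf.continuous_fderiv one_ne_zero).clm_apply continuous_const
  have hdfper : IsAxiallyPeriodic L df := fun y => by
    show fderiv ℝ f (y + L • EuclideanSpace.single 2 1) eZ = fderiv ℝ f y eZ
    rw [isAxiallyPeriodic_fderiv hper y]
  -- the two densities
  set f₁ : EuclideanSpace ℝ (Fin 3) → ℝ := fun x => f x ^ 2 with hf₁
  set f₂ : EuclideanSpace ℝ (Fin 3) → ℝ := fun x => df x ^ 2 with hf₂
  have hf₁c : Continuous f₁ := hfc.pow 2
  have hf₂c : Continuous f₂ := hdfc.pow 2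
  have hf₁per : IsAxiallyPeriodic L f₁ := fun x => by simp only [hf₁]; rw [hper x]
  have hf₂per : IsAxiallyPeriodic L f₂ := fun x => by simp only [hf₂]; rw [hdfper x]
  -- vertical averaging
  have key₁ := setLIntegral_zSlab_mul_verticalIntegral hL hgm hg0 hgz hf₁c (fun x => sq_nonneg _) hf₁per
  have key₂ := setLIntegral_zSlab_mul_verticalIntegral hL hgm hg0 hgz hf₂c (fun x => sq_nonneg _) hf₂per
  -- pointwise vertical Poincaré–Wirtinger
  have hAB : ∀ x : EuclideanSpace ℝ (Fin 3),
      (2 * Real.pi / L) ^ 2 * (g x * ∫ s in (0 : ℝ)..L, f₁ (x + s • eZ)) ≤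
        g x * ∫ s in (0 : ℝ)..L, f₂ (x + s • eZ) := by
    intro x
    have h := vertical_poincare_of_mean_eq_zero hL hf hper x (hmean x)
    have hg := hg0 x
    calc (2 * Real.pi / L) ^ 2 * (g x * ∫ s in (0 : ℝ)..L, f₁ (x + s • eZ))
        = g x * ((2 * Real.pi / L) ^ 2 * ∫ s in (0 : ℝ)..L, f (x + s • eZ) ^ 2) := by
          simp only [hf₁]; ring
      _ ≤ g x * ∫ s in (0 : ℝ)..L, f₂ (x + s • eZ) := by
          simp only [hf₂, hdf]
          exact mul_le_mul_of_nonneg_left h hg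
  -- the inequality between Lebesgue integrals
  set I₁ : ℝ≥0∞ := ∫⁻ x in zSlab L 0, ENNReal.ofReal (g x * f₁ x) with hI₁
  set I₂ : ℝ≥0∞ := ∫⁻ x in zSlab L 0, ENNReal.ofReal (g x * f₂ x) with hI₂
  have hc0 : 0 ≤ (2 * Real.pi / L) ^ 2 := sq_nonneg _
  have hle : ENNReal.ofReal ((2 * Real.pi / L) ^ 2) * (ENNReal.ofReal L * I₁) ≤
      ENNReal.ofReal L * I₂ := by
    rw [← key₁, ← key₂, ← lintegral_const_mul' _ _ ENNReal.ofReal_ne_top]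
    refine lintegral_mono fun x => ?_
    rw [← ENNReal.ofReal_mul hc0]
    exact ENNReal.ofReal_le_ofReal (hAB x)
  have hL0 : ENNReal.ofReal L ≠ 0 := by simpa using hL
  have hle' : ENNReal.ofReal ((2 * Real.pi / L) ^ 2) * I₁ ≤ I₂ := by
    rw [← mul_assoc, mul_comm (ENNReal.ofReal _) (ENNReal.ofReal L), mul_assoc] at hle
    exact (ENNReal.mul_le_mul_iff_right hL0 ENNReal.ofReal_ne_top).1 hle
  -- integrability of the two integrands on the slab
  obtain ⟨B₂, hB₂⟩ := (isCompact_closedBall (0 : EuclideanSpace ℝ (Fin 3)) (|ρ| + L)).exists_bound_of_continuousOn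
    hf₂c.continuousOn
  have hG0 : 0 ≤ G := (hg0 0).trans (hgG 0)
  have hF0 : ∀ (φ : EuclideanSpace ℝ (Fin 3) → ℝ) (x : EuclideanSpace ℝ (Fin 3)),
      ρ ≤ cylRadius x → g x * φ x = 0 := fun φ x hx => by rw [hgρ x hx, zero_mul]
  have hFB : ∀ (φ : EuclideanSpace ℝ (Fin 3) → ℝ) (B : ℝ),
      (∀ x ∈ Metric.closedBall (0 : EuclideanSpace ℝ (Fin 3)) (|ρ| + L), ‖φ x‖ ≤ B) →
      ∀ x : EuclideanSpace ℝ (Fin 3), ‖x‖ ≤ |ρ| + L → ‖g x * φ x‖ ≤ G * B := by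
    intro φ B hB x hx
    rw [norm_mul, Real.norm_of_nonneg (hg0 x)]
    exact mul_le_mul (hgG x) (hB x (mem_closedBall_zero_iff.2 hx)) (norm_nonneg _) hG0
  have hm₁ : AEStronglyMeasurable (fun x => g x * f₁ x) volume :=
    (hgm.mul hf₁c.measurable).aestronglyMeasurable
  have hm₂ : AEStronglyMeasurable (fun x => g x * f₂ x) volume :=
    (hgm.mul hf₂c.measurable).aestronglyMeasurable
  have hint₂ : IntegrableOn (fun x => g x * f₂ x) (zSlab L 0) volume :=
    integrableOn_zSlab_of_bound hL hm₂ (hF0 f₂) (hFB f₂ B₂ hB₂)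
  -- back to Bochner integrals
  have hnn₁ : 0 ≤ᵐ[volume.restrict (zSlab L 0)] fun x => g x * f₁ x :=
    Eventually.of_forall fun x => mul_nonneg (hg0 x) (sq_nonneg _)
  have hnn₂ : 0 ≤ᵐ[volume.restrict (zSlab L 0)] fun x => g x * f₂ x :=
    Eventually.of_forall fun x => mul_nonneg (hg0 x) (sq_nonneg _)
  have e₁ : ∫ x in zSlab L 0, g x * f x ^ 2 = I₁.toReal :=
    integral_eq_lintegral_of_nonneg_ae hnn₁ hm₁.restrict
  have e₂ : ∫ x in zSlab L 0, g x * (fderiv ℝ f x eZ) ^ 2 = I₂.toReal :=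
    integral_eq_lintegral_of_nonneg_ae hnn₂ hm₂.restrict
  have hI₂fin : I₂ ≠ ⊤ := by
    have h := hint₂.2
    rw [hasFiniteIntegral_iff_enorm] at h
    exact (lt_of_le_of_lt (lintegral_ofReal_le_lintegral_enorm _) h).ne
  rw [e₁, e₂, ← ENNReal.toReal_ofReal hc0, ← ENNReal.toReal_mul]
  exact ENNReal.toReal_mono hI₂fin hle'

end Literature.Analysis.SteadySlabLiouville.HelicalSlab

end Part5

/-!
## Part 6 — port of `Summits/NavierStokesRegularity/NavierStokesRegularity/Theorems/ScenarioCensusHelicalSlabRadial.lean` (8 declarations kept)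

# Census row S6 (bounded helical steady flows): the radial velocity `⟪x_h, U⟫`, its Poincaré
# inequality on one period, and the radial structure of the cut-off terms

Support file for the scenario census of `NavierStokesRegularity` (cell `pub/ns-census`, block S,
row S6 = Han–Wang–Xie, arXiv:2312.10382, Thm 1.1; tree FACT
`Literature.Analysis.FluidPDE.HanWangXie2023_helical_liouville`). In the printed Saint-Venant
estimate (§3) every cut-off term carries the factor `u · ∇φ_R = u^r φ_R'(r)`, and `u^r` is
controlled by the Poincaré inequality (A122) on the period because its vertical means vanish.
In Cartesian vocabulary (`x_h = horizPart x`, `r u^r = ⟪x_h, U⟫`):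

* `radial_contDiff`, `radial_periodic`, `fderiv_radial_eZ` — `x ↦ ⟪x_h, U x⟫` is smooth, axially
  periodic, with `∂₃⟪x_h, U⟫ = ⟪x_h, ∂₃U⟫`;
* `radial_poincare_annulus` — `∫_S χ ⟪x_h, U⟫² ≤ (L/2π)² (2r)² ∫_S χ |DU|²` on the dyadic annulus
  `χ = 𝟙{r ≤ ρ < 2r}` of one period `S`, when the vertical period means of `⟪x_h, U⟫` vanish
  (`slab_poincare_of_verticalMean_eq_zero`);
* `cylCutoff_fderiv_apply_eq`, `abs_cylCutoff_fderiv_apply_le` — the derivative of the cylindrical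
  cut-off `φ = cylCutoff r (2r)` along `U` is `a(x) ⟪x_h, U x⟫` with a smooth `z`-independent
  coefficient, and `|Dφ(x)(U x)| ≤ (C₀/r²) χ(x) |⟪x_h, U x⟫|`;
* `setIntegral_footPressure_mul_fderiv_cylCutoff_eq_zero` — `∫_S P(x_h) Dφ(x)(U x) dx = 0`
  (a `z`-independent weight against a function with zero vertical means);
* `abs_sub_footPressure_le` — `|P(x) − P(x_h)| ≤ K₃ L` on the period slab when `‖DP‖ ≤ K₃`.

No summit statement and no census row is proved in this file.

## References

* J. Han, Y. Wang, C. Xie, arXiv:2312.10382 (2023), §3, (A122) and (A126)–(A133). [HanWangXie2023]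
-/

section Part6

open _root_.MeasureTheory _root_.Set _root_.Function _root_.Filter _root_.InnerProductSpace
open scoped _root_.Topology _root_.ENNReal _root_.NNReal RealInnerProductSpace _root_.ContDiff

namespace Literature.Analysis.SteadySlabLiouville.HelicalSlab

open Literature.Analysis Literature.Analysis.FluidPDE
open Literature.Analysis.SteadySlabLiouville.PeriodicSlab

/-! ### The radial velocity `⟪x_h, U⟫` -/

/-- `x ↦ ⟪x_h, U x⟫` is `Cⁿ` if `U` is.
[cite: HanWangXie2023, Thm 1.1, proof §§2–3 (periodic pressure, helical identities, Saint-Venant estimate) (source of the ARGUMENT this module implements; this declaration is the cell’s own lemma or plumbing, NOT a printed statement)] -/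
theorem radial_contDiff {n : WithTop ℕ∞} {U : EuclideanSpace ℝ (Fin 3) → EuclideanSpace ℝ (Fin 3)}
    (hU : ContDiff ℝ n U) : ContDiff ℝ n fun x => ⟪horizPart x, U x⟫ :=
  horizPart.contDiff.inner ℝ hU

/-- `x ↦ ⟪x_h, U x⟫` is axially periodic if `U` is.
[cite: HanWangXie2023, Thm 1.1, proof §§2–3 (periodic pressure, helical identities, Saint-Venant estimate) (source of the ARGUMENT this module implements; this declaration is the cell’s own lemma or plumbing, NOT a printed statement)] -/
theorem radial_periodic {L : ℝ} {U : EuclideanSpace ℝ (Fin 3) → EuclideanSpace ℝ (Fin 3)}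
    (hper : IsAxiallyPeriodic L U) : IsAxiallyPeriodic L fun x => ⟪horizPart x, U x⟫ := by
  intro x
  show ⟪horizPart (x + L • EuclideanSpace.single 2 (1 : ℝ)), U (x + L • EuclideanSpace.single 2 1)⟫ = _
  rw [hper x]
  have : horizPart (x + L • EuclideanSpace.single 2 (1 : ℝ)) = horizPart x := horizPart_add_smul_eZ x L
  rw [this]

/-- `∂₃⟪x_h, U⟫ = ⟪x_h, ∂₃U⟫` (the horizontal projection does not see `e₃`).
[cite: HanWangXie2023, Thm 1.1, proof §§2–3 (periodic pressure, helical identities, Saint-Venant estimate) (source of the ARGUMENT this module implements; this declaration is the cell’s own lemma or plumbing, NOT a printed statement)] -/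
theorem fderiv_radial_eZ {U : EuclideanSpace ℝ (Fin 3) → EuclideanSpace ℝ (Fin 3)}
    (hU : Differentiable ℝ U) (x : EuclideanSpace ℝ (Fin 3)) :
    fderiv ℝ (fun y => ⟪horizPart y, U y⟫) x eZ = ⟪horizPart x, fderiv ℝ U x eZ⟫ := by
  rw [fderiv_inner_apply ℝ horizPart.differentiableAt (hU x), horizPart.fderiv, horizPart_eZ,
    inner_zero_left, add_zero]

/-- Pointwise: `χ ⟪x_h, ∂₃U⟫² ≤ (2r)² χ |DU|²` on the annulus `{r ≤ ρ < 2r}` (`r ≥ 0`).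
[cite: HanWangXie2023, Thm 1.1, proof §§2–3 (periodic pressure, helical identities, Saint-Venant estimate) (source of the ARGUMENT this module implements; this declaration is the cell’s own lemma or plumbing, NOT a printed statement)] -/
theorem indicator_mul_radial_deriv_sq_le {r : ℝ} (hr : 0 ≤ r)
    {U : EuclideanSpace ℝ (Fin 3) → EuclideanSpace ℝ (Fin 3)} (x : EuclideanSpace ℝ (Fin 3)) :
    {x | r ≤ cylRadius x ∧ cylRadius x < 2 * r}.indicator (fun _ => (1 : ℝ)) x *
        ⟪horizPart x, fderiv ℝ U x eZ⟫ ^ 2 ≤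
      (2 * r) ^ 2 * ({x | r ≤ cylRadius x ∧ cylRadius x < 2 * r}.indicator (fun _ => (1 : ℝ)) x *
        frobeniusNormSq (fderiv ℝ U x)) := by
  by_cases hx : x ∈ {x | r ≤ cylRadius x ∧ cylRadius x < 2 * r}
  · rw [Set.indicator_of_mem hx, one_mul, one_mul]
    have hρ : cylRadius x < 2 * r := hx.2
    have heZ : ‖(eZ : EuclideanSpace ℝ (Fin 3))‖ = 1 := by simp [eZ]
    have h1 : |⟪horizPart x, fderiv ℝ U x eZ⟫| ≤ 2 * r * ‖fderiv ℝ U x‖ := by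
      calc |⟪horizPart x, fderiv ℝ U x eZ⟫| ≤ ‖horizPart x‖ * ‖fderiv ℝ U x eZ‖ := abs_real_inner_le_norm _ _
        _ ≤ (2 * r) * (‖fderiv ℝ U x‖ * ‖(eZ : EuclideanSpace ℝ (Fin 3))‖) := by
            rw [norm_horizPart]
            exact mul_le_mul hρ.le (ContinuousLinearMap.le_opNorm _ _) (norm_nonneg _) (by linarith)
        _ = 2 * r * ‖fderiv ℝ U x‖ := by rw [heZ, mul_one]
    have h2 : ⟪horizPart x, fderiv ℝ U x eZ⟫ ^ 2 ≤ (2 * r * ‖fderiv ℝ U x‖) ^ 2 := by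
      rw [← sq_abs]; exact pow_le_pow_left₀ (abs_nonneg _) h1 2
    have h3 : ‖fderiv ℝ U x‖ ^ 2 ≤ frobeniusNormSq (fderiv ℝ U x) := sq_opNorm_le_frobeniusNormSq _
    calc ⟪horizPart x, fderiv ℝ U x eZ⟫ ^ 2 ≤ (2 * r) ^ 2 * ‖fderiv ℝ U x‖ ^ 2 := by rw [← mul_pow]; exact h2
      _ ≤ (2 * r) ^ 2 * frobeniusNormSq (fderiv ℝ U x) := mul_le_mul_of_nonneg_left h3 (sq_nonneg _)
  · rw [Set.indicator_of_notMem hx]; simp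

/-- **The Poincaré inequality for the radial velocity on a dyadic annulus of one period.** Let
`U` be smooth and axially `L`-periodic (`L > 0`), with `|DU|² ≤ B`, and suppose the vertical period
means of `⟪x_h, U⟫` vanish. Then for `r > 0`, with `χ = 𝟙{r ≤ ρ < 2r}` and `S = zSlab L 0`,
`∫_S χ ⟪x_h, U⟫² ≤ (L/2π)² (2r)² ∫_S χ |DU|²`.
[cite: HanWangXie2023, Thm 1.1, proof §§2–3 (periodic pressure, helical identities, Saint-Venant estimate) (source of the ARGUMENT this module implements; this declaration is the cell’s own lemma or plumbing, NOT a printed statement)] -/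
theorem radial_poincare_annulus {L r : ℝ} (hL : 0 < L) (hr : 0 < r)
    {U : EuclideanSpace ℝ (Fin 3) → EuclideanSpace ℝ (Fin 3)} (hU : ContDiff ℝ 1 U)
    (hper : IsAxiallyPeriodic L U) {B : ℝ} (hB : ∀ x, frobeniusNormSq (fderiv ℝ U x) ≤ B)
    (hmean : ∀ x, ∫ s in (0 : ℝ)..L, ⟪horizPart x, U (x + s • eZ)⟫ = 0) :
    ∫ x in zSlab L 0, {x | r ≤ cylRadius x ∧ cylRadius x < 2 * r}.indicator (fun _ => (1 : ℝ)) x *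
        ⟪horizPart x, U x⟫ ^ 2 ≤
      (L / (2 * Real.pi)) ^ 2 * ((2 * r) ^ 2 *
        ∫ x in zSlab L 0, {x | r ≤ cylRadius x ∧ cylRadius x < 2 * r}.indicator (fun _ => (1 : ℝ)) x *
          frobeniusNormSq (fderiv ℝ U x)) := by
  set A : Set (EuclideanSpace ℝ (Fin 3)) := {x | r ≤ cylRadius x ∧ cylRadius x < 2 * r} with hA
  set χ : EuclideanSpace ℝ (Fin 3) → ℝ := A.indicator fun _ => (1 : ℝ) with hχ
  set ur : EuclideanSpace ℝ (Fin 3) → ℝ := fun x => ⟪horizPart x, U x⟫ with hur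
  have hAm : MeasurableSet A :=
    (isClosed_le continuous_const continuous_cylRadius).measurableSet.inter
      (isOpen_lt continuous_cylRadius continuous_const).measurableSet
  have hχm : Measurable χ := measurable_const.indicator hAm
  have hχnn : ∀ x, 0 ≤ χ x := fun x => Set.indicator_nonneg (fun _ _ => zero_le_one) x
  have hχle : ∀ x, χ x ≤ 1 := fun x => Set.indicator_le_self' (fun _ _ => zero_le_one) x
  have hcyl : ∀ (x : EuclideanSpace ℝ (Fin 3)) (s : ℝ), cylRadius (x + s • eZ) = cylRadius x :=
    fun x s => by simp [cylRadius, eZ]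
  have hχz : ∀ (x : EuclideanSpace ℝ (Fin 3)) (s : ℝ), χ (x + s • eZ) = χ x := fun x s => by
    simp only [hχ, Set.indicator_apply, hA, mem_setOf_eq, hcyl]
  have hχzero : ∀ x, 2 * r ≤ cylRadius x → χ x = 0 := fun x hx => by
    simp only [hχ, Set.indicator_apply, hA, mem_setOf_eq]
    rw [if_neg]; exact fun h => absurd h.2 (not_lt.2 hx)
  have hur1 : ContDiff ℝ 1 ur := radial_contDiff hU
  have hurper : IsAxiallyPeriodic L ur := radial_periodic hper
  have hUd : Differentiable ℝ U := hU.differentiable one_ne_zero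
  have hmean' : ∀ x, ∫ s in (0 : ℝ)..L, ur (x + s • eZ) = 0 := fun x => by
    simp only [hur, horizPart_add_smul_eZ]; exact hmean x
  -- Poincaré–Wirtinger with weight `χ`
  have h1 := slab_poincare_of_verticalMean_eq_zero hL hur1 hurper hmean' hχm hχnn hχz hχle
    (ρ := 2 * r) hχzero
  -- compare `χ (∂₃ ur)²` with `(2r)² χ |DU|²`
  have hDUc : Continuous (fderiv ℝ U) := hU.continuous_fderiv one_ne_zero
  have hFc : Continuous fun x => frobeniusNormSq (fderiv ℝ U x) :=
    continuous_frobeniusNormSq_fderiv hU one_ne_zero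
  have hB0 : 0 ≤ B := (frobeniusNormSq_nonneg _).trans (hB 0)
  have hint0 : IntegrableOn (fun x => χ x * frobeniusNormSq (fderiv ℝ U x)) (zSlab L 0) volume := by
    refine integrableOn_zSlab_of_bound hL ((hχm.mul hFc.measurable).aestronglyMeasurable)
      (ρ := 2 * r) (fun x hx => by rw [hχzero x hx, zero_mul]) (B := B) fun x _ => ?_
    rw [Real.norm_eq_abs, abs_mul, abs_of_nonneg (hχnn x), abs_of_nonneg (frobeniusNormSq_nonneg _)]
    exact (mul_le_mul (hχle x) (hB x) (frobeniusNormSq_nonneg _) zero_le_one).trans (by rw [one_mul])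
  have hint : IntegrableOn (fun x => (2 * r) ^ 2 * (χ x * frobeniusNormSq (fderiv ℝ U x)))
      (zSlab L 0) volume := hint0.const_mul _
  have h2 : ∫ x in zSlab L 0, χ x * (fderiv ℝ ur x eZ) ^ 2 ≤
      ∫ x in zSlab L 0, (2 * r) ^ 2 * (χ x * frobeniusNormSq (fderiv ℝ U x)) := by
    refine integral_mono_of_nonneg (Eventually.of_forall fun x => mul_nonneg (hχnn x) (sq_nonneg _))
      hint (Eventually.of_forall fun x => ?_)
    show χ x * (fderiv ℝ ur x eZ) ^ 2 ≤ (2 * r) ^ 2 * (χ x * frobeniusNormSq (fderiv ℝ U x))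
    rw [hur, fderiv_radial_eZ hUd x]
    exact indicator_mul_radial_deriv_sq_le hr.le x
  rw [integral_const_mul] at h2
  have hπL : 0 < (2 * Real.pi / L) ^ 2 := by positivity
  have hκ : (L / (2 * Real.pi)) ^ 2 * (2 * Real.pi / L) ^ 2 = 1 := by field_simp
  calc ∫ x in zSlab L 0, χ x * ur x ^ 2
      = (L / (2 * Real.pi)) ^ 2 * ((2 * Real.pi / L) ^ 2 * ∫ x in zSlab L 0, χ x * ur x ^ 2) := by
        rw [← mul_assoc, hκ, one_mul]
    _ ≤ (L / (2 * Real.pi)) ^ 2 * ((2 * r) ^ 2 * ∫ x in zSlab L 0, χ x * frobeniusNormSq (fderiv ℝ U x)) :=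
        mul_le_mul_of_nonneg_left (h1.trans h2) (sq_nonneg _)

/-! ### The radial structure of the cut-off derivative -/

/-- **The cut-off terms are radial.** For the cylindrical cut-off `φ = cylCutoff r (2r)`
(`r > 0`) with gradient constant `C₀`: there is a smooth coefficient `a`, invariant under axial
translations and vanishing off the cylinder `{ρ < 2r}`, with `Dφ(x) v = a(x) ⟪x_h, v⟫` for all
`x, v`, and `|Dφ(x) v| ≤ (C₀/r²) χ(x) |⟪x_h, v⟫|` with `χ = 𝟙{r ≤ ρ < 2r}`.
[cite: HanWangXie2023, Thm 1.1, proof §§2–3 (periodic pressure, helical identities, Saint-Venant estimate) (source of the ARGUMENT this module implements; this declaration is the cell’s own lemma or plumbing, NOT a printed statement)] -/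
theorem cylCutoff_fderiv_radial {r C₀ : ℝ} (hr : 0 < r)
    (hC₀ : ∀ (ρ₂ ρ₁ : ℝ), 0 ≤ ρ₂ → ρ₂ < ρ₁ → ∀ x : EuclideanSpace ℝ (Fin 3),
      ‖gradient (cylCutoff ρ₂ ρ₁) x‖ ≤ C₀ / (ρ₁ - ρ₂)) :
    ∃ a : EuclideanSpace ℝ (Fin 3) → ℝ, ContDiff ℝ (⊤ : ℕ∞) a ∧
      (∀ (x : EuclideanSpace ℝ (Fin 3)) (t : ℝ), a (x + t • eZ) = a x) ∧
      (∀ x, 2 * r ≤ cylRadius x → a x = 0) ∧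
      (∀ x v, fderiv ℝ (cylCutoff r (2 * r)) x v = a x * ⟪horizPart x, v⟫) ∧
      ∀ x v, |fderiv ℝ (cylCutoff r (2 * r)) x v| ≤
        C₀ / r ^ 2 * {x | r ≤ cylRadius x ∧ cylRadius x < 2 * r}.indicator (fun _ => (1 : ℝ)) x *
          |⟪horizPart x, v⟫| := by
  obtain ⟨a, ha, haz, -, hgrad⟩ := exists_gradient_cylCutoff_eq_smul_horizPart r (2 * r)
  set φ : EuclideanSpace ℝ (Fin 3) → ℝ := cylCutoff r (2 * r) with hφ
  have hr2 : r < 2 * r := by linarith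
  have hφnn : ∀ x, 0 ≤ φ x := cylCutoff_nonneg r (2 * r)
  have hφle : ∀ x, φ x ≤ 1 := cylCutoff_le_one r (2 * r)
  have hφone : ∀ x, cylRadius x ≤ r → φ x = 1 := fun x hx => cylCutoff_eq_one hr.le hr2 hx
  have hφzero : ∀ x, 2 * r ≤ cylRadius x → φ x = 0 := fun x hx => cylCutoff_eq_zero hr.le hr2 hx
  have hDφ : ∀ x v, fderiv ℝ φ x v = a x * ⟪horizPart x, v⟫ := fun x v => by
    rw [← inner_gradient_left, hgrad x, real_inner_smul_left]
  -- `Dφ = 0` off the annulus (local extremum of the cut-off)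
  have hD0 : ∀ x, x ∉ {x | r ≤ cylRadius x ∧ cylRadius x < 2 * r} → fderiv ℝ φ x = 0 := by
    intro x hx
    simp only [mem_setOf_eq, not_and_or, not_le, not_lt] at hx
    rcases hx with hx | hx
    · have hmax : IsLocalMax φ x := Eventually.of_forall fun y => by rw [hφone x hx.le]; exact hφle y
      exact hmax.fderiv_eq_zero
    · have hmin : IsLocalMin φ x := Eventually.of_forall fun y => by rw [hφzero x hx]; exact hφnn y
      exact hmin.fderiv_eq_zero
  -- `a = 0` off the outer cylinder
  have ha0 : ∀ x, 2 * r ≤ cylRadius x → a x = 0 := by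
    intro x hx
    have hg0 : gradient φ x = 0 := by
      rw [gradient, hD0 x (fun h => (not_lt.2 hx) h.2), map_zero]
    have h1 : a x • horizPart x = 0 := by rw [← hgrad x]; exact hg0
    have hxh : horizPart x ≠ 0 := by
      intro h0
      have : cylRadius x = 0 := by rw [← norm_horizPart, h0, norm_zero]
      linarith
    exact (smul_eq_zero.1 h1).resolve_right hxh
  refine ⟨a, ha ⊤, haz, ha0, hDφ, fun x v => ?_⟩
  by_cases hx : x ∈ {x | r ≤ cylRadius x ∧ cylRadius x < 2 * r}
  · rw [Set.indicator_of_mem hx, mul_one, hDφ, abs_mul]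
    refine mul_le_mul_of_nonneg_right ?_ (abs_nonneg _)
    -- `|a x| ρ = ‖∇φ x‖ ≤ C₀/r` and `ρ ≥ r`
    have hρ : r ≤ cylRadius x := hx.1
    have hρ0 : 0 < cylRadius x := lt_of_lt_of_le hr hρ
    have h1 : |a x| * cylRadius x ≤ C₀ / r := by
      rw [← norm_smul_horizPart, ← hgrad x]
      have := hC₀ r (2 * r) hr.le hr2 x
      rwa [show 2 * r - r = r by ring] at this
    rw [le_div_iff₀ (by positivity)]
    calc |a x| * r ^ 2 = (|a x| * r) * r := by ring
      _ ≤ (|a x| * cylRadius x) * r := by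
          exact mul_le_mul_of_nonneg_right (mul_le_mul_of_nonneg_left hρ (abs_nonneg _)) hr.le
      _ ≤ C₀ / r * r := mul_le_mul_of_nonneg_right h1 hr.le
      _ = C₀ := by field_simp
  · rw [hD0 x hx, Set.indicator_of_notMem hx]; simp

/-! ### The foot-point pressure -/

/-- **Integrals of the foot-point pressure against the cut-off term vanish**: with `a` a
continuous `z`-independent coefficient vanishing off the cylinder `{ρ < 2r}` (`r > 0`), `P`
continuous, and `U` continuous axially `L`-periodic with zero vertical period means of `⟪x_h, U⟫`:
`∫_S P(x_h) a(x) ⟪x_h, U x⟫ dx = 0`.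
[cite: HanWangXie2023, Thm 1.1, proof §§2–3 (periodic pressure, helical identities, Saint-Venant estimate) (source of the ARGUMENT this module implements; this declaration is the cell’s own lemma or plumbing, NOT a printed statement)] -/
theorem setIntegral_footPressure_mul_radial_eq_zero {L r : ℝ} (hL : 0 < L) (hr : 0 < r)
    {a : EuclideanSpace ℝ (Fin 3) → ℝ} (hac : Continuous a)
    (haz : ∀ (x : EuclideanSpace ℝ (Fin 3)) (t : ℝ), a (x + t • eZ) = a x)
    (ha0 : ∀ x, 2 * r ≤ cylRadius x → a x = 0)
    {P : EuclideanSpace ℝ (Fin 3) → ℝ} (hPc : Continuous P)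
    {U : EuclideanSpace ℝ (Fin 3) → EuclideanSpace ℝ (Fin 3)} (hUc : Continuous U)
    (hper : IsAxiallyPeriodic L U)
    (hmean : ∀ x, ∫ s in (0 : ℝ)..L, ⟪horizPart x, U (x + s • eZ)⟫ = 0) :
    ∫ x in zSlab L 0, (P (horizPart x) * a x) * ⟪horizPart x, U x⟫ = 0 := by
  -- bounds for the `z`-independent weight `g = (P ∘ horizPart) a`
  obtain ⟨A₀, hA₀⟩ := (isCompact_closedBall (0 : EuclideanSpace ℝ (Fin 3)) (2 * r)).exists_bound_of_continuousOn
    hac.continuousOn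
  obtain ⟨P₀, hP₀⟩ := (isCompact_closedBall (0 : EuclideanSpace ℝ (Fin 3)) (2 * r)).exists_bound_of_continuousOn
    hPc.continuousOn
  have hA₀0 : 0 ≤ A₀ := (norm_nonneg _).trans (hA₀ 0 (Metric.mem_closedBall_self (by linarith)))
  have hgm : Measurable fun x => P (horizPart x) * a x :=
    ((hPc.comp horizPart.continuous).mul hac).measurable
  have hgz : ∀ (x : EuclideanSpace ℝ (Fin 3)) (s : ℝ),
      P (horizPart (x + s • eZ)) * a (x + s • eZ) = P (horizPart x) * a x := fun x s => by
    rw [horizPart_add_smul_eZ, haz]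
  have hgG : ∀ x, |P (horizPart x) * a x| ≤ P₀ * A₀ := by
    intro x
    by_cases hx : 2 * r ≤ cylRadius x
    · rw [ha0 x hx, mul_zero, abs_zero]; exact mul_nonneg ((norm_nonneg _).trans (hP₀ 0
        (Metric.mem_closedBall_self (by linarith)))) hA₀0
    · rw [not_le] at hx
      have hmem : horizPart x ∈ Metric.closedBall (0 : EuclideanSpace ℝ (Fin 3)) (2 * r) := by
        rw [mem_closedBall_zero_iff, norm_horizPart]; exact hx.le
      have hax : a x = a (horizPart x) := by
        conv_lhs => rw [← horizPart_add_apply_two_smul_eZ x]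
        exact haz _ _
      rw [abs_mul, hax, ← Real.norm_eq_abs, ← Real.norm_eq_abs]
      exact mul_le_mul (hP₀ _ hmem) (hA₀ _ hmem) (norm_nonneg _)
        ((norm_nonneg _).trans (hP₀ _ hmem))
  have hgρ : ∀ x, 2 * r ≤ cylRadius x → P (horizPart x) * a x = 0 := fun x hx => by
    rw [ha0 x hx, mul_zero]
  have hmean' : ∀ x, ∫ s in (0 : ℝ)..L, ⟪horizPart (x + s • eZ), U (x + s • eZ)⟫ = 0 := fun x => by
    simp only [horizPart_add_smul_eZ]; exact hmean x
  exact setIntegral_zSlab_mul_eq_zero_of_verticalMean hL hgm hgz hgG hgρ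
    (horizPart.continuous.inner hUc) (radial_periodic hper) hmean'

/-- **The foot-point pressure bound on one period**: if `‖DP‖ ≤ K₃` then
`|P(x) − P(x_h)| ≤ K₃ L` for `x` in the period slab `zSlab L 0` (`x − x_h = x₂ e₃`, `0 ≤ x₂ < L`).
[cite: HanWangXie2023, Thm 1.1, proof §§2–3 (periodic pressure, helical identities, Saint-Venant estimate) (source of the ARGUMENT this module implements; this declaration is the cell’s own lemma or plumbing, NOT a printed statement)] -/
theorem abs_sub_footPressure_le {L K₃ : ℝ} {P : EuclideanSpace ℝ (Fin 3) → ℝ}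
    (hPd : Differentiable ℝ P) (hK₃ : ∀ x, ‖fderiv ℝ P x‖ ≤ K₃) {x : EuclideanSpace ℝ (Fin 3)}
    (hx : x ∈ zSlab L 0) : |P x - P (horizPart x)| ≤ K₃ * L := by
  have hK₃0 : 0 ≤ K₃ := (norm_nonneg _).trans (hK₃ 0)
  rw [mem_zSlab] at hx
  simp only [Int.cast_zero, zero_mul, zero_add, one_mul] at hx
  have h1 : ‖P x - P (horizPart x)‖ ≤ K₃ * ‖x - horizPart x‖ :=
    (convex_univ).norm_image_sub_le_of_norm_fderiv_le (fun y _ => hPd y) (fun y _ => hK₃ y)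
      (mem_univ _) (mem_univ _)
  have h2 : ‖x - horizPart x‖ = |x 2| := by
    rw [horizPart_apply, sub_sub_cancel, norm_smul, Real.norm_eq_abs]
    have : ‖(eZ : EuclideanSpace ℝ (Fin 3))‖ = 1 := by simp [eZ]
    rw [this, mul_one]
  rw [Real.norm_eq_abs, h2, abs_of_nonneg hx.1] at h1
  exact h1.trans (mul_le_mul_of_nonneg_left hx.2.le hK₃0)

end Literature.Analysis.SteadySlabLiouville.HelicalSlab

end Part6

/-!
## Part 7 — port of `Summits/NavierStokesRegularity/NavierStokesRegularity/Theorems/ScenarioCensusHelicalSlabEnergy.lean` (2 declarations kept)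

# Census row S6 (bounded helical steady flows): the localised energy identity of the steady
# Navier–Stokes system per period (nonlinear window identity)

Support file for the scenario census of `NavierStokesRegularity` (cell `pub/ns-census`, block S,
row S6 = Han–Wang–Xie, arXiv:2312.10382, Thm 1.1; tree FACT
`Literature.Analysis.FluidPDE.HanWangXie2023_helical_liouville`). Display (3.2) of the printed
proof ("Multiplying the first equation in (1.1) by `φ_R(r) u` and integrating by parts over the
slab `Ω = ℝ² × (0,1)`, one obtains
`∫_Ω |∇u|² φ_R = −∫_Ω ∇φ_R · ∇u · u + ∫_Ω ½|u|² u · ∇φ_R + ∫_Ω P u · ∇φ_R`", valid because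
the pressure is periodic, Lemma 2.7) in the tree's period-slab vocabulary:

* `steady_window_identity` — for a smooth steady solution `(U, P)` at unit viscosity
  (`IsLerayProfile 1 0 U P`) with `U` AND `P` axially `L`-periodic and an axially periodic `C²`
  cut-off `φ ≥ 0` vanishing off a cylinder (`S = zSlab L 0` one period, `eᵢ` the standard basis):
  `∫_S φ |DU|² = −Σᵢ ∫_S (∂ᵢφ) ⟪∂ᵢU, U⟫ + ½ ∫_S (Dφ·U) ‖U‖² + ∫_S P (Dφ·U)`.

Ingredients: the tree's whole-space localised energy identity
`Literature.Analysis.FluidPDE.IsLerayProfile.integral_mul_frobeniusNormSq_eq` (second-order form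
`½∫(ΔΦ)|U|²`) tested with `Φ = φ ω_L²`, Green's identity for `(Φ, |U|²)` to return to the
first-order form, and the window bookkeeping of `…PeriodicSlabWindow` (terms in which the
derivative falls on the window are integrals of periodic densities against `(ω²)'` and vanish —
this is where the periodicity of `P` enters).

No summit statement and no census row is proved in this file.

## References

* J. Han, Y. Wang, C. Xie, arXiv:2312.10382 (2023), §3, (3.2) = (muinteeq). [HanWangXie2023]
* G. Seregin, W. Wang, St. Petersburg Math. J. 31 (2020), proof of Prop. 2.1. [SereginWang2020]
-/

section Part7

open _root_.MeasureTheory _root_.Set _root_.Function _root_.Filter _root_.InnerProductSpace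
open scoped _root_.Topology _root_.ENNReal _root_.NNReal RealInnerProductSpace Laplacian _root_.ContDiff

namespace Literature.Analysis.SteadySlabLiouville.HelicalSlab

open Literature.Analysis Literature.Analysis.FluidPDE
open Literature.Analysis.SteadySlabLiouville.PeriodicSlab

/-- **The localised energy identity of the steady system, first-order form** (whole space). For
`IsLerayProfile 1 0 U P` and `Φ ∈ C²_c`:
`∫ Φ |DU|² = −Σᵢ ∫ (∂ᵢΦ) ⟪∂ᵢU, U⟫ + ½ ∫ (DΦ·U) ‖U‖² + ∫ P (DΦ·U)` — the tree identity
`IsLerayProfile.integral_mul_frobeniusNormSq_eq` with its Green term `½∫(ΔΦ)‖U‖²` integrated by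
parts once more.
[cite: HanWangXie2023, Thm 1.1, proof §§2–3 (periodic pressure, helical identities, Saint-Venant estimate) (source of the ARGUMENT this module implements; this declaration is the cell’s own lemma or plumbing, NOT a printed statement)] -/
theorem steady_energy_identity_firstOrder {ι : Type*} [Fintype ι]
    (b : OrthonormalBasis ι ℝ (EuclideanSpace ℝ (Fin 3)))
    {U : EuclideanSpace ℝ (Fin 3) → EuclideanSpace ℝ (Fin 3)} {P : EuclideanSpace ℝ (Fin 3) → ℝ}
    (h : IsLerayProfile 1 0 U P) {Φ : EuclideanSpace ℝ (Fin 3) → ℝ} (hΦ : ContDiff ℝ 2 Φ)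
    (hΦc : HasCompactSupport Φ) :
    ∫ x, Φ x * frobeniusNormSq (fderiv ℝ U x) =
      -(∑ i, ∫ x, fderiv ℝ Φ x (b i) * ⟪fderiv ℝ U x (b i), U x⟫) +
        2⁻¹ * (∫ x, fderiv ℝ Φ x (U x) * ‖U x‖ ^ 2) + ∫ x, P x * fderiv ℝ Φ x (U x) := by
  have hid := h.integral_mul_frobeniusNormSq_eq hΦ hΦc
  -- Green's identity for `v = Φ`, `w = ‖U‖²`
  have hU2 : ContDiff ℝ 2 U := h.contDiff_velocity
  have hU1 : ContDiff ℝ 1 U := hU2.of_le one_le_two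
  have hUd : ∀ x, DifferentiableAt ℝ U x := fun x => hU1.differentiable one_ne_zero x
  set g : EuclideanSpace ℝ (Fin 3) → ℝ := fun x => ‖U x‖ ^ 2 with hg
  have hg_inner : g = fun x => ⟪U x, U x⟫ := funext fun x => by rw [hg, real_inner_self_eq_norm_sq]
  have hg1 : ContDiff ℝ 1 g := by rw [hg_inner]; exact hU1.inner ℝ hU1
  have hDg : ∀ x v, fderiv ℝ g x v = 2 * ⟪fderiv ℝ U x v, U x⟫ := fun x v => by
    rw [hg_inner, fderiv_inner_apply ℝ (hUd x) (hUd x) v, real_inner_comm]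
    ring
  have green := FluidPDE.integral_inner_laplacian_add_eq_zero b (F' := ℝ) hΦ hg1 (Or.inl hΦc)
  have e1 : ∫ x, ⟪(Δ Φ) x, g x⟫ = ∫ x, (Δ Φ) x * ‖U x‖ ^ 2 :=
    integral_congr_ae (Eventually.of_forall fun x => by
      simp only [hg, RCLike.inner_apply, conj_trivial, mul_comm])
  have e2 : ∀ i, ∫ x, ⟪fderiv ℝ Φ x (b i), fderiv ℝ g x (b i)⟫ =
      2 * ∫ x, fderiv ℝ Φ x (b i) * ⟪fderiv ℝ U x (b i), U x⟫ := fun i => by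
    rw [← integral_const_mul]
    refine integral_congr_ae (Eventually.of_forall fun x => ?_)
    simp only [RCLike.inner_apply, conj_trivial, hDg]
    ring
  rw [e1] at green
  simp_rw [e2] at green
  rw [← Finset.mul_sum] at green
  rw [hid]
  linarith

/-- **The localised energy identity per period** (Han–Wang–Xie, §3, (3.2)). Let `(U, P)` be a
smooth steady solution at unit viscosity (`IsLerayProfile 1 0 U P`, `U, P ∈ C^∞`) with `U` and
`P` axially `L`-periodic (`L > 0`), and let `φ ≥ 0` be an axially periodic `C²` cut-off vanishing
off a cylinder. Then, with `S = zSlab L 0` and `eᵢ` the standard basis,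
`∫_S φ |DU|² = −Σᵢ ∫_S (∂ᵢφ)⟪∂ᵢU, U⟫ + ½ ∫_S (Dφ·U)‖U‖² + ∫_S P (Dφ·U)`.
[cite: HanWangXie2023, Thm 1.1, proof §§2–3 (periodic pressure, helical identities, Saint-Venant estimate) (source of the ARGUMENT this module implements; this declaration is the cell’s own lemma or plumbing, NOT a printed statement)] -/
theorem steady_window_identity {L : ℝ} (hL : 0 < L)
    {U : EuclideanSpace ℝ (Fin 3) → EuclideanSpace ℝ (Fin 3)} {P : EuclideanSpace ℝ (Fin 3) → ℝ}
    (h : IsLerayProfile 1 0 U P) (hU : ContDiff ℝ (⊤ : ℕ∞) U) (hP : ContDiff ℝ (⊤ : ℕ∞) P)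
    (hUper : IsAxiallyPeriodic L U) (hPper : IsAxiallyPeriodic L P)
    {φ : EuclideanSpace ℝ (Fin 3) → ℝ} (hφ : ContDiff ℝ 2 φ) (hφper : IsAxiallyPeriodic L φ)
    (hφnn : ∀ x, 0 ≤ φ x) {ρ : ℝ} (hφ0 : ∀ x, ρ ≤ cylRadius x → φ x = 0) :
    ∫ x in zSlab L 0, φ x * frobeniusNormSq (fderiv ℝ U x) =
      -(∑ i, ∫ x in zSlab L 0, fderiv ℝ φ x (EuclideanSpace.basisFun (Fin 3) ℝ i) *
          ⟪fderiv ℝ U x (EuclideanSpace.basisFun (Fin 3) ℝ i), U x⟫) +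
        2⁻¹ * (∫ x in zSlab L 0, fderiv ℝ φ x (U x) * ‖U x‖ ^ 2) +
        ∫ x in zSlab L 0, P x * fderiv ℝ φ x (U x) := by
  set b := EuclideanSpace.basisFun (Fin 3) ℝ with hb
  set ω2 : ℝ → ℝ := fun s => periodicWindow L s ^ 2 with hω2
  set Φ : EuclideanSpace ℝ (Fin 3) → ℝ := fun x => φ x * ω2 (x 2) with hΦ
  -- regularity and support
  have hφ1 : ContDiff ℝ 1 φ := hφ.of_le one_le_two
  have hU1 : ContDiff ℝ 1 U := contDiff_infty.1 hU 1
  have hUc : Continuous U := hU1.continuous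
  have hPc : Continuous P := hP.continuous
  have hφc : Continuous φ := hφ.continuous
  have hDUc : Continuous (fderiv ℝ U) := hU1.continuous_fderiv one_ne_zero
  have hDφc : Continuous (fderiv ℝ φ) := hφ1.continuous_fderiv one_ne_zero
  have hω2 : ContDiff ℝ 2 ω2 := contDiff_periodicWindow_sq L
  have hω21 : ContDiff ℝ 1 ω2 := contDiff_periodicWindow_sq L
  have hΦ2 : ContDiff ℝ 2 Φ := contDiff_mul_comp_apply_two hφ hω2
  have hΦc : HasCompactSupport Φ :=
    hasCompactSupport_mul_comp_apply_two hφ0 (abs_le_of_periodicWindow_sq_ne_zero hL)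
  have hφD0 : ∀ x, ρ ≤ cylRadius x → fderiv ℝ φ x = 0 := fun x hx => by
    have hmin : IsLocalMin φ x := Eventually.of_forall fun y => by rw [hφ0 x hx]; exact hφnn y
    exact hmin.fderiv_eq_zero
  have hDΦ : ∀ (x v : EuclideanSpace ℝ (Fin 3)),
      fderiv ℝ Φ x v = ω2 (x 2) * fderiv ℝ φ x v + φ x * deriv ω2 (x 2) * v 2 := fun x v =>
    fderiv_mul_comp_apply_two (hφ1.differentiable one_ne_zero x) (hω21.differentiable one_ne_zero _) v
  have hDUper : IsAxiallyPeriodic L (fderiv ℝ U) := isAxiallyPeriodic_fderiv hUper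
  have hDφper : IsAxiallyPeriodic L (fderiv ℝ φ) := isAxiallyPeriodic_fderiv hφper
  -- the whole-space identity
  have id := steady_energy_identity_firstOrder b h hΦ2 hΦc
  -- (0) `φ |DU|²`
  have hFc : Continuous fun x => frobeniusNormSq (fderiv ℝ U x) :=
    continuous_frobeniusNormSq_fderiv hU1 one_ne_zero
  have e0 : ∫ x, Φ x * frobeniusNormSq (fderiv ℝ U x) =
      ∫ x in zSlab L 0, φ x * frobeniusNormSq (fderiv ℝ U x) := by
    obtain ⟨c0, -, -, -⟩ := window_bookkeeping hL (Q := fun x => φ x * frobeniusNormSq (fderiv ℝ U x))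
      (hφc.mul hFc) (fun x => by simp only [hφper x, hDUper x]) (ρ := ρ)
      (fun x hx => by rw [hφ0 x hx, zero_mul])
    rw [← c0]; refine integral_congr_ae (Eventually.of_forall fun x => ?_)
    simp only [hΦ]; ring
  -- (1) `∂ᵢΦ ⟪∂ᵢU, U⟫`
  have e1 : ∀ i, ∫ x, fderiv ℝ Φ x (b i) * ⟪fderiv ℝ U x (b i), U x⟫ =
      ∫ x in zSlab L 0, fderiv ℝ φ x (b i) * ⟪fderiv ℝ U x (b i), U x⟫ := by
    intro i
    obtain ⟨cA, -, iA, -⟩ := window_bookkeeping hL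
      (Q := fun x => fderiv ℝ φ x (b i) * ⟪fderiv ℝ U x (b i), U x⟫)
      ((hDφc.clm_apply continuous_const).mul ((hDUc.clm_apply continuous_const).inner hUc))
      (fun x => by simp only [hDφper x, hDUper x, hUper x]) (ρ := ρ)
      (fun x hx => by rw [hφD0 x hx]; simp)
    obtain ⟨-, cB, -, iB⟩ := window_bookkeeping hL
      (Q := fun x => φ x * (b i) 2 * ⟪fderiv ℝ U x (b i), U x⟫)
      ((hφc.mul continuous_const).mul ((hDUc.clm_apply continuous_const).inner hUc))
      (fun x => by simp only [hφper x, hDUper x, hUper x]) (ρ := ρ)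
      (fun x hx => by rw [hφ0 x hx]; simp)
    rw [← cA, ← add_zero (∫ x, fderiv ℝ φ x (b i) * _ * _), ← cB, ← integral_add iA iB]
    refine integral_congr_ae (Eventually.of_forall fun x => ?_)
    simp only [hDΦ]; ring
  -- (2) `DΦ·U ‖U‖²`
  have e2 : ∫ x, fderiv ℝ Φ x (U x) * ‖U x‖ ^ 2 =
      ∫ x in zSlab L 0, fderiv ℝ φ x (U x) * ‖U x‖ ^ 2 := by
    obtain ⟨cA, -, iA, -⟩ := window_bookkeeping hL
      (Q := fun x => fderiv ℝ φ x (U x) * ‖U x‖ ^ 2)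
      ((hDφc.clm_apply hUc).mul (hUc.norm.pow 2))
      (fun x => by simp only [hDφper x, hUper x]) (ρ := ρ)
      (fun x hx => by rw [hφD0 x hx]; simp)
    obtain ⟨-, cB, -, iB⟩ := window_bookkeeping hL
      (Q := fun x => φ x * (U x) 2 * ‖U x‖ ^ 2)
      ((hφc.mul ((continuous_apply 2).comp ((PiLp.continuous_ofLp 2 _).comp hUc))).mul
        (hUc.norm.pow 2))
      (fun x => by simp only [hφper x, hUper x]) (ρ := ρ)
      (fun x hx => by rw [hφ0 x hx]; simp)
    rw [← cA, ← add_zero (∫ x, fderiv ℝ φ x (U x) * _ * _), ← cB, ← integral_add iA iB]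
    refine integral_congr_ae (Eventually.of_forall fun x => ?_)
    simp only [hDΦ]; ring
  -- (3) `P DΦ·U` (here the periodicity of the pressure is used)
  have e3 : ∫ x, P x * fderiv ℝ Φ x (U x) = ∫ x in zSlab L 0, P x * fderiv ℝ φ x (U x) := by
    obtain ⟨cA, -, iA, -⟩ := window_bookkeeping hL
      (Q := fun x => P x * fderiv ℝ φ x (U x))
      (hPc.mul (hDφc.clm_apply hUc))
      (fun x => by simp only [hDφper x, hPper x, hUper x]) (ρ := ρ)
      (fun x hx => by rw [hφD0 x hx]; simp)
    obtain ⟨-, cB, -, iB⟩ := window_bookkeeping hL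
      (Q := fun x => P x * φ x * (U x) 2)
      ((hPc.mul hφc).mul ((continuous_apply 2).comp ((PiLp.continuous_ofLp 2 _).comp hUc)))
      (fun x => by simp only [hφper x, hPper x, hUper x]) (ρ := ρ)
      (fun x hx => by rw [hφ0 x hx]; simp)
    rw [← cA, ← add_zero (∫ x, P x * _ * _), ← cB, ← integral_add iA iB]
    refine integral_congr_ae (Eventually.of_forall fun x => ?_)
    simp only [hDΦ]; ring
  rw [e0, e2, e3] at id
  simp_rw [e1] at id
  exact id

end Literature.Analysis.SteadySlabLiouville.HelicalSlab

end Part7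

/-!
## Part 8 — port of `Summits/NavierStokesRegularity/NavierStokesRegularity/Theorems/ScenarioCensusHelicalSlabTerms.lean` (5 declarations kept)

# Census row S6 (bounded helical steady flows): the weighted dyadic energy inequality

Support file for the scenario census of `NavierStokesRegularity` (cell `pub/ns-census`, block S,
row S6 = Han–Wang–Xie, arXiv:2312.10382, Thm 1.1; tree FACT
`Literature.Analysis.FluidPDE.HanWangXie2023_helical_liouville`). Printed proof, §3 (Step 2,
"Saint-Venant type estimate"): every cut-off term of the energy identity (3.2) is bounded through
`‖u^r‖_{L²(𝒪_R)} ≤ C‖∂_z u^r‖_{L²(𝒪_R)}` (Poincaré, zero vertical means) and the bounds on `u`,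
`∇u`, `∇P`. Here, on the dyadic annulus `{r ≤ ρ < 2r}` of one period `S = zSlab L 0` with the
cut-off `φ = cylCutoff r (2r)`, for every `r ≥ 1` and every splitting parameter `λ > 0`:

* `helical_dyadic_weighted_estimate` —
  `∫_S φ |DU|² ≤ a λ r + c (∫_S χ |DU|²)/(λ r)` with explicit `a, c` (depending on `sup ‖U‖`,
  `sup ‖DP‖`, `L` and the cut-off constant), for a smooth steady solution at unit viscosity with
  `U`, `P` axially periodic and ZERO vertical period means of `⟪x_h, U⟫` (the helical input,
  `…HelicalSlabFlux`). The pressure term is split as `P = (P − P(x_h)) + P(x_h)`: the foot-point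
  part integrates to zero against the radial cut-off term, the rest is `O(L ‖DP‖_∞)` — this
  replaces the Bogovskiĭ corrector `Ψ_{R,θ}` of the printed proof.

Inputs by name: `steady_window_identity` (`…HelicalSlabEnergy`), `radial_poincare_annulus`,
`cylCutoff_fderiv_radial`, `setIntegral_footPressure_mul_radial_eq_zero`, `abs_sub_footPressure_le`
(`…HelicalSlabRadial`), `volume_zSlab_inter_cyl_le` (`…PeriodicSlabBounds`). Sequel:
`…HelicalSlabLiouville`. No summit statement and no census row is proved in this file.

## References

* J. Han, Y. Wang, C. Xie, arXiv:2312.10382 (2023), §3, (A126)–(A134). [HanWangXie2023]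
-/

section Part8

open _root_.MeasureTheory _root_.Set _root_.Function _root_.Filter _root_.InnerProductSpace
open scoped _root_.Topology _root_.ENNReal _root_.NNReal RealInnerProductSpace Laplacian _root_.ContDiff

namespace Literature.Analysis.SteadySlabLiouville.HelicalSlab

open Literature.Analysis Literature.Analysis.FluidPDE
open Literature.Analysis.SteadySlabLiouville.PeriodicSlab

/-! ### Elementary algebra (kept outside the long proof) -/

/-- Young: `y ≤ (μ + y²/μ)/2` for `μ > 0`.
[cite: HanWangXie2023, Thm 1.1, proof §§2–3 (periodic pressure, helical identities, Saint-Venant estimate) (source of the ARGUMENT this module implements; this declaration is the cell’s own lemma or plumbing, NOT a printed statement)] -/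
theorem young_abs_le (y : ℝ) {μ : ℝ} (hμ : 0 < μ) : |y| ≤ (μ + y ^ 2 / μ) / 2 := by
  have key : 0 ≤ (μ * 1 - |y|) ^ 2 / μ := by positivity
  rw [alg_sq_div μ 1 |y| hμ.ne', sq_abs] at key
  linarith

/-- Splitting of the radial dominating function.
[cite: HanWangXie2023, Thm 1.1, proof §§2–3 (periodic pressure, helical identities, Saint-Venant estimate) (source of the ARGUMENT this module implements; this declaration is the cell’s own lemma or plumbing, NOT a printed statement)] -/
theorem alg_dom (c r χ μ w : ℝ) (hr : r ≠ 0) (hμ : μ ≠ 0) :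
    c / r ^ 2 * χ * ((μ + w ^ 2 / μ) / 2) =
      c * μ / (2 * r ^ 2) * χ + c / (2 * μ * r ^ 2) * (χ * w ^ 2) := by
  field_simp

/-- Collecting the radial bound.
[cite: HanWangXie2023, Thm 1.1, proof §§2–3 (periodic pressure, helical identities, Saint-Venant estimate) (source of the ARGUMENT this module implements; this declaration is the cell’s own lemma or plumbing, NOT a printed statement)] -/
theorem alg_rad (c L κ D r lam : ℝ) (hr : r ≠ 0) (hlam : lam ≠ 0) :
    c * (lam * r) / (2 * r ^ 2) * (32 * L * r ^ 2) +
        c / (2 * (lam * r) * r ^ 2) * (κ * ((2 * r) ^ 2 * D)) =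
      16 * c * L * lam * r + 2 * c * κ * D / (lam * r) := by
  field_simp
  ring

/-- Collecting the Green-term bound.
[cite: HanWangXie2023, Thm 1.1, proof §§2–3 (periodic pressure, helical identities, Saint-Venant estimate) (source of the ARGUMENT this module implements; this declaration is the cell’s own lemma or plumbing, NOT a printed statement)] -/
theorem alg_green (C₀ M L D r lam : ℝ) (hr : r ≠ 0) (hlam : lam ≠ 0) :
    C₀ * M * lam / r * (32 * L * r ^ 2) + C₀ * M / (r * lam) * D =
      32 * C₀ * M * L * lam * r + C₀ * M * D / (lam * r) := by
  field_simp

/-! ### The estimate -/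

/-- **The weighted dyadic energy inequality for bounded periodic steady flows with mean-free
radial velocity** (Han–Wang–Xie, §3 Step 2, on the dyadic annulus `{r ≤ ρ < 2r}`). Let `(U, P)` be
a smooth steady solution at unit viscosity (`IsLerayProfile 1 0 U P`, `U, P ∈ C^∞`), both axially
`L`-periodic (`L > 0`), with `‖U‖ ≤ M`, `‖DP‖ ≤ K₃`, `|DU|² ≤ B`, and with ZERO vertical period
means of `⟪x_h, U⟫`; let `C₀` be the gradient constant of the cylindrical cut-offs. Then for
`r ≥ 1`, `λ > 0`, with `φ = cylCutoff r (2r)`, `χ = 𝟙{r ≤ ρ < 2r}`, `κ = (L/(2π))²`, `S = zSlab L 0`: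
`∫_S φ|DU|² ≤ (96 C₀ M L + 8 C₀ M² L + 16 C₀ K₃ L²) λ r + (3 C₀ M + C₀ M² κ + 2 C₀ K₃ L κ) (∫_S χ|DU|²)/(λ r)`.
[cite: HanWangXie2023, Thm 1.1, proof §§2–3 (periodic pressure, helical identities, Saint-Venant estimate) (source of the ARGUMENT this module implements; this declaration is the cell’s own lemma or plumbing, NOT a printed statement)] -/
theorem helical_dyadic_weighted_estimate {L M K₃ B C₀ : ℝ} (hL : 0 < L)
    {U : EuclideanSpace ℝ (Fin 3) → EuclideanSpace ℝ (Fin 3)} {P : EuclideanSpace ℝ (Fin 3) → ℝ}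
    (h : IsLerayProfile 1 0 U P) (hU : ContDiff ℝ (⊤ : ℕ∞) U) (hP : ContDiff ℝ (⊤ : ℕ∞) P)
    (hUper : IsAxiallyPeriodic L U) (hPper : IsAxiallyPeriodic L P)
    (hM : ∀ x, ‖U x‖ ≤ M) (hK₃ : ∀ x, ‖fderiv ℝ P x‖ ≤ K₃)
    (hB : ∀ x, frobeniusNormSq (fderiv ℝ U x) ≤ B)
    (hmean : ∀ x, ∫ s in (0 : ℝ)..L, ⟪horizPart x, U (x + s • eZ)⟫ = 0)
    (hC₀ : ∀ (ρ₂ ρ₁ : ℝ), 0 ≤ ρ₂ → ρ₂ < ρ₁ → ∀ x : EuclideanSpace ℝ (Fin 3),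
      ‖gradient (cylCutoff ρ₂ ρ₁) x‖ ≤ C₀ / (ρ₁ - ρ₂))
    {r : ℝ} (hr : 1 ≤ r) {lam : ℝ} (hlam : 0 < lam) :
    ∫ x in zSlab L 0, cylCutoff r (2 * r) x * frobeniusNormSq (fderiv ℝ U x) ≤
      (96 * C₀ * M * L + 8 * C₀ * M ^ 2 * L + 16 * C₀ * K₃ * L ^ 2) * lam * r +
        (3 * C₀ * M + C₀ * M ^ 2 * (L / (2 * Real.pi)) ^ 2 +
            2 * C₀ * K₃ * L * (L / (2 * Real.pi)) ^ 2) *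
          (∫ x in zSlab L 0,
            {x | r ≤ cylRadius x ∧ cylRadius x < 2 * r}.indicator (fun _ => (1 : ℝ)) x *
              frobeniusNormSq (fderiv ℝ U x)) / (lam * r) := by
  set b := EuclideanSpace.basisFun (Fin 3) ℝ with hb
  set S : Set (EuclideanSpace ℝ (Fin 3)) := zSlab L 0 with hS
  set F : EuclideanSpace ℝ (Fin 3) → ℝ := fun x => frobeniusNormSq (fderiv ℝ U x) with hF
  set ur : EuclideanSpace ℝ (Fin 3) → ℝ := fun x => ⟪horizPart x, U x⟫ with hur
  set κ : ℝ := (L / (2 * Real.pi)) ^ 2 with hκ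
  have hκ0 : 0 ≤ κ := sq_nonneg _
  have hr0 : 0 < r := by linarith
  have hr2 : r < 2 * r := by linarith
  have hU1 : ContDiff ℝ 1 U := contDiff_infty.1 hU 1
  have hUc : Continuous U := hU1.continuous
  have hUd : Differentiable ℝ U := hU1.differentiable one_ne_zero
  have hPc : Continuous P := hP.continuous
  have hPd : Differentiable ℝ P := (contDiff_infty.1 hP 1).differentiable one_ne_zero
  have hDUc : Continuous (fderiv ℝ U) := hU1.continuous_fderiv one_ne_zero
  have hFc : Continuous F := continuous_frobeniusNormSq_fderiv hU1 one_ne_zero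
  have hurc : Continuous ur := horizPart.continuous.inner hUc
  have hF0 : ∀ x, 0 ≤ F x := fun x => frobeniusNormSq_nonneg _
  have hM0 : 0 ≤ M := (norm_nonneg _).trans (hM 0)
  have hK₃0 : 0 ≤ K₃ := (norm_nonneg _).trans (hK₃ 0)
  have hdi : ∀ x i, ‖fderiv ℝ U x (b i)‖ ^ 2 ≤ F x := fun x i => norm_apply_sq_le_frobeniusNormSq b _ i
  -- the cut-off, its radial structure, and the annulus
  set φ : EuclideanSpace ℝ (Fin 3) → ℝ := cylCutoff r (2 * r) with hφ
  have hφ2 : ContDiff ℝ 2 φ := contDiff_cylCutoff r (2 * r)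
  have hφ1 : ContDiff ℝ 1 φ := contDiff_cylCutoff r (2 * r)
  have hφc : Continuous φ := hφ2.continuous
  have hDφc : Continuous (fderiv ℝ φ) := hφ1.continuous_fderiv one_ne_zero
  have hφnn : ∀ x, 0 ≤ φ x := cylCutoff_nonneg r (2 * r)
  have hφzero : ∀ x, 2 * r ≤ cylRadius x → φ x = 0 := fun x hx => cylCutoff_eq_zero hr0.le hr2 hx
  have hφper : IsAxiallyPeriodic L φ := isAxiallyPeriodic_cylCutoff L r (2 * r)
  obtain ⟨a, ha, haz, ha0, hDφa0, hDφle0⟩ := cylCutoff_fderiv_radial hr0 hC₀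
  have hDφa : ∀ x v, fderiv ℝ φ x v = a x * ⟪horizPart x, v⟫ := hDφa0
  have hDφle : ∀ x v, |fderiv ℝ φ x v| ≤
      C₀ / r ^ 2 * {x | r ≤ cylRadius x ∧ cylRadius x < 2 * r}.indicator (fun _ => (1 : ℝ)) x *
        |⟪horizPart x, v⟫| := hDφle0
  have hac : Continuous a := ha.continuous
  have hC₀0 : 0 ≤ C₀ := by
    have h1 := hC₀ r (2 * r) hr0.le hr2 0
    rw [show 2 * r - r = r by ring] at h1
    have h2 : 0 ≤ C₀ / r := (norm_nonneg _).trans h1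
    by_contra hneg
    exact absurd h2 (not_le.2 (div_neg_of_neg_of_pos (not_le.1 hneg) hr0))
  set A : Set (EuclideanSpace ℝ (Fin 3)) := {x | r ≤ cylRadius x ∧ cylRadius x < 2 * r} with hA
  have hAm : MeasurableSet A :=
    (isClosed_le continuous_const continuous_cylRadius).measurableSet.inter
      (isOpen_lt continuous_cylRadius continuous_const).measurableSet
  set χ : EuclideanSpace ℝ (Fin 3) → ℝ := A.indicator fun _ => (1 : ℝ) with hχ
  have hχm : Measurable χ := measurable_const.indicator hAm
  have hχnn : ∀ x, 0 ≤ χ x := fun x => Set.indicator_nonneg (fun _ _ => zero_le_one) x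
  have hχle : ∀ x, χ x ≤ 1 := fun x => Set.indicator_le_self' (fun _ _ => zero_le_one) x
  have hχzero : ∀ x, 2 * r ≤ cylRadius x → χ x = 0 := fun x hx => by
    simp only [hχ, Set.indicator_apply, hA, mem_setOf_eq]
    rw [if_neg]; exact fun h' => absurd h'.2 (not_lt.2 hx)
  -- `|∂ᵢφ| ≤ (2C₀/r) χ`
  have hDφi : ∀ x i, |fderiv ℝ φ x (b i)| ≤ 2 * C₀ / r * χ x := by
    intro x i
    have hle := hDφle x (b i)
    by_cases hx : x ∈ A
    · have hχ1 : χ x = 1 := by simp [hχ, hx]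
      rw [hχ1, mul_one] at hle ⊢
      have h1 : |⟪horizPart x, b i⟫| ≤ 2 * r := by
        calc |⟪horizPart x, b i⟫| ≤ ‖horizPart x‖ * ‖b i‖ := abs_real_inner_le_norm _ _
          _ ≤ 2 * r := by rw [b.orthonormal.1 i, mul_one, norm_horizPart]; exact hx.2.le
      calc |fderiv ℝ φ x (b i)| ≤ C₀ / r ^ 2 * |⟪horizPart x, b i⟫| := hle
        _ ≤ C₀ / r ^ 2 * (2 * r) := mul_le_mul_of_nonneg_left h1 (div_nonneg hC₀0 (sq_nonneg _))
        _ = 2 * C₀ / r := by field_simp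
    · have hχ0 : χ x = 0 := by simp [hχ, hx]
      rw [hχ0, mul_zero] at hle ⊢
      simpa using hle
  -- the identity per period
  have hid := steady_window_identity hL h hU hP hUper hPper hφ2 hφper hφnn hφzero
  -- the integrals
  set Iφ : ℝ := ∫ x in S, φ x * F x with hIφ
  set D : ℝ := ∫ x in S, χ x * F x with hD
  set V : ℝ := ∫ x in S, χ x with hVdef
  set J : ℝ := ∫ x in S, χ x * ur x ^ 2 with hJdef
  -- integrability on the slab
  have hχ_int : IntegrableOn χ S volume :=
    integrableOn_zSlab_of_bound hL hχm.aestronglyMeasurable (ρ := 2 * r) hχzero (B := 1)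
      fun x _ => by rw [Real.norm_eq_abs, abs_of_nonneg (hχnn x)]; exact hχle x
  have hB0 : 0 ≤ B := (hF0 0).trans (hB 0)
  have hD_int : IntegrableOn (fun x => χ x * F x) S volume := by
    refine integrableOn_zSlab_of_bound hL ((hχm.mul hFc.measurable).aestronglyMeasurable)
      (ρ := 2 * r) (fun x hx => by rw [hχzero x hx, zero_mul]) (B := B) fun x _ => ?_
    rw [Real.norm_eq_abs, abs_mul, abs_of_nonneg (hχnn x), abs_of_nonneg (hF0 x)]
    exact (mul_le_mul (hχle x) (hB x) (hF0 x) zero_le_one).trans (by rw [one_mul])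
  obtain ⟨Bu, hBu⟩ := (isCompact_closedBall (0 : EuclideanSpace ℝ (Fin 3)) (|2 * r| + L)).exists_bound_of_continuousOn
    (hurc.pow 2).continuousOn
  have hJ_int : IntegrableOn (fun x => χ x * ur x ^ 2) S volume := by
    refine integrableOn_zSlab_of_bound hL ((hχm.mul (hurc.pow 2).measurable).aestronglyMeasurable)
      (ρ := 2 * r) (fun x hx => by rw [hχzero x hx, zero_mul]) (B := Bu) fun x hx => ?_
    rw [Real.norm_eq_abs, abs_mul, abs_of_nonneg (hχnn x)]
    have h1 : |ur x ^ 2| ≤ Bu := by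
      rw [← Real.norm_eq_abs]; exact hBu x (mem_closedBall_zero_iff.2 hx)
    exact (mul_le_mul (hχle x) h1 (abs_nonneg _) zero_le_one).trans (by rw [one_mul])
  have hD0 : 0 ≤ D := setIntegral_nonneg (measurableSet_zSlab L 0) fun x _ => mul_nonneg (hχnn x) (hF0 x)
  -- volume of the annulus period and the radial Poincaré inequality
  have hV : V ≤ 32 * L * r ^ 2 := by
    have h1 : V = volume.real (S ∩ A) := by
      rw [hVdef, hχ, setIntegral_indicator hAm, setIntegral_const, smul_eq_mul, mul_one]
    rw [h1, measureReal_def]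
    refine ENNReal.toReal_le_of_le_ofReal (by positivity) ?_
    calc volume (S ∩ A) ≤ volume (zSlab L 0 ∩ {x | cylRadius x < 2 * r}) :=
          measure_mono fun x hx => ⟨hx.1, hx.2.2⟩
      _ ≤ ENNReal.ofReal (8 * L * (2 * r) ^ 2) := volume_zSlab_inter_cyl_le hL (by linarith)
      _ = ENNReal.ofReal (32 * L * r ^ 2) := by ring_nf
  have hJ : J ≤ κ * ((2 * r) ^ 2 * D) := radial_poincare_annulus hL hr0 hU1 hUper hB hmean
  -- the generic radial bound: `|g| ≤ (c/r²) χ |ur|` on `S` ⇒ `|∫_S g| ≤ 16 c L λ r + 2 c κ D/(λ r)`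
  have hrad : ∀ c : ℝ, 0 ≤ c → ∀ g : EuclideanSpace ℝ (Fin 3) → ℝ, IntegrableOn g S volume →
      (∀ x ∈ S, |g x| ≤ c / r ^ 2 * χ x * |ur x|) →
      |∫ x in S, g x| ≤ 16 * c * L * lam * r + 2 * c * κ * D / (lam * r) := by
    intro c hc g hgi hgb
    set μ : ℝ := lam * r with hμdef
    have hμ : 0 < μ := mul_pos hlam hr0
    have hdom_int : IntegrableOn
        (fun x => c * μ / (2 * r ^ 2) * χ x + c / (2 * μ * r ^ 2) * (χ x * ur x ^ 2)) S volume :=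
      (hχ_int.const_mul _).add (hJ_int.const_mul _)
    have h1 := norm_integral_le_of_norm_le (μ := volume.restrict S) hdom_int
      ((ae_restrict_iff' (measurableSet_zSlab L 0)).2 (Eventually.of_forall fun x hx => (?_ :
        ‖g x‖ ≤ c * μ / (2 * r ^ 2) * χ x + c / (2 * μ * r ^ 2) * (χ x * ur x ^ 2))))
    · rw [Real.norm_eq_abs] at h1
      have h2 : ∫ x in S, (c * μ / (2 * r ^ 2) * χ x + c / (2 * μ * r ^ 2) * (χ x * ur x ^ 2)) =
          c * μ / (2 * r ^ 2) * V + c / (2 * μ * r ^ 2) * J := by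
        rw [integral_add (hχ_int.const_mul _) (hJ_int.const_mul _), integral_const_mul,
          integral_const_mul]
      rw [h2] at h1
      have h3 : c * μ / (2 * r ^ 2) * V ≤ c * μ / (2 * r ^ 2) * (32 * L * r ^ 2) :=
        mul_le_mul_of_nonneg_left hV (by positivity)
      have h4 : c / (2 * μ * r ^ 2) * J ≤ c / (2 * μ * r ^ 2) * (κ * ((2 * r) ^ 2 * D)) :=
        mul_le_mul_of_nonneg_left hJ (by positivity)
      have e := alg_rad c L κ D r lam hr0.ne' hlam.ne'
      rw [← hμdef] at e
      linarith
    · rw [Real.norm_eq_abs]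
      have hy := young_abs_le (ur x) hμ
      have h5 : 0 ≤ c / r ^ 2 * χ x := mul_nonneg (div_nonneg hc (sq_nonneg _)) (hχnn x)
      calc |g x| ≤ c / r ^ 2 * χ x * |ur x| := hgb x hx
        _ ≤ c / r ^ 2 * χ x * ((μ + ur x ^ 2 / μ) / 2) := mul_le_mul_of_nonneg_left hy h5
        _ = c * μ / (2 * r ^ 2) * χ x + c / (2 * μ * r ^ 2) * (χ x * ur x ^ 2) :=
            alg_dom c r (χ x) μ (ur x) hr0.ne' hμ.ne'
  -- T1: the Green terms
  have hT1 : ∀ i, |∫ x in S, fderiv ℝ φ x (b i) * ⟪fderiv ℝ U x (b i), U x⟫| ≤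
      32 * C₀ * M * L * lam * r + C₀ * M * D / (lam * r) := by
    intro i
    have hdom_int : IntegrableOn
        (fun x => C₀ * M * lam / r * χ x + C₀ * M / (r * lam) * (χ x * F x)) S volume :=
      (hχ_int.const_mul _).add (hD_int.const_mul _)
    have h1 := norm_integral_le_of_norm_le (μ := volume.restrict S) hdom_int
      (Eventually.of_forall fun x => (?_ :
        ‖fderiv ℝ φ x (b i) * ⟪fderiv ℝ U x (b i), U x⟫‖ ≤
          C₀ * M * lam / r * χ x + C₀ * M / (r * lam) * (χ x * F x)))
    · rw [Real.norm_eq_abs] at h1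
      have h2 : ∫ x in S, (C₀ * M * lam / r * χ x + C₀ * M / (r * lam) * (χ x * F x)) =
          C₀ * M * lam / r * V + C₀ * M / (r * lam) * D := by
        rw [integral_add (hχ_int.const_mul _) (hD_int.const_mul _), integral_const_mul,
          integral_const_mul]
      rw [h2] at h1
      have h3 : C₀ * M * lam / r * V ≤ C₀ * M * lam / r * (32 * L * r ^ 2) :=
        mul_le_mul_of_nonneg_left hV (by positivity)
      have e := alg_green C₀ M L D r lam hr0.ne' hlam.ne'
      linarith
    · rw [norm_mul, Real.norm_eq_abs]
      have h2 := hDφi x i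
      have h3 : ‖⟪fderiv ℝ U x (b i), U x⟫‖ ≤ ‖fderiv ℝ U x (b i)‖ * M :=
        (norm_inner_le_norm _ _).trans (mul_le_mul_of_nonneg_left (hM x) (norm_nonneg _))
      have hy : ‖fderiv ℝ U x (b i)‖ ≤ (lam + ‖fderiv ℝ U x (b i)‖ ^ 2 / lam) / 2 := by
        have := young_abs_le ‖fderiv ℝ U x (b i)‖ hlam
        rwa [abs_of_nonneg (norm_nonneg _)] at this
      have hy' : ‖fderiv ℝ U x (b i)‖ ≤ (lam + F x / lam) / 2 :=
        hy.trans (by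
          have := div_le_div_of_nonneg_right (hdi x i) hlam.le
          linarith)
      have h5 : 0 ≤ 2 * C₀ / r * χ x := mul_nonneg (by positivity) (hχnn x)
      calc |fderiv ℝ φ x (b i)| * ‖⟪fderiv ℝ U x (b i), U x⟫‖
          ≤ (2 * C₀ / r * χ x) * (‖fderiv ℝ U x (b i)‖ * M) := mul_le_mul h2 h3 (norm_nonneg _) h5
        _ = (2 * C₀ / r * χ x * M) * ‖fderiv ℝ U x (b i)‖ := by ring
        _ ≤ (2 * C₀ / r * χ x * M) * ((lam + F x / lam) / 2) :=
            mul_le_mul_of_nonneg_left hy' (mul_nonneg h5 hM0)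
        _ = C₀ * M * lam / r * χ x + C₀ * M / (r * lam) * (χ x * F x) := by
            field_simp
  have hT1s : |∑ i, ∫ x in S, fderiv ℝ φ x (b i) * ⟪fderiv ℝ U x (b i), U x⟫| ≤
      3 * (32 * C₀ * M * L * lam * r) + 3 * (C₀ * M * D / (lam * r)) := by
    refine (Finset.abs_sum_le_sum_abs _ _).trans ?_
    calc ∑ i, |∫ x in S, fderiv ℝ φ x (b i) * ⟪fderiv ℝ U x (b i), U x⟫|
        ≤ ∑ _i : Fin 3, (32 * C₀ * M * L * lam * r + C₀ * M * D / (lam * r)) :=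
          Finset.sum_le_sum fun i _ => hT1 i
      _ = 3 * (32 * C₀ * M * L * lam * r) + 3 * (C₀ * M * D / (lam * r)) := by simp
  -- T2: the cubic term
  have hT2_int : IntegrableOn (fun x => fderiv ℝ φ x (U x) * ‖U x‖ ^ 2) S volume :=
    integrableOn_zSlab_of_eq_zero_of_le_cylRadius (Q := fun x => fderiv ℝ φ x (U x) * ‖U x‖ ^ 2)
      ((hDφc.clm_apply hUc).mul (hUc.norm.pow 2))
      (fun x hx => by show fderiv ℝ φ x (U x) * ‖U x‖ ^ 2 = 0; rw [hDφa x (U x), ha0 x hx, zero_mul, zero_mul]) L 0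
  have hT2 : |∫ x in S, fderiv ℝ φ x (U x) * ‖U x‖ ^ 2| ≤
      16 * (C₀ * M ^ 2) * L * lam * r + 2 * (C₀ * M ^ 2) * κ * D / (lam * r) := by
    refine hrad (C₀ * M ^ 2) (by positivity) _ hT2_int fun x _ => ?_
    rw [abs_mul, abs_of_nonneg (sq_nonneg ‖U x‖)]
    have h1 := hDφle x (U x)
    have h2 : ‖U x‖ ^ 2 ≤ M ^ 2 := pow_le_pow_left₀ (norm_nonneg _) (hM x) 2
    have h5 : 0 ≤ C₀ / r ^ 2 * χ x * |ur x| :=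
      mul_nonneg (mul_nonneg (div_nonneg hC₀0 (sq_nonneg _)) (hχnn x)) (abs_nonneg _)
    calc |fderiv ℝ φ x (U x)| * ‖U x‖ ^ 2 ≤ (C₀ / r ^ 2 * χ x * |ur x|) * M ^ 2 :=
          mul_le_mul h1 h2 (sq_nonneg _) h5
      _ = C₀ * M ^ 2 / r ^ 2 * χ x * |ur x| := by ring
  -- T3: the pressure term, split at the foot point
  have hT3a_int : IntegrableOn (fun x => (P x - P (horizPart x)) * fderiv ℝ φ x (U x)) S volume :=
    integrableOn_zSlab_of_eq_zero_of_le_cylRadius (Q := fun x => (P x - P (horizPart x)) * fderiv ℝ φ x (U x))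
      ((hPc.sub (hPc.comp horizPart.continuous)).mul (hDφc.clm_apply hUc))
      (fun x hx => by
        show (P x - P (horizPart x)) * fderiv ℝ φ x (U x) = 0
        rw [hDφa x (U x), ha0 x hx, zero_mul, mul_zero]) L 0
  have hT3b_int : IntegrableOn (fun x => (P (horizPart x) * a x) * ur x) S volume :=
    integrableOn_zSlab_of_eq_zero_of_le_cylRadius (Q := fun x => (P (horizPart x) * a x) * ur x)
      (((hPc.comp horizPart.continuous).mul hac).mul hurc)
      (fun x hx => by show (P (horizPart x) * a x) * ur x = 0; rw [ha0 x hx, mul_zero, zero_mul]) L 0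
  have hT3eq : ∫ x in S, P x * fderiv ℝ φ x (U x) =
      (∫ x in S, (P x - P (horizPart x)) * fderiv ℝ φ x (U x)) +
        ∫ x in S, (P (horizPart x) * a x) * ur x := by
    rw [← integral_add hT3a_int hT3b_int]
    refine setIntegral_congr_fun (measurableSet_zSlab L 0) fun x _ => ?_
    simp only [hur, hDφa x (U x)]
    ring
  have hT3b : ∫ x in S, (P (horizPart x) * a x) * ur x = 0 :=
    setIntegral_footPressure_mul_radial_eq_zero hL hr0 hac haz ha0 hPc hUc hUper hmean
  have hT3a : |∫ x in S, (P x - P (horizPart x)) * fderiv ℝ φ x (U x)| ≤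
      16 * (C₀ * K₃ * L) * L * lam * r + 2 * (C₀ * K₃ * L) * κ * D / (lam * r) := by
    refine hrad (C₀ * K₃ * L) (by positivity) _ hT3a_int fun x hx => ?_
    rw [abs_mul]
    have h1 : |P x - P (horizPart x)| ≤ K₃ * L := abs_sub_footPressure_le hPd hK₃ hx
    have h2 := hDφle x (U x)
    have h5 : 0 ≤ C₀ / r ^ 2 * χ x * |ur x| :=
      mul_nonneg (mul_nonneg (div_nonneg hC₀0 (sq_nonneg _)) (hχnn x)) (abs_nonneg _)
    calc |P x - P (horizPart x)| * |fderiv ℝ φ x (U x)| ≤ (K₃ * L) * (C₀ / r ^ 2 * χ x * |ur x|) :=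
          mul_le_mul h1 h2 (abs_nonneg _) (mul_nonneg hK₃0 hL.le)
      _ = C₀ * K₃ * L / r ^ 2 * χ x * |ur x| := by ring
  -- assemble
  have hmain : Iφ = -(∑ i, ∫ x in S, fderiv ℝ φ x (b i) * ⟪fderiv ℝ U x (b i), U x⟫) +
      2⁻¹ * (∫ x in S, fderiv ℝ φ x (U x) * ‖U x‖ ^ 2) +
      ∫ x in S, P x * fderiv ℝ φ x (U x) := hid
  rw [hT3eq, hT3b, add_zero] at hmain
  have a1 := (abs_le.1 hT1s).1
  have a2 := (abs_le.1 hT2).2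
  have a3 := (abs_le.1 hT3a).2
  have e : 3 * (32 * C₀ * M * L * lam * r) + 3 * (C₀ * M * D / (lam * r)) +
      2⁻¹ * (16 * (C₀ * M ^ 2) * L * lam * r + 2 * (C₀ * M ^ 2) * κ * D / (lam * r)) +
      (16 * (C₀ * K₃ * L) * L * lam * r + 2 * (C₀ * K₃ * L) * κ * D / (lam * r)) =
      (96 * C₀ * M * L + 8 * C₀ * M ^ 2 * L + 16 * C₀ * K₃ * L ^ 2) * lam * r +
        (3 * C₀ * M + C₀ * M ^ 2 * κ + 2 * C₀ * K₃ * L * κ) * D / (lam * r) := by ring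
  have hfin : Iφ ≤ 3 * (32 * C₀ * M * L * lam * r) + 3 * (C₀ * M * D / (lam * r)) +
      2⁻¹ * (16 * (C₀ * M ^ 2) * L * lam * r + 2 * (C₀ * M ^ 2) * κ * D / (lam * r)) +
      (16 * (C₀ * K₃ * L) * L * lam * r + 2 * (C₀ * K₃ * L) * κ * D / (lam * r)) := by
    rw [hmain]; linarith
  rw [← e]
  exact hfin

end Literature.Analysis.SteadySlabLiouville.HelicalSlab

end Part8

/-!
## Part 9 — port of `Summits/NavierStokesRegularity/NavierStokesRegularity/Theorems/ScenarioCensusHelicalSlabFlux.lean` (8 declarations kept)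

# Census row S6 (bounded helical steady flows): the helical flux lemma — the radial velocity has
# zero mean over every vertical period

Support file for the scenario census of `NavierStokesRegularity` (cell `pub/ns-census`, block S,
row S6 = Han–Wang–Xie, arXiv:2312.10382 = Sci. China Math. 2025, Thm 1.1; tree FACT
`Literature.Analysis.FluidPDE.HanWangXie2023_helical_liouville`). Display (A117) of the printed
proof (§3, proof of Lemma 3.1): for a divergence-free helically symmetric field,
"`∂_r ∫₀¹ r u^r dz = −∫₀¹ ∂_θ u^θ + ∂_z(r u^z) dz = −∫₀¹ κ ∂_z u^θ + ∂_z(r u^z) dz = 0`. This implies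
`∫₀¹ r u^r dz = 0`" — the radial velocity has ZERO MEAN over every vertical period, which is what
makes the Poincaré inequality (A122) for `u^r` available. Here is that statement in Cartesian
vocabulary, `r u^r(x) = ⟪x_h, u(x)⟫` (`x_h = horizPart x`):

* `helical_radial_verticalMean_eq_zero` — for `U ∈ C¹` with bounded derivative, divergence free,
  axially `L`-periodic and helically symmetric of pitch `κ` (`IsHelicallySymmetric κ U`):
  `∫₀ᴸ ⟪x_h, U(x + s e₃)⟫ ds = 0` for every `x`.

Proof (no cylindrical coordinates): the vertical period integral `g(x) = ∫₀ᴸ U(x + s e₃) ds` is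
`C¹` (`hasFDerivAt_verticalIntegral`), invariant under axial translations, divergence free, and
AXISYMMETRIC (screw motions act on vertical lines as rotations up to an axial shift, which the
period integral does not see: `verticalIntegral_rotZ`); for such a field the radial flux
`h(x) = ⟪x_h, g(x)⟫` satisfies `Dh(x)[x_h] = r² div g = 0` (infinitesimal axisymmetry
`Dg(x)[Jx] = J g(x)`, `Literature.Analysis.FluidPDE.IsAxisymmetric.fderiv_rotGen`), so `h` is
constant along horizontal rays and vanishes on the axis, hence everywhere.

No summit statement and no census row is proved in this file.

## References

* J. Han, Y. Wang, C. Xie, arXiv:2312.10382 (2023), §2 Lemma 2.2 (helical identities) and §3,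
  (A117)–(A118). [HanWangXie2023]
-/

section Part9

open _root_.MeasureTheory _root_.Set _root_.Function _root_.Filter
open scoped _root_.Topology _root_.InnerProductSpace RealInnerProductSpace

namespace Literature.Analysis.SteadySlabLiouville.HelicalSlab

open Literature.Analysis Literature.Analysis.FluidPDE
open Literature.Analysis.SteadySlabLiouville.PeriodicSlab

/-! ### Screw motions act on vertical lines -/

/-- Rotations about the axis commute with axial translations: `R_θ(x + c e₃) = R_θ x + c e₃`.
[cite: HanWangXie2023, Thm 1.1, proof §§2–3 (periodic pressure, helical identities, Saint-Venant estimate) (source of the ARGUMENT this module implements; this declaration is the cell’s own lemma or plumbing, NOT a printed statement)] -/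
theorem rotZ_add_smul_eZ (θ c : ℝ) (x : EuclideanSpace ℝ (Fin 3)) :
    rotZ θ (x + c • eZ) = rotZ θ x + c • eZ := by
  ext i
  fin_cases i <;> simp [rotZ, eZ]

/-- A helically symmetric field on the vertical line through `R_θ x`:
`U(R_θ x + s e₃) = R_θ U(x + (s − κθ) e₃)`.
[cite: HanWangXie2023, Thm 1.1, proof §§2–3 (periodic pressure, helical identities, Saint-Venant estimate) (source of the ARGUMENT this module implements; this declaration is the cell’s own lemma or plumbing, NOT a printed statement)] -/
theorem apply_rotZ_add_smul_eZ_of_isHelicallySymmetric {κ : ℝ}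
    {U : EuclideanSpace ℝ (Fin 3) → EuclideanSpace ℝ (Fin 3)} (hsym : IsHelicallySymmetric κ U)
    (θ s : ℝ) (x : EuclideanSpace ℝ (Fin 3)) :
    U (rotZ θ x + s • eZ) = rotZ θ (U (x + (s - κ * θ) • eZ)) := by
  have h := hsym θ (x + (s - κ * θ) • eZ)
  rw [rotZ_add_smul_eZ, add_assoc, ← add_smul, show s - κ * θ + κ * θ = s by ring] at h
  exact h

/-! ### The vertical period integral `g(x) = ∫₀ᴸ U(x + s e₃) ds` -/

/-- The vertical period integral of an axially `L`-periodic continuous field does not depend on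
the starting height: `∫₀ᴸ U(x + (t + s) e₃) ds = ∫₀ᴸ U(x + s e₃) ds`.
[cite: HanWangXie2023, Thm 1.1, proof §§2–3 (periodic pressure, helical identities, Saint-Venant estimate) (source of the ARGUMENT this module implements; this declaration is the cell’s own lemma or plumbing, NOT a printed statement)] -/
theorem verticalIntegral_shift {F : Type*} [NormedAddCommGroup F] [NormedSpace ℝ F] {L : ℝ}
    {U : EuclideanSpace ℝ (Fin 3) → F} (hper : IsAxiallyPeriodic L U)
    (x : EuclideanSpace ℝ (Fin 3)) (t : ℝ) :
    ∫ s in (0 : ℝ)..L, U (x + (t + s) • eZ) = ∫ s in (0 : ℝ)..L, U (x + s • eZ) := by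
  have hp : Function.Periodic (fun σ : ℝ => U (x + σ • eZ)) L := fun σ => by
    show U (x + (σ + L) • eZ) = U (x + σ • eZ)
    rw [add_smul, ← add_assoc]
    exact isAxiallyPeriodic_add_smul_eZ hper (x + σ • eZ)
  have h1 : ∫ s in (0 : ℝ)..L, U (x + (t + s) • eZ) = ∫ s in t..t + L, U (x + s • eZ) := by
    rw [show (fun s : ℝ => U (x + (t + s) • eZ)) = fun s : ℝ => (fun σ : ℝ => U (x + σ • eZ)) (t + s)
      from rfl, intervalIntegral.integral_comp_add_left (fun σ : ℝ => U (x + σ • eZ)) t]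
    simp
  rw [h1, hp.intervalIntegral_add_eq t 0, zero_add]

/-- The vertical period integral is invariant under axial translations.
[cite: HanWangXie2023, Thm 1.1, proof §§2–3 (periodic pressure, helical identities, Saint-Venant estimate) (source of the ARGUMENT this module implements; this declaration is the cell’s own lemma or plumbing, NOT a printed statement)] -/
theorem verticalIntegral_add_smul_eZ {F : Type*} [NormedAddCommGroup F] [NormedSpace ℝ F] {L : ℝ}
    {U : EuclideanSpace ℝ (Fin 3) → F} (hper : IsAxiallyPeriodic L U)
    (x : EuclideanSpace ℝ (Fin 3)) (t : ℝ) :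
    ∫ s in (0 : ℝ)..L, U (x + t • eZ + s • eZ) = ∫ s in (0 : ℝ)..L, U (x + s • eZ) := by
  have : (fun s : ℝ => U (x + t • eZ + s • eZ)) = fun s : ℝ => U (x + (t + s) • eZ) := by
    funext s; rw [add_smul, add_assoc]
  rw [this, verticalIntegral_shift hper x t]

/-- **The vertical period integral of a helically symmetric periodic field is axisymmetric**:
`∫₀ᴸ U(R_θ x + s e₃) ds = R_θ ∫₀ᴸ U(x + s e₃) ds`.
[cite: HanWangXie2023, Thm 1.1, proof §§2–3 (periodic pressure, helical identities, Saint-Venant estimate) (source of the ARGUMENT this module implements; this declaration is the cell’s own lemma or plumbing, NOT a printed statement)] -/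
theorem verticalIntegral_rotZ {κ L : ℝ} {U : EuclideanSpace ℝ (Fin 3) → EuclideanSpace ℝ (Fin 3)}
    (hUc : Continuous U) (hper : IsAxiallyPeriodic L U) (hsym : IsHelicallySymmetric κ U)
    (θ : ℝ) (x : EuclideanSpace ℝ (Fin 3)) :
    ∫ s in (0 : ℝ)..L, U (rotZ θ x + s • eZ) = rotZ θ (∫ s in (0 : ℝ)..L, U (x + s • eZ)) := by
  have h1 : (fun s : ℝ => U (rotZ θ x + s • eZ)) =
      fun s : ℝ => rotZL θ (U (x + (-(κ * θ) + s) • eZ)) := by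
    funext s
    rw [apply_rotZ_add_smul_eZ_of_isHelicallySymmetric hsym, rotZL_apply,
      show s - κ * θ = -(κ * θ) + s by ring]
  have hint : IntervalIntegrable (fun s : ℝ => U (x + (-(κ * θ) + s) • eZ)) volume 0 L :=
    (hUc.comp (continuous_const.add ((continuous_const.add continuous_id).smul
      continuous_const))).intervalIntegrable _ _
  rw [h1, (rotZL θ).intervalIntegral_comp_comm hint, rotZL_apply, verticalIntegral_shift hper x]

/-- On the axis the vertical period integral is an axial vector: its horizontal part vanishes.
[cite: HanWangXie2023, Thm 1.1, proof §§2–3 (periodic pressure, helical identities, Saint-Venant estimate) (source of the ARGUMENT this module implements; this declaration is the cell’s own lemma or plumbing, NOT a printed statement)] -/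
theorem horizPart_verticalIntegral_eq_zero_of_horizPart_eq_zero {κ L : ℝ}
    {U : EuclideanSpace ℝ (Fin 3) → EuclideanSpace ℝ (Fin 3)}
    (hUc : Continuous U) (hper : IsAxiallyPeriodic L U) (hsym : IsHelicallySymmetric κ U)
    {x : EuclideanSpace ℝ (Fin 3)} (hx : horizPart x = 0) :
    horizPart (∫ s in (0 : ℝ)..L, U (x + s • eZ)) = 0 := by
  set v : EuclideanSpace ℝ (Fin 3) := ∫ s in (0 : ℝ)..L, U (x + s • eZ) with hv
  have hx0 : x 0 = 0 := by simpa using congrArg (fun w : EuclideanSpace ℝ (Fin 3) => w 0) hx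
  have hx1 : x 1 = 0 := by simpa using congrArg (fun w : EuclideanSpace ℝ (Fin 3) => w 1) hx
  have hfix : rotZ Real.pi x = x := by
    ext i
    fin_cases i <;> simp [rotZ, hx0, hx1]
  have hrot : rotZ Real.pi v = v := by
    have h := verticalIntegral_rotZ hUc hper hsym Real.pi x
    rw [hfix] at h
    exact h.symm
  have hv0 : v 0 = 0 := by
    have h0 := congrArg (fun w : EuclideanSpace ℝ (Fin 3) => w 0) hrot
    simp only [rotZ_apply_zero, Real.cos_pi, Real.sin_pi] at h0
    linarith
  have hv1 : v 1 = 0 := by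
    have h1 := congrArg (fun w : EuclideanSpace ℝ (Fin 3) => w 1) hrot
    simp only [rotZ_apply_one, Real.cos_pi, Real.sin_pi] at h1
    linarith
  rw [horizPart_eq_toLp]
  ext i
  fin_cases i <;> simp [hv0, hv1]

/-- **Differentiation under the vertical period integral.** For `U ∈ C¹` with `‖DU‖ ≤ K`,
`x ↦ ∫₀ᴸ U(x + s e₃) ds` has derivative `∫₀ᴸ DU(x + s e₃) ds` at every point.
[cite: HanWangXie2023, Thm 1.1, proof §§2–3 (periodic pressure, helical identities, Saint-Venant estimate) (source of the ARGUMENT this module implements; this declaration is the cell’s own lemma or plumbing, NOT a printed statement)] -/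
theorem hasFDerivAt_verticalIntegral {F : Type*} [NormedAddCommGroup F] [NormedSpace ℝ F]
    [CompleteSpace F] {L : ℝ}
    {U : EuclideanSpace ℝ (Fin 3) → F} (hU : ContDiff ℝ 1 U) {K : ℝ}
    (hK : ∀ x, ‖fderiv ℝ U x‖ ≤ K) (x₀ : EuclideanSpace ℝ (Fin 3)) :
    HasFDerivAt (fun y => ∫ s in (0 : ℝ)..L, U (y + s • eZ))
      (∫ s in (0 : ℝ)..L, fderiv ℝ U (x₀ + s • eZ)) x₀ := by
  have hUd : Differentiable ℝ U := hU.differentiable one_ne_zero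
  have hUc : Continuous U := hU.continuous
  have hDUc : Continuous (fderiv ℝ U) := hU.continuous_fderiv one_ne_zero
  have hline : ∀ y : EuclideanSpace ℝ (Fin 3), Continuous fun s : ℝ => y + s • (eZ : EuclideanSpace ℝ (Fin 3)) :=
    fun y => continuous_const.add (continuous_id.smul continuous_const)
  refine intervalIntegral.hasFDerivAt_integral_of_dominated_of_fderiv_le (𝕜 := ℝ) (μ := volume)
    (F := fun y s => U (y + s • eZ)) (F' := fun y s => fderiv ℝ U (y + s • eZ)) (x₀ := x₀)
    (s := univ) (bound := fun _ => K) univ_mem ?_ ?_ ?_ ?_ ?_ ?_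
  · exact Eventually.of_forall fun y => ((hUc.comp (hline y)).aestronglyMeasurable)
  · exact (hUc.comp (hline x₀)).intervalIntegrable _ _
  · exact (hDUc.comp (hline x₀)).aestronglyMeasurable
  · exact Eventually.of_forall fun s _ y _ => hK _
  · exact intervalIntegrable_const
  · exact Eventually.of_forall fun s _ y _ => by
      have h := (hUd (y + s • eZ)).hasFDerivAt.comp y ((hasFDerivAt_id y).add_const (s • eZ))
      simpa [Function.comp_def] using h

/-! ### The radial flux of the averaged field -/

/-- **The helical flux lemma** (Han–Wang–Xie, §3, (A117)–(A118), Cartesian form). Let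
`U ∈ C¹(ℝ³; ℝ³)` have bounded derivative, be divergence free, axially `L`-periodic and helically
symmetric of pitch `κ` (`IsHelicallySymmetric κ U`). Then the radial velocity `r u^r = ⟪x_h, U⟫`
has zero mean over every vertical period: `∫₀ᴸ ⟪x_h, U(x + s e₃)⟫ ds = 0` for all `x`.
[cite: HanWangXie2023, Thm 1.1, proof §§2–3 (periodic pressure, helical identities, Saint-Venant estimate) (source of the ARGUMENT this module implements; this declaration is the cell’s own lemma or plumbing, NOT a printed statement)] -/
theorem helical_radial_verticalMean_eq_zero {κ L : ℝ}
    {U : EuclideanSpace ℝ (Fin 3) → EuclideanSpace ℝ (Fin 3)} (hU : ContDiff ℝ 1 U) {K : ℝ}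
    (hK : ∀ x, ‖fderiv ℝ U x‖ ≤ K) (hdiv : VectorCalculus.IsDivFree U)
    (hper : IsAxiallyPeriodic L U) (hsym : IsHelicallySymmetric κ U)
    (x : EuclideanSpace ℝ (Fin 3)) :
    ∫ s in (0 : ℝ)..L, ⟪horizPart x, U (x + s • eZ)⟫ = 0 := by
  have hUc : Continuous U := hU.continuous
  have hDUc : Continuous (fderiv ℝ U) := hU.continuous_fderiv one_ne_zero
  have hline : ∀ y : EuclideanSpace ℝ (Fin 3), Continuous fun s : ℝ => y + s • (eZ : EuclideanSpace ℝ (Fin 3)) :=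
    fun y => continuous_const.add (continuous_id.smul continuous_const)
  -- the averaged field and its derivative
  set g : EuclideanSpace ℝ (Fin 3) → EuclideanSpace ℝ (Fin 3) := fun y => ∫ s in (0 : ℝ)..L, U (y + s • eZ)
    with hg
  set Dg : EuclideanSpace ℝ (Fin 3) → (EuclideanSpace ℝ (Fin 3) →L[ℝ] EuclideanSpace ℝ (Fin 3)) :=
    fun y => ∫ s in (0 : ℝ)..L, fderiv ℝ U (y + s • eZ) with hDg
  have hgD : ∀ y, HasFDerivAt g (Dg y) y := fun y => hasFDerivAt_verticalIntegral hU hK y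
  have hgd : Differentiable ℝ g := fun y => (hgD y).differentiableAt
  have hgF : ∀ y, fderiv ℝ g y = Dg y := fun y => (hgD y).fderiv
  have hDint : ∀ y, IntervalIntegrable (fun s : ℝ => fderiv ℝ U (y + s • eZ)) volume 0 L :=
    fun y => (hDUc.comp (hline y)).intervalIntegrable _ _
  have hDg_apply : ∀ y v, Dg y v = ∫ s in (0 : ℝ)..L, fderiv ℝ U (y + s • eZ) v := fun y v => by
    rw [hDg]
    exact ContinuousLinearMap.intervalIntegral_apply (hDint y) v
  -- (1) `g` is axisymmetric, (2) invariant under axial translations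
  have hgsym : IsAxisymmetric g := fun θ y => verticalIntegral_rotZ hUc hper hsym θ y
  have hgz : ∀ (y : EuclideanSpace ℝ (Fin 3)) (t : ℝ), g (y + t • eZ) = g y :=
    fun y t => verticalIntegral_add_smul_eZ hper y t
  -- (3) `div g = 0`
  set τ : (EuclideanSpace ℝ (Fin 3) →L[ℝ] EuclideanSpace ℝ (Fin 3)) →L[ℝ] ℝ :=
    LinearMap.toContinuousLinearMap
      ((LinearMap.trace ℝ (EuclideanSpace ℝ (Fin 3))).comp (ContinuousLinearMap.coeLM ℝ)) with hτ
  have hτ_apply : ∀ T : EuclideanSpace ℝ (Fin 3) →L[ℝ] EuclideanSpace ℝ (Fin 3),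
      τ T = LinearMap.trace ℝ _ (T : EuclideanSpace ℝ (Fin 3) →ₗ[ℝ] EuclideanSpace ℝ (Fin 3)) :=
    fun T => rfl
  have hdivg : ∀ y, VectorCalculus.divergence g y = 0 := fun y => by
    rw [VectorCalculus.divergence, hgF y, ← hτ_apply, hDg, ← τ.intervalIntegral_comp_comm (hDint y)]
    have : (fun s : ℝ => τ (fderiv ℝ U (y + s • eZ))) = fun _ => (0 : ℝ) := by
      funext s
      rw [hτ_apply]
      exact hdiv (y + s • eZ)
    rw [this, intervalIntegral.integral_const, smul_zero]
  -- (4) `Dg(y) e₃ = 0`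
  have hDg_eZ : ∀ y, fderiv ℝ g y eZ = 0 := fun y => by
    have h1 : HasDerivAt (fun t : ℝ => g (y + t • eZ)) (fderiv ℝ g (y + (0 : ℝ) • eZ) eZ) 0 :=
      hasDerivAt_comp_add_smul_eZ hgd y 0
    have h2 : (fun t : ℝ => g (y + t • eZ)) = fun _ => g y := funext fun t => hgz y t
    rw [h2, zero_smul, add_zero] at h1
    exact h1.unique (hasDerivAt_const (0 : ℝ) (g y))
  -- (5) infinitesimal axisymmetry `Dg(y)[J y] = J g(y)`
  have hDg_rot : ∀ y, fderiv ℝ g y (rotGen y) = rotGen (g y) := fun y => hgsym.fderiv_rotGen (hgd y)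
  -- (6) the key identity `⟪Dg(y) y_h, y_h⟫ + ⟪y_h, g y⟫ = 0`
  set b := EuclideanSpace.basisFun (Fin 3) ℝ with hb
  have key : ∀ y : EuclideanSpace ℝ (Fin 3),
      ⟪fderiv ℝ g y (horizPart y), horizPart y⟫ + ⟪horizPart y, g y⟫ = 0 := by
    intro y
    set G := fderiv ℝ g y with hG
    -- entries of `G` in the standard basis
    have hb0 : b 0 = EuclideanSpace.single 0 (1 : ℝ) := by simp [hb]
    have hb1 : b 1 = EuclideanSpace.single 1 (1 : ℝ) := by simp [hb]
    have hb2 : b 2 = EuclideanSpace.single 2 (1 : ℝ) := by simp [hb]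
    -- trace
    have htr : ⟪b 0, G (b 0)⟫ + ⟪b 1, G (b 1)⟫ + ⟪b 2, G (b 2)⟫ = 0 := by
      have h := divergence_eq_sum_inner_fderiv b g y
      rw [hdivg y, Fin.sum_univ_three] at h
      rw [hG]; linarith
    have htr' : G (b 0) 0 + G (b 1) 1 + G (b 2) 2 = 0 := by
      have h := htr
      rw [hb0, hb1, hb2] at h ⊢
      simpa [EuclideanSpace.inner_single_left] using h
    -- axial column vanishes
    have hcol : G (b 2) = 0 := by rw [hb2, hG]; exact hDg_eZ y
    have hG22 : G (b 2) 2 = 0 := by rw [hcol]; rfl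
    -- infinitesimal axisymmetry in coordinates
    have hrot := hDg_rot y
    rw [← hG, rotGen_eq_sub_single, map_sub, map_smul, map_smul, ← hb0, ← hb1] at hrot
    have hr0 := congrArg (fun w : EuclideanSpace ℝ (Fin 3) => w 0) hrot
    have hr1 := congrArg (fun w : EuclideanSpace ℝ (Fin 3) => w 1) hrot
    simp only [PiLp.sub_apply, PiLp.smul_apply, smul_eq_mul, rotGen_apply_zero, rotGen_apply_one] at hr0 hr1
    -- expand the goal in coordinates
    have hhp : horizPart y = y 0 • b 0 + y 1 • b 1 := by
      rw [horizPart_eq_toLp, hb0, hb1]; ext i; fin_cases i <;> simp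
    have e1 : ⟪G (horizPart y), horizPart y⟫ =
        y 0 * (y 0 * G (b 0) 0 + y 1 * G (b 1) 0) + y 1 * (y 0 * G (b 0) 1 + y 1 * G (b 1) 1) := by
      rw [real_inner_comm, inner_horizPart_left, hhp, map_add, map_smul, map_smul]
      simp only [PiLp.add_apply, PiLp.smul_apply, smul_eq_mul]
    have e2 : ⟪horizPart y, g y⟫ = y 0 * g y 0 + y 1 * g y 1 := inner_horizPart_left y (g y)
    rw [e1, e2]
    linear_combination (y 0 ^ 2 + y 1 ^ 2) * htr' - (y 0 ^ 2 + y 1 ^ 2) * hG22 +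
      y 1 * hr0 - y 0 * hr1
  -- (7) the flux function `h(y) = ⟪y_h, g y⟫` is constant along horizontal rays
  set h : EuclideanSpace ℝ (Fin 3) → ℝ := fun y => ⟪horizPart y, g y⟫ with hh
  have hhd : ∀ y, HasFDerivAt h ((innerSL ℝ (horizPart y)).comp (fderiv ℝ g y) +
      (innerSL ℝ (g y)).comp horizPart) y := by
    intro y
    refine ((horizPart.hasFDerivAt (x := y)).inner ℝ (hgd y).hasFDerivAt).congr_fderiv ?_
    ext v
    simp only [_root_.add_apply, ContinuousLinearMap.comp_apply, innerSL_apply_apply,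
      fderivInnerCLM_apply, ContinuousLinearMap.prod_apply]
    rw [real_inner_comm (g y)]
  have hhD : ∀ y v, fderiv ℝ h y v = ⟪horizPart y, fderiv ℝ g y v⟫ + ⟪g y, horizPart v⟫ := by
    intro y v
    rw [(hhd y).fderiv]
    simp only [_root_.add_apply, ContinuousLinearMap.comp_apply, innerSL_apply_apply]
  -- along the ray `t ↦ c + t x_h` with `c = x₂ e₃` on the axis
  set c : EuclideanSpace ℝ (Fin 3) := (x 2) • eZ with hc
  have hc0 : horizPart c = 0 := by
    rw [hc, map_smul, horizPart_eZ, smul_zero]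
  have hray : ∀ t : ℝ, horizPart (c + t • horizPart x) = t • horizPart x := by
    intro t; rw [map_add, hc0, zero_add, map_smul, horizPart_horizPart]
  set ψ : ℝ → ℝ := fun t => h (c + t • horizPart x) with hψ
  have hψd : ∀ t, HasDerivAt ψ (fderiv ℝ h (c + t • horizPart x) (horizPart x)) t := by
    intro t
    have hl : HasDerivAt (fun τ : ℝ => c + τ • horizPart x) (horizPart x) t := by
      have := ((hasDerivAt_id t).smul_const (horizPart x)).const_add c
      simpa using this
    exact ((hhd _).comp_hasDerivAt t hl).congr_deriv (by rw [(hhd _).fderiv])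
  have hψ0 : ∀ t : ℝ, fderiv ℝ h (c + t • horizPart x) (horizPart x) = 0 := by
    intro t
    set y := c + t • horizPart x with hy
    have hyh : horizPart y = t • horizPart x := hray t
    rcases eq_or_ne t 0 with ht | ht
    · -- on the axis: `g` is axial, `Dh(c)[x_h] = ⟪g c, x_h⟫ = 0`
      have hyc : y = c := by rw [hy, ht, zero_smul, add_zero]
      have hgc : horizPart (g c) = 0 :=
        horizPart_verticalIntegral_eq_zero_of_horizPart_eq_zero hUc hper hsym hc0
      rw [hhD, hyh, ht, zero_smul, inner_zero_left, zero_add, horizPart_horizPart, hyc,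
        real_inner_comm, ← inner_horizPart_horizPart, hgc, inner_zero_right]
    · -- off the axis: `t · Dh(y)[x_h] = ⟪Dg y_h, y_h⟫ + ⟪y_h, g⟫ = 0` up to the factor `t`
      have hk := key y
      rw [hyh] at hk
      simp only [map_smul, real_inner_smul_left, real_inner_smul_right] at hk
      have e3 : ⟪horizPart x, fderiv ℝ g y (horizPart x)⟫ = ⟪fderiv ℝ g y (horizPart x), horizPart x⟫ :=
        real_inner_comm _ _
      have e4 : ⟪g y, horizPart x⟫ = ⟪horizPart x, g y⟫ := real_inner_comm _ _
      rw [hhD, hyh, real_inner_smul_left, horizPart_horizPart, e3, e4]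
      have h0 : t * (t * ⟪fderiv ℝ g y (horizPart x), horizPart x⟫ + ⟪horizPart x, g y⟫) = 0 := by
        linear_combination hk
      rcases mul_eq_zero.1 h0 with h1 | h1
      · exact absurd h1 ht
      · exact h1
  have hψconst : ψ 1 = ψ 0 :=
    is_const_of_deriv_eq_zero (fun t => (hψd t).differentiableAt)
      (fun t => by rw [(hψd t).deriv, hψ0 t]) 1 0
  have hψ0' : ψ 0 = 0 := by
    simp only [hψ, zero_smul, add_zero, hh, hc0, inner_zero_left]
  have hψ1 : ψ 1 = ∫ s in (0 : ℝ)..L, ⟪horizPart x, U (x + s • eZ)⟫ := by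
    have hxc : c + (1 : ℝ) • horizPart x = x := by
      rw [one_smul, hc, add_comm]; exact horizPart_add_apply_two_smul_eZ x
    simp only [hψ, hh, hxc, hg]
    show innerSL ℝ (horizPart x) (∫ s in (0 : ℝ)..L, U (x + s • eZ)) = _
    have hint : IntervalIntegrable (fun s : ℝ => U (x + s • eZ)) volume 0 L :=
      (hUc.comp (hline x)).intervalIntegrable _ _
    rw [← (innerSL ℝ (horizPart x)).intervalIntegral_comp_comm hint]
    simp only [innerSL_apply_apply]
  rw [← hψ1, hψconst, hψ0']

end Literature.Analysis.SteadySlabLiouville.HelicalSlab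

end Part9

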